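import Mathlib.Analysis.SpecialFunctions.Gamma.Deligne
import Mathlib.Analysis.CStarAlgebra.Classes
import Mathlib.MeasureTheory.Function.Holder
import Mathlib.Analysis.InnerProductSpace.Orthogonal
import Literature.Analysis.SpecialFunctions.GammaStirlingVertical
import Literature.Analysis.SpecialFunctions.GammaMultiplication
import Literature.NumberTheory.ConnesConsani2021.SemilocalSoninSpace
import Literature.NumberTheory.ConnesConsani2021.SchwartzKernels
import Literature.NumberTheory.LFunctions.RiemannSiegelPhase
import Literature.Analysis.Fourier.LpMultiplierDilation
import Literature.Analysis.Fourier.L2FourierReflection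
import Literature.NumberTheory.Automorphic.TateLocalFunctionalEquationReal
import Mathlib.MeasureTheory.Function.Jacobian
import HarnessLib

/-!
# Connes–Consani 2021 (JNT), *Quasi-inner functions and local factors*, §4–§5 — STATEMENT LAYER

LINE 1 — FRAMING: RH-FREE corpus literature (function theory of ratios of local factors and Sonin
spaces); no positivity statement, no statement about zeros of `ζ`; nothing here bears on the truth of
RH.  Cell `rh-crit/cc`, typer t18 (bears_on W-C/W-P, sequel typing, no leaf role).

Source: A. Connes, C. Consani, *Quasi-inner functions and local factors*, J. Number Theory **226**
(2021) 139–167 = arXiv:2008.10974 [bib: `ConnesConsani2021QuasiInner`]; locators `pNNNN:Lnn` are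
chunk:line of the materialised arXiv text.  This file types §4 «The product `ρ_∞ ∏ ρ_p` is
quasi-inner» and §5 «Quasi-inner functions and Sonin's space»; §2–§3 (the functions `ρ_∞`, `ρ_p`,
the disk picture `κ = ρ_∞ ∘ ψ`, the Hardy projection `𝒫` and the notion *quasi-inner*) are typed by
seat t17 in `QuasiInnerLocalFactors.lean` (disk model, `IsQuasiInner`, `IsQuasiInnerLeftHalfPlane`) and are
not restated here; the §4 operator statements that need them (Thm 4.1/4.4/4.8, Prop 4.5, the quasi-inner
clause of Lemma 4.7) are appended to this file once that vocabulary has landed.  The LINE model of §5.3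
(`L²(∂ℂ_−) = H²(ℂ_−) ⊕ H²(ℂ_+)`, p0016:L12) is typed here (part B below).

## What is here — part A (function-level layer; everything PROVED, no named facts)

* §4.1 **Lemma 4.2** (p0011:L25) Stirling on vertical lines `|Γ(a+it)| ∼ e^{σ_a(t)}`,
  `σ_a(t) = (a − ½) log|t| − (π/2)|t| + O(1)` — `lemma_4_2`, a corollary of the tree's uniform
  vertical Stirling estimate `GammaStirling.exists_abs_log_norm_Gamma_vertical_sub_le`.
* §4.2 **Lemma 4.3** (p0011:L69) `|ρ_∞(it)| = |t|^{-1/2} (2π coth(π|t|/2))^{1/2}` — `lemma_4_3`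
  (reflection formula).  Here `ρ_∞(z) = γ_∞(z)/γ_∞(1−z)`, `γ_∞(z) = π^{-z/2}Γ(z/2)` (eq. (1),
  p0003:L19; (2.1) p0005:L6) is written with Mathlib's `Complex.Gammaℝ` as
  `Gammaℝ z / Gammaℝ (1 − z)` (no new definition: t17 names this function).
* §4.3 **Lemma 4.6** (p0013:L78) the Gauss factors `γ_{m,k}(z) = Γ(z/(2m) + k/m)`,
  `φ_{m,k} = γ_{m,k}(z)/γ_{m,k}(1−z)` (eq. (4.5)): (i) `|φ_{m,k}(it)| = O(|t|^{-1/(2m)})`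
  (`lemma_4_6_i`, from the tree's sharp vertical ratio bound); (ii) `|φ_{m,k}(½+is)| = 1`
  (`lemma_4_6_ii_norm`) and the factorisation `∏_{k<m} φ_{m,k}(z) = (m/π)^{½−z} ρ_∞(z)`
  (`lemma_4_6_ii`, from the tree's `GaussMultiplicationFormula_holds`); the reality condition and
  `φ_{m,k}(1−z)φ_{m,k}(z) = 1` of the proof (p0014:L41–L46).
* **Lemma 4.7** (p0014:L48) `ρ_∞^{(m,k)}(z) = (π/m)^{1/(2m) − z/m} φ_{m,k}(z)`: the product over
  `k < m` equals `ρ_∞(z)` (`lemma_4_7_prod`) and each factor has modulus `1` on the critical line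
  (`lemma_4_7_norm`); the poles of `γ_{m,k}` are the progression `−2k − 2nm` (`gammaFactor_eq_zero_iff`,
  Mathlib's junk-zero convention at poles).  The clause «each `ρ_∞^{(m,k)}` is quasi-inner» waits for
  t17's `IsQuasiInner` (appended later as a named fact; not restated here).
* §5 **Definition 5.1** (p0015:L5) for `𝕂 = ℝ`, `α = e_ℝ`: `localSoninSpace` and the PROVED bridge
  `soninSpace 1 1 = evenPart ⊓ localSoninSpace` with the tree's `soninSpace` (CC 2021 Selecta
  Def. 4.4, the even Sonin space `S(1,1)` used in §5.2 p0015:L102).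
* §5.1 **Proposition 5.4** (p0015:L35) triangular unitaries, PROVED in C⋆-algebra generality
  (`prop_5_4`).
* §5.3 eq. (5.3) `N_F = ∏(1 − p^{z−1})`, `D_F = ∏(1 − p^{−z})` and **Lemma 5.6** (p0016:L14)
  `N_F ∈ H^∞(ℂ_−)`, `D_F ∈ H^∞(ℂ_+)` (`lemma_5_6`), with `H^∞` of the OPEN half-planes
  `Re z < ½`, `Re z > ½` as explicit predicates `IsHinftyLeft/Right`.

## What is here — part B (§5.2–§5.4 on the critical line; 1 named fact, rest PROVED)

* §5.2 the critical line `z(s) = ½ + is` (`critPt`), **`u_∞(s) = ρ_∞(½ + is)`** (p0015:L115) PROVED for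
  the tree's `u_∞ = archUnitary` (CC 2021 Selecta eq. (14), seat t1) — `archUnitary_eq_Gammaℝ_div` — and
  `|ρ_∞| = |ρ_p| = 1` on `∂ℂ_−`, continuity; the boundary functions `u(F) = ∏_{F ∪ {∞}} ρ_v`
  (`placeBoundaryFun`, `placeBoundary ∈ L^∞`) and `D(F,F′) = D_{F′∖F}` (`dBoundaryFun`, `dBoundary`),
  for `F : Finset Nat.Primes` (a finite set of places containing `∞` is `F ∪ {∞}`).
* §5.3 p0016:L12 the Hardy decomposition of `L²(∂ℂ_−)`, typed SPECTRALLY (Paley–Wiener, see the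
  section docstring): `hardyLeft = H²(ℂ_−) = 𝒫L²`, `hardyRight = H²(ℂ_+) = (1 − 𝒫)L²`, PROVED closed,
  orthogonal and each other's orthogonal complement; `hardyLeftProj = 𝒫`.
* **Definition 5.2** (p0015:L17) `soninSpaceOf u = S(u) = ker u₂₂ = {ξ ∈ H²(ℂ_+) | uξ ∈ H²(ℂ_−)}`
  (operator form `mem_soninSpaceOf_iff_ker`), `u ∈ L^∞` acting by Mathlib's Hölder product.
* **Theorem 5.3** (p0015:L22): (i) `thm_5_3_i` is a NAMED FACT (RH-FREE) REDUCED to Sonin's classical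
  theorem: `thm_5_3_i_of_not_finiteDimensional_soninSpace : ¬ FiniteDimensional ℂ (soninSpace 1 1) → thm_5_3_i`
  is PROVED (last section; `S(1,1) ↪ S(u(F))` linearly via `𝔽_μ ∘ w` and `D(∅,F)`); **(ii) is PROVED** (`thm_5_3_ii`): the range clause `thm_5_3_ii_mapsTo` (kept as a
  named statement, discharged by `thm_5_3_ii_mapsTo_holds` in the last section — `D_{F″}·H²(ℂ_+) ⊆ H²(ℂ_+)`,
  `N_{F″}·H²(ℂ_−) ⊆ H²(ℂ_−)` via «modulation = translation of the `L²` Fourier transform»,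
  `fourier_charLinfty_smul`, and `u(F′)D(F,F′) = N_{F′∖F}u(F)`), the injectivity clause
  (`dBoundary_smul_injective`), and the transitivity `D(F,F″) = D(F′,F″)D(F,F′)` behind «filtering
  inductive system» (`dBoundaryFun_sdiff_mul`).
* **Proposition 5.5** (p0015:L118) `(𝔽_μ ∘ w)(S(1,1)) = ker (ρ_∞)₂₂`: the named statement `prop_5_5`
  (the unitary `𝔽_μ ∘ w` of eqs. (5.1)–(5.2) typed as the relation `IsMellinLineImage`) is **PROVED**
  (`prop_5_5_holds`, last sections): half `P ↦ 1 − 𝒫` by the `L²` dilation law, `𝓕𝓕 = reflection` and the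
  substitution `v = e^x`; half `ker 𝒫̂₁ ↦ ker 𝒫ρ_∞` (CC 2021 Selecta Lemma 6) from Tate's local functional
  equation at the real place (tree theorem) on even Schwartz functions, by density.

## Deliberately NOT here

`ρ_p`, `κ`, `κ_p`, the disk Hardy space and its projection, `IsQuasiInner`, `ξ_n`, `η_n`, `U_±`, `V`, `B`,
`I` (§1–§3, seat t17: `QuasiInnerLocalFactors.lean`); Thm 4.1/4.4/4.8, Prop 4.5 and the quasi-inner
clause of Lemma 4.7 (appended over t17's `IsQuasiInnerLeftHalfPlane` / t4's `approxNumber` when landed);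
a multiplication OPERATOR `L^∞ → 𝓑(L²)` (t17's `mulOp`; here the Hölder product `u • ξ` suffices);
Def. 5.1 for a general local field (Mathlib has no `L²` Fourier transform on `ℚ_p`; the remark «the
`ℤ_p^*`-invariant part of `S(ℚ_p, e_p)` is one-dimensional» (p0015:L12) is prose without proof in print
and is not typed); anything about zeros of `ζ` or positivity.
-/

noncomputable section

open Complex Set Filter Finset MeasureTheory
open scoped Real ComplexConjugate FourierTransform InnerProductSpace ENNReal

namespace Literature.NumberTheory.ConnesConsani2021

namespace QuasiInner

open Literature.Analysis.SpecialFunctions Literature.NumberTheory.LFunctions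

/-! ## §4.1 `Γ(z)` on vertical lines -/

/-- **Lemma 4.2** (§4.1; arXiv chunk p0011:L25).  «On the vertical line `L_a = {Re z = a}`, `a ≥ 0`,
`|Γ(a + it)| ∼ exp(σ_a(t))`, `σ_a(t) = (a − ½) log|t| − (π/2)|t| + O(1)`.»  Typed as the two-sided
bound `|log ‖Γ(a+it)‖ − ((a − ½) log|t| − π|t|/2)| ≤ C` for `|t| ≥ 1`; PROVED (for every real `a`,
the printed `a ≥ 0` included) from the tree's uniform vertical Stirling estimate
`GammaStirling.exists_abs_log_norm_Gamma_vertical_sub_le`.  RH-FREE.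
[cite: ConnesConsani2021QuasiInner, Lemma 4.2 §4.1 (arXiv chunk p0011:L25)] -/
theorem lemma_4_2 (a : ℝ) :
    ∃ C : ℝ, ∀ t : ℝ, 1 ≤ |t| →
      |Real.log ‖Complex.Gamma ((a : ℂ) + t * I)‖ -
        ((a - 1 / 2) * Real.log |t| - π * |t| / 2)| ≤ C := by
  obtain ⟨C, -, hC⟩ := GammaStirling.exists_abs_log_norm_Gamma_vertical_sub_le a a
  exact ⟨C, fun t ht => hC a ⟨le_rfl, le_rfl⟩ t ht⟩

/-! ## §4.2 The modulus of `ρ_∞` on the imaginary axis -/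

/-- `‖Γ(it)‖² = π / (t sinh(πt))` for real `t ≠ 0` (reflection formula `Γ(z)Γ(1−z) = π/sin(πz)`
with `Γ(−it) = conj Γ(it)`; the computation of the proof of Lemma 4.3, p0011:L75–L85) — DLMF 5.4.3
`|Γ(iy)|² = π/(y sinh πy)`. [cite: DLMF, 5.4.3] -/
theorem norm_Gamma_mul_I_sq (t : ℝ) (ht : t ≠ 0) :
    ‖Complex.Gamma (t * I)‖ ^ 2 = π / (t * Real.sinh (π * t)) := by
  set s : ℂ := t * I with hs
  have hs0 : s ≠ 0 := by
    rw [hs]; exact mul_ne_zero (ofReal_ne_zero.mpr ht) I_ne_zero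
  have hconj : conj s = -s := by
    rw [hs, map_mul, conj_ofReal, conj_I]; ring
  -- `Γ(s) Γ(1 - s) = π / sin (π s)` and `Γ(1 - s) = (-s) Γ(-s) = (-s) conj (Γ s)`
  have hrefl := Complex.Gamma_mul_Gamma_one_sub s
  have h1s : Complex.Gamma (1 - s) = -s * conj (Complex.Gamma s) := by
    rw [← Complex.Gamma_conj, hconj, show (1 : ℂ) - s = -s + 1 by ring,
      Complex.Gamma_add_one _ (neg_ne_zero.mpr hs0)]
  have hsin : Complex.sin (π * s) = Real.sinh (π * t) * I := by
    rw [hs, show (π : ℂ) * (t * I) = ((π * t : ℝ) : ℂ) * I by push_cast; ring,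
      Complex.sin_mul_I, ofReal_sinh]
  have hnormSq : Complex.Gamma s * conj (Complex.Gamma s) = ((‖Complex.Gamma s‖ ^ 2 : ℝ) : ℂ) := by
    rw [mul_conj, normSq_eq_norm_sq]
  rw [h1s, hsin, show Complex.Gamma s * (-s * conj (Complex.Gamma s)) =
      -s * (Complex.Gamma s * conj (Complex.Gamma s)) by ring, hnormSq] at hrefl
  -- `hrefl : -s * ‖Γ s‖² = π / (sinh(πt) I)`; solve for `‖Γ s‖²`
  have hsinh : Real.sinh (π * t) ≠ 0 := by
    rw [Real.sinh_ne_zero]; positivity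
  have hden : (Real.sinh (π * t) : ℂ) * I ≠ 0 :=
    mul_ne_zero (ofReal_ne_zero.mpr hsinh) I_ne_zero
  rw [eq_div_iff hden] at hrefl
  have key : ((‖Complex.Gamma s‖ ^ 2 : ℝ) : ℂ) = ((π / (t * Real.sinh (π * t)) : ℝ) : ℂ) := by
    rw [ofReal_div, ofReal_mul,
      eq_div_iff (mul_ne_zero (ofReal_ne_zero.mpr ht) (ofReal_ne_zero.mpr hsinh))]
    linear_combination hrefl +
      (((‖Complex.Gamma s‖ ^ 2 : ℝ) : ℂ) * (Real.sinh (π * t) : ℂ) * I) * hs +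
      (((‖Complex.Gamma s‖ ^ 2 : ℝ) : ℂ) * (Real.sinh (π * t) : ℂ) * (t : ℂ)) * I_mul_I
  exact_mod_cast key

/-- **Lemma 4.3** (§4.2; arXiv chunk p0011:L69).  «For any `t ∈ ℝ`,
`|ρ_∞(it)| = |t|^{-1/2} (2π coth(π|t|/2))^{1/2}`», with `ρ_∞(z) = γ_∞(z)/γ_∞(1−z)`,
`γ_∞(z) = π^{-z/2}Γ(z/2)` = Mathlib's `Gammaℝ`, i.e. `ρ_∞ z = Gammaℝ z / Gammaℝ (1 − z)`; `coth`
written `cosh/sinh`.  Typed for `t ≠ 0` (`t = 0` is the simple pole, p0011:L87).  PROVED (reflection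
formula, as in print).  RH-FREE. [cite: ConnesConsani2021QuasiInner, Lemma 4.3 §4.2 (arXiv chunk p0011:L69)] -/
theorem lemma_4_3 (t : ℝ) (ht : t ≠ 0) :
    ‖Gammaℝ (t * I) / Gammaℝ (1 - t * I)‖ =
      |t| ^ (-(1 / 2 : ℝ)) *
        Real.sqrt (2 * π * (Real.cosh (π * |t| / 2) / Real.sinh (π * |t| / 2))) := by
  set s : ℂ := t * I with hs
  -- reflection: `ρ_∞(s) = Γ_ℂ(s) cos(π s/2)`
  have hodd : ∀ n : ℕ, s ≠ -(2 * n + 1) := by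
    intro n h
    have := congrArg Complex.re h
    rw [hs] at this
    simp at this
    linarith
  have h1 : Gammaℝ s / Gammaℝ (1 - s) = Gammaℂ s * Complex.cos (π * s / 2) :=
    Gammaℝ_div_Gammaℝ_one_sub hodd
  -- the three moduli
  have hcos : Complex.cos (π * s / 2) = (Real.cosh (π * t / 2) : ℂ) := by
    rw [hs, show (π : ℂ) * (t * I) / 2 = ((π * t / 2 : ℝ) : ℂ) * I by push_cast; ring,
      Complex.cos_mul_I, ofReal_cosh]
  have hpow : ‖(2 * π : ℂ) ^ (-s)‖ = 1 := by
    rw [show (2 * π : ℂ) = ((2 * π : ℝ) : ℂ) by push_cast; ring,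
      norm_cpow_eq_rpow_re_of_pos (by positivity : (0 : ℝ) < 2 * π)]
    rw [hs]; simp
  have hGammaC : ‖Gammaℂ s‖ = 2 * ‖Complex.Gamma s‖ := by
    rw [Gammaℂ_def, norm_mul, norm_mul, hpow, mul_one]
    norm_num
  have hnorm : ‖Gammaℝ s / Gammaℝ (1 - s)‖ =
      2 * ‖Complex.Gamma s‖ * Real.cosh (π * t / 2) := by
    rw [h1, norm_mul, hGammaC, hcos, Complex.norm_real, Real.norm_eq_abs,
      abs_of_pos (Real.cosh_pos _)]
  -- square and compare
  have hL0 : 0 ≤ ‖Gammaℝ s / Gammaℝ (1 - s)‖ := norm_nonneg _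
  have hcoth0 : 0 < Real.cosh (π * |t| / 2) / Real.sinh (π * |t| / 2) :=
    div_pos (Real.cosh_pos _) (Real.sinh_pos_iff.mpr (by positivity))
  have hR0 : 0 ≤ |t| ^ (-(1 / 2 : ℝ)) *
      Real.sqrt (2 * π * (Real.cosh (π * |t| / 2) / Real.sinh (π * |t| / 2))) := by positivity
  rw [← sq_eq_sq₀ hL0 hR0, hnorm]
  have hsq : (2 * ‖Complex.Gamma s‖ * Real.cosh (π * t / 2)) ^ 2 =
      4 * ‖Complex.Gamma s‖ ^ 2 * Real.cosh (π * t / 2) ^ 2 := by ring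
  have hpow2 : (|t| ^ (-(1 / 2 : ℝ))) ^ 2 = |t|⁻¹ := by
    rw [← Real.rpow_two, ← Real.rpow_mul (abs_nonneg t)]
    norm_num [Real.rpow_neg_one]
  rw [hsq, hs, norm_Gamma_mul_I_sq t ht, mul_pow, Real.sq_sqrt (by positivity), hpow2]
  -- `sinh(πt) = 2 sinh(πt/2) cosh(πt/2)` and evenness in `t`
  have hdup : Real.sinh (π * t) = 2 * Real.sinh (π * t / 2) * Real.cosh (π * t / 2) := by
    rw [← Real.sinh_two_mul]; ring_nf
  have habs : t * Real.sinh (π * t / 2) = |t| * Real.sinh (π * |t| / 2) ∧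
      Real.cosh (π * t / 2) = Real.cosh (π * |t| / 2) := by
    rcases le_or_gt 0 t with h | h
    · rw [abs_of_nonneg h]; exact ⟨rfl, rfl⟩
    · rw [abs_of_neg h, show π * -t / 2 = -(π * t / 2) by ring, Real.sinh_neg, Real.cosh_neg]
      exact ⟨by ring, rfl⟩
  obtain ⟨hts, htc⟩ := habs
  have hsinh2 : Real.sinh (π * |t| / 2) ≠ 0 := by
    rw [Real.sinh_ne_zero]; positivity
  have hcosh : Real.cosh (π * t / 2) ≠ 0 := (Real.cosh_pos _).ne'
  have htabs : |t| ≠ 0 := abs_ne_zero.mpr ht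
  rw [hdup, htc]
  rw [show t * (2 * Real.sinh (π * t / 2) * Real.cosh (π * |t| / 2)) =
      2 * (t * Real.sinh (π * t / 2)) * Real.cosh (π * |t| / 2) by ring, hts]
  field_simp
  ring

/-! ## §4.3 Factorisation of `ρ_∞` (Gauss multiplication) -/

/-- `γ_{m,k}(z) := Γ(z/(2m) + k/m)` (Lemma 4.6, eq. (4.5); arXiv chunk p0013:L81), for `m ∈ ℕ`,
`k ∈ {0, …, m − 1}` (any `k : ℕ` allowed; `m = 0` is junk).
[cite: ConnesConsani2021QuasiInner, Lemma 4.6 eq. (4.5) (arXiv chunk p0013:L81)] -/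
def gammaFactor (m k : ℕ) (z : ℂ) : ℂ :=
  Complex.Gamma (z / (2 * (m : ℂ)) + (k : ℂ) / (m : ℂ))

/-- `φ_{m,k}(z) := γ_{m,k}(z) / γ_{m,k}(1 − z)` (Lemma 4.6, eq. (4.5); arXiv chunk p0013:L81).
[cite: ConnesConsani2021QuasiInner, Lemma 4.6 eq. (4.5) (arXiv chunk p0013:L81)] -/
def phiFactor (m k : ℕ) (z : ℂ) : ℂ :=
  gammaFactor m k z / gammaFactor m k (1 - z)

/-- Unfolding `gammaFactor`. [cite: ConnesConsani2021QuasiInner, Lemma 4.6 eq. (4.5) (arXiv chunk p0013:L81)] -/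
theorem gammaFactor_def (m k : ℕ) (z : ℂ) :
    gammaFactor m k z = Complex.Gamma (z / (2 * (m : ℂ)) + (k : ℂ) / (m : ℂ)) := rfl

/-- Unfolding `phiFactor`. [cite: ConnesConsani2021QuasiInner, Lemma 4.6 eq. (4.5) (arXiv chunk p0013:L81)] -/
theorem phiFactor_def (m k : ℕ) (z : ℂ) :
    phiFactor m k z = gammaFactor m k z / gammaFactor m k (1 - z) := rfl

/-- The poles of `γ_{m,k}` «form the arithmetic progression `z = −2k − 2nm`» (proof of Lemma 4.7,
p0014:L56); in Mathlib's convention `Γ` takes the junk value `0` exactly at its poles, so this reads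
`γ_{m,k}(z) = 0 ↔ ∃ n, z = −2k − 2nm` (`m ≥ 1`). [cite: ConnesConsani2021QuasiInner, Lemma 4.7 proof (arXiv chunk p0014:L56)] -/
theorem gammaFactor_eq_zero_iff {m : ℕ} (hm : 0 < m) (k : ℕ) (z : ℂ) :
    gammaFactor m k z = 0 ↔ ∃ n : ℕ, z = -2 * k - 2 * n * m := by
  have hm' : (m : ℂ) ≠ 0 := Nat.cast_ne_zero.mpr hm.ne'
  rw [gammaFactor, Complex.Gamma_eq_zero_iff]
  constructor
  · rintro ⟨n, hn⟩
    refine ⟨n, ?_⟩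
    have hz : z = 2 * (m : ℂ) * (z / (2 * (m : ℂ)) + (k : ℂ) / (m : ℂ)) - 2 * k := by
      field_simp
      ring
    rw [hz, hn]
    ring
  · rintro ⟨n, hn⟩
    refine ⟨n, ?_⟩
    rw [hn]
    field_simp
    ring

/-- `γ_{m,k}(conj z) = conj γ_{m,k}(z)` (`m`, `k` real), the «reality condition» of the proof of
Lemma 4.6 (p0014:L41). [cite: ConnesConsani2021QuasiInner, Lemma 4.6 proof (arXiv chunk p0014:L41)] -/
theorem gammaFactor_conj (m k : ℕ) (z : ℂ) :
    gammaFactor m k (conj z) = conj (gammaFactor m k z) := by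
  rw [gammaFactor, gammaFactor, ← Complex.Gamma_conj]
  congr 1
  simp only [map_add, map_div₀, map_mul, map_natCast, map_ofNat]

/-- Reality condition `φ_{m,k}(z̄) = conj φ_{m,k}(z)` (proof of Lemma 4.6 (ii), p0014:L41).
[cite: ConnesConsani2021QuasiInner, Lemma 4.6 proof (arXiv chunk p0014:L41)] -/
theorem phiFactor_conj (m k : ℕ) (z : ℂ) :
    phiFactor m k (conj z) = conj (phiFactor m k z) := by
  rw [phiFactor, phiFactor, map_div₀, ← gammaFactor_conj, ← gammaFactor_conj, map_sub, map_one]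

/-- `φ_{m,k}(1 − z) φ_{m,k}(z) = 1` «by construction» (proof of Lemma 4.6 (ii), p0014:L43), away
from the zeros/poles of `γ_{m,k}` at `z` and `1 − z` (where Mathlib's junk values intervene).
[cite: ConnesConsani2021QuasiInner, Lemma 4.6 proof (arXiv chunk p0014:L43)] -/
theorem phiFactor_one_sub_mul (m k : ℕ) {z : ℂ} (hz : gammaFactor m k z ≠ 0)
    (hz' : gammaFactor m k (1 - z) ≠ 0) :
    phiFactor m k (1 - z) * phiFactor m k z = 1 := by
  rw [phiFactor, phiFactor, sub_sub_cancel]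
  field_simp

/-- For `m ≥ 1`, `Re z > 0`: `γ_{m,k}(z) ≠ 0` — no pole, `Re(z/(2m) + k/m) > 0` (the poles are the
progression `−2k − 2nm`, proof of Lemma 4.7, p0014:L56). [cite: ConnesConsani2021QuasiInner, Lemma 4.7 proof (arXiv chunk p0014:L56)] -/
theorem gammaFactor_ne_zero_of_re_pos {m : ℕ} (hm : 0 < m) (k : ℕ) {z : ℂ} (hz : 0 < z.re) :
    gammaFactor m k z ≠ 0 := by
  rw [gammaFactor]
  apply Complex.Gamma_ne_zero_of_re_pos
  have hm' : (0 : ℝ) < m := Nat.cast_pos.mpr hm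
  rw [add_re, show z / (2 * (m : ℂ)) = z * (((2 * (m : ℝ))⁻¹ : ℝ) : ℂ) by
      push_cast; rw [div_eq_mul_inv],
    mul_comm, re_ofReal_mul,
    show (k : ℂ) / (m : ℂ) = (((k : ℝ) / m : ℝ) : ℂ) by push_cast; rfl, ofReal_re]
  have : 0 ≤ (k : ℝ) / m := by positivity
  have : 0 < (2 * (m : ℝ))⁻¹ * z.re := by positivity
  linarith

/-- **Lemma 4.6 (ii), modulus one on the critical line** (p0013:L86; proof p0014:L41–L46):
`|φ_{m,k}(½ + is)| = 1` for `s ∈ ℝ` (`m ≥ 1`).  PROVED: `1 − z = z̄` on the critical line and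
`φ_{m,k}(z̄) = conj φ_{m,k}(z)`.  RH-FREE. [cite: ConnesConsani2021QuasiInner, Lemma 4.6 (ii) (arXiv chunk p0013:L86)] -/
theorem lemma_4_6_ii_norm {m : ℕ} (hm : 0 < m) (k : ℕ) (s : ℝ) :
    ‖phiFactor m k (1 / 2 + s * I)‖ = 1 := by
  set z : ℂ := 1 / 2 + s * I with hz
  have hconj : (1 : ℂ) - z = conj z := by
    rw [hz, map_add, map_mul, conj_ofReal, conj_I, map_div₀, map_one, map_ofNat]
    ring
  have hne : gammaFactor m k z ≠ 0 :=
    gammaFactor_ne_zero_of_re_pos hm k (by norm_num [hz])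
  rw [phiFactor, hconj, gammaFactor_conj, norm_div, Complex.norm_conj, div_self]
  exact norm_ne_zero_iff.mpr hne

/-- **Lemma 4.6 (i)** (p0013:L84): «`|φ_{m,k}(it)| = O(|t|^{-1/(2m)})` when `|t| → ∞`» (`m ≥ 1`;
printed for `k ∈ {0,…,m−1}`, true for every `k`).  Typed as an explicit bound for `|t| ≥ 2m`.
PROVED from the tree's sharp vertical ratio bound `GammaStirling.exists_norm_Gamma_vertical_ratio_le`
(`|Γ(x₁+iu)| ≤ C|u|^{x₁−x₂}|Γ(x₂+iu)|`, `u = t/(2m)`, `x₁ = k/m`, `x₂ = k/m + 1/(2m)`), as in the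
printed proof via Lemma 4.2.  RH-FREE. [cite: ConnesConsani2021QuasiInner, Lemma 4.6 (i) (arXiv chunk p0013:L84)] -/
theorem lemma_4_6_i {m : ℕ} (hm : 0 < m) (k : ℕ) :
    ∃ C : ℝ, ∀ t : ℝ, 2 * (m : ℝ) ≤ |t| →
      ‖phiFactor m k (t * I)‖ ≤ C * |t| ^ (-(1 / (2 * (m : ℝ)))) := by
  have hm0 : (0 : ℝ) < m := Nat.cast_pos.mpr hm
  have h2m : (0 : ℝ) < 2 * m := by positivity
  set x₁ : ℝ := (k : ℝ) / m with hx₁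
  set x₂ : ℝ := (k : ℝ) / m + 1 / (2 * m) with hx₂
  obtain ⟨C, hC, hratio⟩ := GammaStirling.exists_norm_Gamma_vertical_ratio_le x₁ x₂
  have hδ : (0 : ℝ) < 1 / (2 * (m : ℝ)) := by positivity
  have hx₁mem : x₁ ∈ Icc x₁ x₂ := ⟨le_rfl, by linarith [hx₁, hx₂]⟩
  have hx₂mem : x₂ ∈ Icc x₁ x₂ := ⟨by linarith [hx₁, hx₂], le_rfl⟩
  refine ⟨C * (2 * (m : ℝ)) ^ (1 / (2 * (m : ℝ))), fun t ht => ?_⟩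
  set u : ℝ := t / (2 * m) with hu
  have hu1 : 1 ≤ |u| := by
    rw [hu, abs_div, abs_of_pos h2m, le_div_iff₀ h2m, one_mul]; exact ht
  have hu0 : 0 < |u| := by linarith
  -- numerator and denominator of `φ_{m,k}(it)` on the lines `Re = x₁`, `Re = x₂`
  have hnum : gammaFactor m k (t * I) = Complex.Gamma ((x₁ : ℂ) + u * I) := by
    rw [gammaFactor, hx₁, hu]; congr 1; push_cast; field_simp; ring
  have hden : gammaFactor m k (1 - t * I) = conj (Complex.Gamma ((x₂ : ℂ) + u * I)) := by
    rw [gammaFactor, ← Complex.Gamma_conj, hx₂, hu]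
    congr 1
    simp only [map_add, map_mul, conj_ofReal, conj_I]
    push_cast; field_simp; ring
  have hΓ₂ : Complex.Gamma ((x₂ : ℂ) + u * I) ≠ 0 := by
    apply Complex.Gamma_ne_zero_of_re_pos
    simp [hx₂]; positivity
  have hΓ₂pos : 0 < ‖Complex.Gamma ((x₂ : ℂ) + u * I)‖ := norm_pos_iff.mpr hΓ₂
  rw [phiFactor, hnum, hden, norm_div, Complex.norm_conj, div_le_iff₀ hΓ₂pos]
  have h := hratio x₁ hx₁mem x₂ hx₂mem u hu1
  have hexp : x₁ - x₂ = -(1 / (2 * (m : ℝ))) := by rw [hx₁, hx₂]; ring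
  rw [hexp] at h
  -- `|u|^{-1/(2m)} = (2m)^{1/(2m)} |t|^{-1/(2m)}`
  have hut : |u| ^ (-(1 / (2 * (m : ℝ)))) =
      (2 * (m : ℝ)) ^ (1 / (2 * (m : ℝ))) * |t| ^ (-(1 / (2 * (m : ℝ)))) := by
    rw [hu, abs_div, abs_of_pos h2m, Real.div_rpow (abs_nonneg t) h2m.le, Real.rpow_neg h2m.le,
      div_eq_mul_inv, inv_inv, mul_comm]
  calc ‖Complex.Gamma ((x₁ : ℂ) + u * I)‖
      ≤ C * |u| ^ (-(1 / (2 * (m : ℝ)))) * ‖Complex.Gamma ((x₂ : ℂ) + u * I)‖ := h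
    _ = C * (2 * (m : ℝ)) ^ (1 / (2 * (m : ℝ))) * |t| ^ (-(1 / (2 * (m : ℝ)))) *
          ‖Complex.Gamma ((x₂ : ℂ) + u * I)‖ := by rw [hut]; ring

/-- `∏_{k<m} γ_{m,k}(z) = Γ(z/2) · m^{−z/2} · √m (2π)^{(m−1)/2}` (`m ≥ 1`, all `z`): Gauss's
multiplication formula at `w = z/(2m)`, in the pole-free inverse form of the tree
(`GaussMultiplication.complex_inv_formula`); step of the proof of Lemma 4.6 (ii) (p0014:L25–L33).
[cite: ConnesConsani2021QuasiInner, Lemma 4.6 proof (arXiv chunk p0014:L25)] -/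
theorem prod_gammaFactor {m : ℕ} (hm : 0 < m) (z : ℂ) :
    ∏ k ∈ Finset.range m, gammaFactor m k z =
      Complex.Gamma (z / 2) * ((m : ℂ) ^ (z / 2))⁻¹ *
        ((Real.sqrt m : ℂ) * (2 * (π : ℂ)) ^ (((m : ℂ) - 1) / 2)) := by
  have hm0 : m ≠ 0 := hm.ne'
  have hm' : (m : ℂ) ≠ 0 := Nat.cast_ne_zero.mpr hm0
  have H := GaussMultiplication.complex_inv_formula hm0 (z / (2 * (m : ℂ)))
  have hmw : (m : ℂ) * (z / (2 * (m : ℂ))) = z / 2 := by field_simp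
  rw [hmw] at H
  have H' := congrArg Inv.inv H
  rw [Finset.prod_inv_distrib, inv_inv, mul_inv, mul_inv, inv_inv, inv_inv] at H'
  rw [show (∏ k ∈ Finset.range m, gammaFactor m k z) =
      ∏ k ∈ Finset.range m, Complex.Gamma (z / (2 * (m : ℂ)) + k / m) from rfl, H']

/-- **Lemma 4.6 (ii), factorisation** (eq. (4.6), p0013:L88): for `m ≥ 1` and all `z ∈ ℂ`,
`∏_{k=0}^{m−1} φ_{m,k}(z) = (m/π)^{½ − z} ρ_∞(z)` with `ρ_∞(z) = Gammaℝ z / Gammaℝ (1 − z)`.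
PROVED from Gauss's multiplication theorem (tree: `GaussMultiplicationFormula_holds` /
`GaussMultiplication.complex_inv_formula`), as in print; holds at the poles too with Mathlib's junk
conventions (`Γ(pole) = 0`, `x/0 = 0`).  RH-FREE. [cite: ConnesConsani2021QuasiInner, Lemma 4.6 (ii) eq. (4.6) (arXiv chunk p0013:L88)] -/
theorem lemma_4_6_ii {m : ℕ} (hm : 0 < m) (z : ℂ) :
    ∏ k ∈ Finset.range m, phiFactor m k z =
      ((m : ℂ) / π) ^ (1 / 2 - z) * (Gammaℝ z / Gammaℝ (1 - z)) := by
  have hm' : (m : ℂ) ≠ 0 := Nat.cast_ne_zero.mpr hm.ne'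
  have hπ : (π : ℂ) ≠ 0 := ofReal_ne_zero.mpr Real.pi_pos.ne'
  set C : ℂ := (Real.sqrt m : ℂ) * (2 * (π : ℂ)) ^ (((m : ℂ) - 1) / 2) with hC
  have hC0 : C ≠ 0 := by
    refine mul_ne_zero ?_ (Complex.cpow_ne_zero_iff.mpr (Or.inl (mul_ne_zero two_ne_zero hπ)))
    exact ofReal_ne_zero.mpr (Real.sqrt_pos.mpr (Nat.cast_pos.mpr hm)).ne'
  simp only [phiFactor]
  rw [Finset.prod_div_distrib, prod_gammaFactor hm z, prod_gammaFactor hm (1 - z)]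
  -- both sides are `Γ(z/2) (Γ((1−z)/2))⁻¹ · m^{½−z}`
  have hmpow : ((m : ℂ) ^ (z / 2))⁻¹ / ((m : ℂ) ^ ((1 - z) / 2))⁻¹ = (m : ℂ) ^ (1 / 2 - z) := by
    rw [inv_div_inv, ← Complex.cpow_sub _ _ hm']
    congr 1; ring
  have hbase : ((m : ℂ) / π) ^ (1 / 2 - z) = (m : ℂ) ^ (1 / 2 - z) * ((π : ℂ) ^ (1 / 2 - z))⁻¹ := by
    rw [div_eq_mul_inv, show ((m : ℂ) * (π : ℂ)⁻¹) = ((m : ℝ) : ℂ) * (((π⁻¹ : ℝ)) : ℂ) by push_cast; rfl,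
      Complex.mul_cpow_ofReal_nonneg (Nat.cast_nonneg m) (inv_nonneg.mpr Real.pi_pos.le),
      ofReal_inv, Complex.inv_cpow _ _ (by rw [arg_ofReal_of_nonneg Real.pi_pos.le]; exact Real.pi_pos.ne)]
    push_cast; rfl
  have hGammaR : Gammaℝ z / Gammaℝ (1 - z) =
      (π : ℂ) ^ (1 / 2 - z) * (Complex.Gamma (z / 2) / Complex.Gamma ((1 - z) / 2)) := by
    rw [Gammaℝ_def, Gammaℝ_def, mul_div_mul_comm, ← Complex.cpow_sub _ _ hπ]
    congr 2; ring
  rw [mul_div_mul_comm, mul_div_mul_comm, hmpow, div_self hC0, mul_one, hbase, hGammaR]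
  have hπpow : ((π : ℂ) ^ (1 / 2 - z))⁻¹ * (π : ℂ) ^ (1 / 2 - z) = 1 :=
    inv_mul_cancel₀ (Complex.cpow_ne_zero_iff.mpr (Or.inl hπ))
  linear_combination (-(Complex.Gamma (z / 2) / Complex.Gamma ((1 - z) / 2) * (m : ℂ) ^ (1 / 2 - z))) * hπpow

/-- `ρ_∞^{(m,k)}(z) := (π/m)^{1/(2m) − z/m} φ_{m,k}(z)` (Lemma 4.7, eq. (4.7); arXiv chunk p0014:L51).
[cite: ConnesConsani2021QuasiInner, Lemma 4.7 eq. (4.7) (arXiv chunk p0014:L51)] -/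
def rhoFactor (m k : ℕ) (z : ℂ) : ℂ :=
  ((π : ℂ) / m) ^ (1 / (2 * (m : ℂ)) - z / m) * phiFactor m k z

/-- Unfolding `rhoFactor`. [cite: ConnesConsani2021QuasiInner, Lemma 4.7 eq. (4.7) (arXiv chunk p0014:L51)] -/
theorem rhoFactor_def (m k : ℕ) (z : ℂ) :
    rhoFactor m k z = ((π : ℂ) / m) ^ (1 / (2 * (m : ℂ)) - z / m) * phiFactor m k z := rfl

/-- **Lemma 4.7, product** (p0014:L54): «their product is equal to `ρ_∞(z)`»:
`∏_{k<m} ρ_∞^{(m,k)}(z) = Gammaℝ z / Gammaℝ (1 − z)` for `m ≥ 1`, all `z`.  PROVED from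
`lemma_4_6_ii`.  RH-FREE. [cite: ConnesConsani2021QuasiInner, Lemma 4.7 (arXiv chunk p0014:L54)] -/
theorem lemma_4_7_prod {m : ℕ} (hm : 0 < m) (z : ℂ) :
    ∏ k ∈ Finset.range m, rhoFactor m k z = Gammaℝ z / Gammaℝ (1 - z) := by
  have hm' : (m : ℂ) ≠ 0 := Nat.cast_ne_zero.mpr hm.ne'
  have hπ : (π : ℂ) ≠ 0 := ofReal_ne_zero.mpr Real.pi_pos.ne'
  simp only [rhoFactor]
  rw [Finset.prod_mul_distrib, Finset.prod_const, Finset.card_range, lemma_4_6_ii hm z,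
    ← Complex.cpow_nat_mul]
  have hexp : (m : ℂ) * (1 / (2 * (m : ℂ)) - z / m) = 1 / 2 - z := by field_simp
  rw [hexp, ← mul_assoc]
  have hinv : ((π : ℂ) / m) ^ (1 / 2 - z) * ((m : ℂ) / π) ^ (1 / 2 - z) = 1 := by
    rw [show ((π : ℂ) / m) = (((m : ℂ) / π))⁻¹ by rw [inv_div],
      Complex.inv_cpow _ _ ?_, inv_mul_cancel₀]
    · exact Complex.cpow_ne_zero_iff.mpr (Or.inl (div_ne_zero hm' hπ))
    · rw [show ((m : ℂ) / π) = (((m : ℝ) / π : ℝ) : ℂ) by push_cast; rfl,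
        arg_ofReal_of_nonneg (by positivity)]
      exact Real.pi_pos.ne
  rw [hinv, one_mul]

/-- **Lemma 4.7, modulus one on `∂ℂ_−`** (proof, p0014:L56: «each has absolute value `1` on `∂ℂ_−`»):
`|ρ_∞^{(m,k)}(½ + is)| = 1` (`m ≥ 1`).  PROVED.  RH-FREE.
[cite: ConnesConsani2021QuasiInner, Lemma 4.7 proof (arXiv chunk p0014:L56)] -/
theorem lemma_4_7_norm {m : ℕ} (hm : 0 < m) (k : ℕ) (s : ℝ) :
    ‖rhoFactor m k (1 / 2 + s * I)‖ = 1 := by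
  have hm0 : (0 : ℝ) < m := Nat.cast_pos.mpr hm
  rw [rhoFactor, norm_mul, lemma_4_6_ii_norm hm k s, mul_one,
    show ((π : ℂ) / m) = (((π / m : ℝ)) : ℂ) by push_cast; rfl,
    norm_cpow_eq_rpow_re_of_pos (by positivity)]
  have hre : (1 / (2 * (m : ℂ)) - (1 / 2 + s * I) / m).re = 0 := by
    have : (1 / (2 * (m : ℂ)) - (1 / 2 + s * I) / m) = ((-(s / m) : ℝ) : ℂ) * I := by
      push_cast; field_simp; ring
    rw [this, re_ofReal_mul, I_re, mul_zero]
  rw [hre, Real.rpow_zero]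


/-! ## §5 Definition 5.1 — the local Sonin space, case `𝕂 = ℝ` -/

/-- A.e.-implications on an open versus a closed interval agree (the endpoints are Lebesgue-null);
used to match the printed strict inequality `|x| < 1` of Def. 5.1 with the tree's `vanishOn`
(closed interval). [folklore] -/
private theorem ae_imp_Ioo_iff_Icc {P : ℝ → Prop} (a b : ℝ) :
    (∀ᵐ x : ℝ, x ∈ Ioo a b → P x) ↔ (∀ᵐ x : ℝ, x ∈ Icc a b → P x) := by
  have h : ∀ᵐ x : ℝ, x ∈ Ioo a b ↔ x ∈ Icc a b := by
    filter_upwards [(Ioo_ae_eq_Icc : Ioo a b =ᵐ[(volume : Measure ℝ)] Icc a b)] with x hx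
    exact eq_iff_iff.mp hx
  constructor <;> intro hP <;> filter_upwards [hP, h] with x hx hiff hmem
  · exact hx (hiff.mpr hmem)
  · exact hx (hiff.mp hmem)

/-- **Definition 5.1** (§5; arXiv chunk p0015:L5) for the local field `𝕂 = ℝ` with its standard
additive character `α = e_ℝ` (so that `𝔽_α` is Mathlib's `L²` Fourier transform `𝓕`, kernel
`e^{−2πixy}`, as in the tree's `soninSpace`): the Sonin space
`S(ℝ, e_ℝ) := {f ∈ L²(ℝ) | f(x) = 0 and (𝔽_α f)(x) = 0 for all x, |x| < 1}`
(«for all» read almost everywhere, `f` being an `L²` class).  Built from the tree's `vanishOn 1`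
(CC 2021 / CCM 2024 vocabulary); the printed open-ball form is `mem_localSoninSpace_iff`.  NOT the
even subspace: CC 2021's `S(1,1) ⊂ L²(ℝ)_ev` (§5.2, p0015:L102) is its even part
(`soninSpace_one_one_eq_evenPart_inf`).  General local fields `𝕂` are not typed (no `L²` Fourier
transform on `ℚ_p` in Mathlib). [cite: ConnesConsani2021QuasiInner, Def. 5.1 (arXiv chunk p0015:L5)] -/
def localSoninSpace : Submodule ℂ (Lp ℂ 2 (volume : Measure ℝ)) :=
  vanishOn 1 ⊓ (vanishOn 1).comap
    ((Lp.fourierTransformₗᵢ ℝ ℂ).toLinearEquiv :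
      Lp ℂ 2 (volume : Measure ℝ) →ₗ[ℂ] Lp ℂ 2 (volume : Measure ℝ))

/-- `f ∈ S(ℝ, e_ℝ) ↔ f ∈ vanishOn 1 ∧ 𝓕 f ∈ vanishOn 1` (bookkeeping).
[cite: ConnesConsani2021QuasiInner, Def. 5.1 (arXiv chunk p0015:L5)] -/
theorem mem_localSoninSpace_iff' (f : Lp ℂ 2 (volume : Measure ℝ)) :
    f ∈ localSoninSpace ↔ f ∈ vanishOn 1 ∧ (𝓕 f : Lp ℂ 2 (volume : Measure ℝ)) ∈ vanishOn 1 :=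
  Iff.rfl

/-- **Definition 5.1 as printed** (`𝕂 = ℝ`): `f ∈ S(ℝ, e_ℝ)` iff `f(x) = 0` and `(𝓕 f)(x) = 0` for
a.e. `x` with `|x| < 1`. [cite: ConnesConsani2021QuasiInner, Def. 5.1 (arXiv chunk p0015:L5)] -/
theorem mem_localSoninSpace_iff (f : Lp ℂ 2 (volume : Measure ℝ)) :
    f ∈ localSoninSpace ↔
      (∀ᵐ x : ℝ, x ∈ Ioo (-1 : ℝ) 1 → (f : ℝ → ℂ) x = 0) ∧
      (∀ᵐ x : ℝ, x ∈ Ioo (-1 : ℝ) 1 → ((𝓕 f : Lp ℂ 2 (volume : Measure ℝ)) : ℝ → ℂ) x = 0) := by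
  rw [mem_localSoninSpace_iff', mem_vanishOn_iff, mem_vanishOn_iff, ae_imp_Ioo_iff_Icc,
    ae_imp_Ioo_iff_Icc]

/-- **Bridge with CC 2021 Selecta Def. 4.4**: the tree's Sonin space `S(1,1) = soninSpace 1 1`
(even functions vanishing with their Fourier transform on `[−1,1]`; «Sonin's space of even
functions» of §5.2, p0015:L102) is the even part of the local Sonin space `S(ℝ, e_ℝ)` of Def. 5.1.
PROVED (definitional bookkeeping). [cite: ConnesConsani2021QuasiInner, §5.2 (arXiv chunk p0015:L102)] -/
theorem soninSpace_one_one_eq_evenPart_inf : soninSpace 1 1 = evenPart ⊓ localSoninSpace := by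
  ext ξ
  rw [mem_soninSpace_iff', Submodule.mem_inf, mem_localSoninSpace_iff']

/-! ## §5.1 Triangular unitaries (Proposition 5.4) -/

/-- **Proposition 5.4** (§5.1 Triangular unitaries; arXiv chunk p0015:L35).  «Let
`U = [[u₁₁, u₁₂], [0, u₂₂]]` be a triangular matrix of operators, then `U` is unitary if and only if
(1) `u₁₁` is an isometry, (2) `u₂₂` is a coisometry, (3) `u₁₂` is a partial isometry from the kernel
of `u₂₂` to the cokernel of `u₁₁`.»  Typed intrinsically in a unital C⋆-algebra `A` (the paper uses it
for bounded operators on `L²` and, «modulo compact operators», in the Calkin algebra, p0015:L33): the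
`2 × 2` decomposition is given by a projection `P` (`P² = P = P*`; `Q := 1 − P`; in print `P = 𝒫`, the
Hardy projection), «triangular» is `Q U P = 0`, the corners are `u₁₁ = P U P`, `u₁₂ = P U Q`,
`u₂₂ = Q U Q` (elements of `A` vanishing on the complementary summand), and (1)–(3) read:
(1) `u₁₁* u₁₁ = P`; (2) `u₂₂ u₂₂* = Q`; (3) `u₁₂* u₁₂ = Q − u₂₂* u₂₂` and `u₁₂ u₁₂* = P − u₁₁ u₁₁*`,
i.e. `u₁₂` is a partial isometry with initial projection the projection `Q − u₂₂* u₂₂` onto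
`ker u₂₂ ⊆ QH` (by (2)) and final projection `P − u₁₁ u₁₁*` onto `coker u₁₁ ⊆ PH` (by (1)).  PROVED: the
block computation of the printed proof (p0015:L48–L94), plus the C⋆-identity for the two cross terms
`u₁₁* u₁₂ = 0`, `u₁₂ u₂₂* = 0` that the printed «iff» leaves implicit.  RH-FREE.
[cite: ConnesConsani2021QuasiInner, Prop. 5.4 §5.1 (arXiv chunk p0015:L35)] -/
theorem prop_5_4 {A : Type*} [NormedRing A] [StarRing A] [CStarRing A] {P U : A}
    (hP2 : P * P = P) (hPsa : star P = P) (htri : (1 - P) * U * P = 0) :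
    U ∈ unitary A ↔
      star (P * U * P) * (P * U * P) = P ∧
      (1 - P) * U * (1 - P) * star ((1 - P) * U * (1 - P)) = 1 - P ∧
      star (P * U * (1 - P)) * (P * U * (1 - P)) =
          (1 - P) - star ((1 - P) * U * (1 - P)) * ((1 - P) * U * (1 - P)) ∧
      P * U * (1 - P) * star (P * U * (1 - P)) = P - P * U * P * star (P * U * P) := by
  -- opaque names: `Q = 1 - P`, corners `a = PUP`, `b = PUQ`, `d = QUQ`
  obtain ⟨Q, hQ⟩ : ∃ Q : A, Q = 1 - P := ⟨_, rfl⟩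
  rw [← hQ] at htri ⊢
  obtain ⟨a, ha⟩ : ∃ a : A, a = P * U * P := ⟨_, rfl⟩
  obtain ⟨b, hb⟩ : ∃ b : A, b = P * U * Q := ⟨_, rfl⟩
  obtain ⟨d, hd⟩ : ∃ d : A, d = Q * U * Q := ⟨_, rfl⟩
  rw [← ha, ← hb, ← hd, Unitary.mem_iff]
  -- projection calculus
  have hQ2 : Q * Q = Q := by
    simp only [hQ, mul_sub, sub_mul, one_mul, mul_one, hP2]; abel
  have hPQ : P * Q = 0 := by simp only [hQ, mul_sub, mul_one, hP2, sub_self]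
  have hQP : Q * P = 0 := by simp only [hQ, sub_mul, one_mul, hP2, sub_self]
  have hPQ1 : P + Q = 1 := by simp only [hQ, add_sub_cancel]
  have hQsa : star Q = Q := by simp only [hQ, star_sub, star_one, hPsa]
  -- decomposition `U = a + b + d`
  have hU : U = a + b + d := by
    have h1 : U = (P + Q) * U * (P + Q) := by rw [hPQ1, one_mul, mul_one]
    rw [h1, add_mul, add_mul, mul_add, mul_add, htri, zero_add, ha, hb, hd]
  have hUstar : star U = star a + star b + star d := by
    rw [hU, star_add, star_add]
  -- absorption rules for the corners
  have haP : a * P = a := by rw [ha, mul_assoc, hP2]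
  have hPa : P * a = a := by rw [ha, ← mul_assoc, ← mul_assoc, hP2]
  have hbQ : b * Q = b := by rw [hb, mul_assoc, hQ2]
  have hPb : P * b = b := by rw [hb, ← mul_assoc, ← mul_assoc, hP2]
  have hdQ : d * Q = d := by rw [hd, mul_assoc, hQ2]
  have hQd : Q * d = d := by rw [hd, ← mul_assoc, ← mul_assoc, hQ2]
  have haQ : a * Q = 0 := by rw [← haP, mul_assoc, hPQ, mul_zero]
  have hQa : Q * a = 0 := by rw [← hPa, ← mul_assoc, hQP, zero_mul]
  have hbP : b * P = 0 := by rw [← hbQ, mul_assoc, hQP, mul_zero]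
  have hQb : Q * b = 0 := by rw [← hPb, ← mul_assoc, hQP, zero_mul]
  have hdP : d * P = 0 := by rw [← hdQ, mul_assoc, hQP, mul_zero]
  have hPd : P * d = 0 := by rw [← hQd, ← mul_assoc, hPQ, zero_mul]
  -- starred absorption rules
  have star_rule : ∀ {x y z : A}, x * y = z → star y * star x = star z := by
    intro x y z h; rw [← star_mul, h]
  have hsaP : star a * P = star a := by simpa only [hPsa] using star_rule hPa
  have hPsa' : P * star a = star a := by simpa only [hPsa] using star_rule haP
  have hQsb : Q * star b = star b := by simpa only [hQsa] using star_rule hbQ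
  have hsbP : star b * P = star b := by simpa only [hPsa] using star_rule hPb
  have hsdQ : star d * Q = star d := by simpa only [hQsa] using star_rule hQd
  have hQsd : Q * star d = star d := by simpa only [hQsa] using star_rule hdQ
  have hsaQ : star a * Q = 0 := by rw [← hsaP, mul_assoc, hPQ, mul_zero]
  have hQsa' : Q * star a = 0 := by rw [← hPsa', ← mul_assoc, hQP, zero_mul]
  have hsbQ : star b * Q = 0 := by rw [← hsbP, mul_assoc, hPQ, mul_zero]
  have hPsb : P * star b = 0 := by rw [← hQsb, ← mul_assoc, hPQ, zero_mul]
  have hsdP : star d * P = 0 := by rw [← hsdQ, mul_assoc, hQP, mul_zero]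
  have hPsd : P * star d = 0 := by rw [← hQsd, ← mul_assoc, hPQ, zero_mul]
  -- right-nested ("continuation") forms of the prefix rules
  have cont : ∀ {x y z : A}, x * y = z → ∀ w : A, x * (y * w) = z * w :=
    fun h w => by rw [← mul_assoc, h]
  -- vanishing cross products
  have z1 : star a * d = 0 := by rw [← hsaP, mul_assoc, hPd, mul_zero]
  have z2 : star b * d = 0 := by rw [← hsbP, mul_assoc, hPd, mul_zero]
  have z3 : star d * a = 0 := by rw [← hsdQ, mul_assoc, hQa, mul_zero]
  have z4 : star d * b = 0 := by rw [← hsdQ, mul_assoc, hQb, mul_zero]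
  have z5 : a * star b = 0 := by rw [← haP, mul_assoc, hPsb, mul_zero]
  have z6 : a * star d = 0 := by rw [← haP, mul_assoc, hPsd, mul_zero]
  have z7 : b * star a = 0 := by rw [← hbQ, mul_assoc, hQsa', mul_zero]
  have z8 : d * star a = 0 := by rw [← hdQ, mul_assoc, hQsa', mul_zero]
  -- the two products
  have hX : star U * U = star a * a + star a * b + star b * a + star b * b + star d * d := by
    rw [hUstar, hU]
    simp only [add_mul, mul_add, z1, z2, z3, z4, add_zero]
    abel
  have hY : U * star U = a * star a + b * star b + b * star d + d * star b + d * star d := by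
    rw [hUstar, hU]
    simp only [add_mul, mul_add, z5, z6, z7, z8, add_zero, zero_add]
    abel
  constructor
  · -- (⇒) corner extraction
    rintro ⟨h1, h2⟩
    rw [hX] at h1
    rw [hY] at h2
    have c1 := congrArg (fun x => P * x * P) h1
    have c2 := congrArg (fun x => Q * x * Q) h1
    have c3 := congrArg (fun x => P * x * P) h2
    have c4 := congrArg (fun x => Q * x * Q) h2
    simp only [mul_add, add_mul, mul_assoc, mul_one, hP2, hQ2, haP, hbP, haQ,
      hbQ, hdQ, hsaP, hsbP, hsdP, hsaQ, hsbQ, hsdQ, cont hPsa', cont hPsb, cont hPsd,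
      cont hQsa', cont hQsb, cont hQsd, cont hPa, cont hPb, cont hPd, cont hQb, cont hQd,
      mul_zero, zero_mul, add_zero, zero_add] at c1 c2 c3 c4
    refine ⟨c1, c4, ?_, ?_⟩
    · rw [← c2]; abel
    · rw [← c3]; abel
  · -- (⇐) the two cross terms vanish by the C⋆-identity
    rintro ⟨h1, h2, h3, h4⟩
    -- `R = P − a a*` is a projection with `R b = b`, whence `a* b = 0`
    obtain ⟨R, hR⟩ : ∃ R : A, R = P - a * star a := ⟨_, rfl⟩
    have h4' : b * star b = R := by rw [hR]; exact h4
    have hRsa : star R = R := by rw [hR, star_sub, hPsa, star_mul, star_star]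
    have hR2 : R * R = R := by
      rw [hR]
      simp only [mul_sub, sub_mul, mul_assoc, hP2, cont hPa, hsaP, cont h1, hPsa']
      abel
    have hx : (b - R * b) * star (b - R * b) = 0 := by
      rw [star_sub, star_mul, hRsa]
      simp only [mul_sub, sub_mul, mul_assoc, h4', cont h4', hR2]
      abel
    have hb' : b = R * b := by
      have := (CStarRing.mul_star_self_eq_zero_iff _).mp hx
      rwa [sub_eq_zero] at this
    have haR : star a * R = 0 := by
      rw [hR, mul_sub, hsaP, ← mul_assoc, h1, hPsa', sub_self]
    have hab : star a * b = 0 := by rw [hb', ← mul_assoc, haR, zero_mul]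
    have hba : star b * a = 0 := by
      simpa only [star_mul, star_star, star_zero] using congrArg star hab
    -- `R' = Q − d* d` is a projection with `b R' = b`, whence `b d* = 0`
    obtain ⟨R', hR'⟩ : ∃ R' : A, R' = Q - star d * d := ⟨_, rfl⟩
    have h3' : star b * b = R' := by rw [hR']; exact h3
    have hR'sa : star R' = R' := by rw [hR', star_sub, hQsa, star_mul, star_star]
    have hR'2 : R' * R' = R' := by
      rw [hR']
      simp only [mul_sub, sub_mul, mul_assoc, hQ2, cont hQsd, hdQ, cont h2, hQd]
      abel
    have hy : star (b - b * R') * (b - b * R') = 0 := by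
      rw [star_sub, star_mul, hR'sa]
      simp only [mul_sub, sub_mul, mul_assoc, h3', cont h3', hR'2]
      abel
    have hb'' : b = b * R' := by
      have := (CStarRing.star_mul_self_eq_zero_iff _).mp hy
      rwa [sub_eq_zero] at this
    have hRd : R' * star d = 0 := by
      rw [hR', sub_mul, hQsd, mul_assoc, h2, hsdQ, sub_self]
    have hbd : b * star d = 0 := by rw [hb'', mul_assoc, hRd, mul_zero]
    have hdb : d * star b = 0 := by
      simpa only [star_mul, star_star, star_zero] using congrArg star hbd
    constructor
    · rw [hX, h1, hab, hba, h3, add_zero, add_zero, ← hPQ1]; abel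
    · rw [hY, h4, hbd, hdb, h2, add_zero, add_zero, ← hPQ1]; abel

/-! ## §5.3 The product `∏ ρ_p` as a ratio `N_F / D_F` (eq. (5.3), Lemma 5.6) -/

/-- `N_F(z) := ∏_{p ∈ F} (1 − p^{z−1})` for a finite set of primes `F` (eq. (5.3), §5.3; arXiv chunk
p0016:L9). [cite: ConnesConsani2021QuasiInner, §5.3 eq. (5.3) (arXiv chunk p0016:L9)] -/
def numerN (F : Finset ℕ) (z : ℂ) : ℂ := ∏ p ∈ F, (1 - (p : ℂ) ^ (z - 1))

/-- `D_F(z) := ∏_{p ∈ F} (1 − p^{−z})` for a finite set of primes `F` (eq. (5.3), §5.3; arXiv chunk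
p0016:L9); `D(F, F') = D_{F' ∖ F}` is the multiplier of Theorem 5.3 (ii).
[cite: ConnesConsani2021QuasiInner, §5.3 eq. (5.3) (arXiv chunk p0016:L9)] -/
def denomD (F : Finset ℕ) (z : ℂ) : ℂ := ∏ p ∈ F, (1 - (p : ℂ) ^ (-z))

/-- Unfolding `numerN`. [cite: ConnesConsani2021QuasiInner, §5.3 eq. (5.3) (arXiv chunk p0016:L9)] -/
theorem numerN_def (F : Finset ℕ) (z : ℂ) : numerN F z = ∏ p ∈ F, (1 - (p : ℂ) ^ (z - 1)) := rfl

/-- Unfolding `denomD`. [cite: ConnesConsani2021QuasiInner, §5.3 eq. (5.3) (arXiv chunk p0016:L9)] -/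
theorem denomD_def (F : Finset ℕ) (z : ℂ) : denomD F z = ∏ p ∈ F, (1 - (p : ℂ) ^ (-z)) := rfl

/-- Eq. (5.3): `∏_F ρ_p = N_F / D_F` with `ρ_p(z) = (1 − p^{z−1})/(1 − p^{−z})` (§3 l.1, p0008:L6).
PROVED. [cite: ConnesConsani2021QuasiInner, §5.3 eq. (5.3) (arXiv chunk p0016:L9)] -/
theorem prod_localRatio_eq_numerN_div_denomD (F : Finset ℕ) (z : ℂ) :
    ∏ p ∈ F, (1 - (p : ℂ) ^ (z - 1)) / (1 - (p : ℂ) ^ (-z)) = numerN F z / denomD F z := by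
  rw [numerN, denomD, Finset.prod_div_distrib]

/-- `f ∈ H^∞(ℂ_−)`: `f` is holomorphic and bounded on the OPEN left half-plane `Re z < ½`
(`ℂ_− = {Re z ≤ ½}` in print, p0005:L9; `H^∞` of a half-plane = bounded holomorphic functions on
its interior; Lemma 5.6, p0016:L17).  Explicit predicate (no Hardy-space theory is built).
[cite: ConnesConsani2021QuasiInner, Lemma 5.6 §5.3 (arXiv chunk p0016:L17)] -/
def IsHinftyLeft (f : ℂ → ℂ) : Prop :=
  DifferentiableOn ℂ f {z : ℂ | z.re < 1 / 2} ∧ ∃ C : ℝ, ∀ z : ℂ, z.re < 1 / 2 → ‖f z‖ ≤ C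

/-- `f ∈ H^∞(ℂ_+)`: `f` is holomorphic and bounded on the OPEN right half-plane `Re z > ½`
(`ℂ_+` = «the half plane on the right of the critical line», p0016:L12; Lemma 5.6, p0016:L17).
[cite: ConnesConsani2021QuasiInner, Lemma 5.6 §5.3 (arXiv chunk p0016:L17)] -/
def IsHinftyRight (f : ℂ → ℂ) : Prop :=
  DifferentiableOn ℂ f {z : ℂ | 1 / 2 < z.re} ∧ ∃ C : ℝ, ∀ z : ℂ, 1 / 2 < z.re → ‖f z‖ ≤ C

/-- `H^∞(ℂ_−)` is closed under products (the reduction «it is enough to show that for any prime `p` …»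
of the proof of Lemma 5.6, p0016:L21). [cite: ConnesConsani2021QuasiInner, Lemma 5.6 proof (arXiv chunk p0016:L21)] -/
theorem IsHinftyLeft.mul {f g : ℂ → ℂ} (hf : IsHinftyLeft f) (hg : IsHinftyLeft g) :
    IsHinftyLeft (fun z => f z * g z) := by
  obtain ⟨hfd, C, hC⟩ := hf
  obtain ⟨hgd, D, hD⟩ := hg
  refine ⟨hfd.mul hgd, C * D, fun z hz => ?_⟩
  rw [norm_mul]
  have hC0 : 0 ≤ C := (norm_nonneg _).trans (hC z hz)
  exact mul_le_mul (hC z hz) (hD z hz) (norm_nonneg _) hC0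

/-- `H^∞(ℂ_+)` is closed under products (proof of Lemma 5.6, p0016:L21).
[cite: ConnesConsani2021QuasiInner, Lemma 5.6 proof (arXiv chunk p0016:L21)] -/
theorem IsHinftyRight.mul {f g : ℂ → ℂ} (hf : IsHinftyRight f) (hg : IsHinftyRight g) :
    IsHinftyRight (fun z => f z * g z) := by
  obtain ⟨hfd, C, hC⟩ := hf
  obtain ⟨hgd, D, hD⟩ := hg
  refine ⟨hfd.mul hgd, C * D, fun z hz => ?_⟩
  rw [norm_mul]
  have hC0 : 0 ≤ C := (norm_nonneg _).trans (hC z hz)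
  exact mul_le_mul (hC z hz) (hD z hz) (norm_nonneg _) hC0

/-- Constants are in `H^∞(ℂ_−)` (empty product in Lemma 5.6). [cite: ConnesConsani2021QuasiInner, Lemma 5.6 proof (arXiv chunk p0016:L21)] -/
theorem isHinftyLeft_const (c : ℂ) : IsHinftyLeft (fun _ => c) :=
  ⟨differentiableOn_const c, ‖c‖, fun _ _ => le_rfl⟩

/-- Constants are in `H^∞(ℂ_+)` (empty product in Lemma 5.6). [cite: ConnesConsani2021QuasiInner, Lemma 5.6 proof (arXiv chunk p0016:L21)] -/
theorem isHinftyRight_const (c : ℂ) : IsHinftyRight (fun _ => c) :=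
  ⟨differentiableOn_const c, ‖c‖, fun _ _ => le_rfl⟩

/-- Finite products stay in `H^∞(ℂ_−)` (the reduction step of the proof of Lemma 5.6, p0016:L21).
[cite: ConnesConsani2021QuasiInner, Lemma 5.6 proof (arXiv chunk p0016:L21)] -/
theorem isHinftyLeft_finset_prod {ι : Type*} (s : Finset ι) (f : ι → ℂ → ℂ)
    (h : ∀ i ∈ s, IsHinftyLeft (f i)) : IsHinftyLeft (fun z => ∏ i ∈ s, f i z) := by
  classical
  induction s using Finset.induction_on with
  | empty => simpa using isHinftyLeft_const 1
  | insert i s hi ih =>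
    have h' := ih (fun j hj => h j (Finset.mem_insert_of_mem hj))
    have hi' := h i (Finset.mem_insert_self i s)
    simpa [Finset.prod_insert hi] using hi'.mul h'

/-- Finite products stay in `H^∞(ℂ_+)` (the reduction step of the proof of Lemma 5.6, p0016:L21).
[cite: ConnesConsani2021QuasiInner, Lemma 5.6 proof (arXiv chunk p0016:L21)] -/
theorem isHinftyRight_finset_prod {ι : Type*} (s : Finset ι) (f : ι → ℂ → ℂ)
    (h : ∀ i ∈ s, IsHinftyRight (f i)) : IsHinftyRight (fun z => ∏ i ∈ s, f i z) := by
  classical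
  induction s using Finset.induction_on with
  | empty => simpa using isHinftyRight_const 1
  | insert i s hi ih =>
    have h' := ih (fun j hj => h j (Finset.mem_insert_of_mem hj))
    have hi' := h i (Finset.mem_insert_self i s)
    simpa [Finset.prod_insert hi] using hi'.mul h'

/-- `1 − p^{z−1} ∈ H^∞(ℂ_−)` for a prime `p` (proof of Lemma 5.6, p0016:L21–L27: «uniform
boundedness of these analytic functions in `ℂ_−`»; here `|p^{z−1}| = p^{Re z − 1} ≤ 1`).  PROVED.
[cite: ConnesConsani2021QuasiInner, Lemma 5.6 proof (arXiv chunk p0016:L21)] -/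
theorem isHinftyLeft_one_sub_cpow {p : ℕ} (hp : p.Prime) :
    IsHinftyLeft (fun z => 1 - (p : ℂ) ^ (z - 1)) := by
  have hp0 : (p : ℂ) ≠ 0 := Nat.cast_ne_zero.mpr hp.ne_zero
  have hp1 : (1 : ℝ) ≤ p := by exact_mod_cast hp.one_lt.le
  refine ⟨?_, 2, fun z hz => ?_⟩
  · refine DifferentiableOn.sub (differentiableOn_const _) ?_
    intro z _
    exact ((differentiableAt_id.sub_const 1).const_cpow (Or.inl hp0)).differentiableWithinAt
  · have hnorm : ‖(p : ℂ) ^ (z - 1)‖ ≤ 1 := by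
      rw [show (p : ℂ) = ((p : ℝ) : ℂ) by norm_cast,
        norm_cpow_eq_rpow_re_of_pos (by exact_mod_cast hp.pos) (z - 1)]
      refine Real.rpow_le_one_of_one_le_of_nonpos hp1 ?_
      simp only [sub_re, one_re]; linarith
    calc ‖1 - (p : ℂ) ^ (z - 1)‖ ≤ ‖(1 : ℂ)‖ + ‖(p : ℂ) ^ (z - 1)‖ := norm_sub_le _ _
      _ ≤ 1 + 1 := by rw [norm_one]; linarith
      _ = 2 := by norm_num

/-- `1 − p^{−z} ∈ H^∞(ℂ_+)` for a prime `p` (proof of Lemma 5.6, p0016:L21–L27; `|p^{−z}| = p^{−Re z} ≤ 1`).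
PROVED. [cite: ConnesConsani2021QuasiInner, Lemma 5.6 proof (arXiv chunk p0016:L21)] -/
theorem isHinftyRight_one_sub_cpow {p : ℕ} (hp : p.Prime) :
    IsHinftyRight (fun z => 1 - (p : ℂ) ^ (-z)) := by
  have hp0 : (p : ℂ) ≠ 0 := Nat.cast_ne_zero.mpr hp.ne_zero
  have hp1 : (1 : ℝ) ≤ p := by exact_mod_cast hp.one_lt.le
  refine ⟨?_, 2, fun z hz => ?_⟩
  · refine DifferentiableOn.sub (differentiableOn_const _) ?_
    intro z _
    exact (differentiableAt_id.neg.const_cpow (Or.inl hp0)).differentiableWithinAt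
  · have hnorm : ‖(p : ℂ) ^ (-z)‖ ≤ 1 := by
      rw [show (p : ℂ) = ((p : ℝ) : ℂ) by norm_cast,
        norm_cpow_eq_rpow_re_of_pos (by exact_mod_cast hp.pos) (-z)]
      refine Real.rpow_le_one_of_one_le_of_nonpos hp1 ?_
      simp only [neg_re]; linarith
    calc ‖1 - (p : ℂ) ^ (-z)‖ ≤ ‖(1 : ℂ)‖ + ‖(p : ℂ) ^ (-z)‖ := norm_sub_le _ _
      _ ≤ 1 + 1 := by rw [norm_one]; linarith
      _ = 2 := by norm_num

/-- **Lemma 5.6** (§5.3; arXiv chunk p0016:L14).  «Let `F` be a finite set of primes and `N_F`, `D_F`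
as in (5.3).  Then `N_F ∈ H^∞(ℂ_−)`, `D_F ∈ H^∞(ℂ_+)`.»  PROVED (as in print: each factor is a bounded
holomorphic function on the relevant open half-plane).  RH-FREE.
[cite: ConnesConsani2021QuasiInner, Lemma 5.6 §5.3 (arXiv chunk p0016:L14)] -/
theorem lemma_5_6 (F : Finset ℕ) (hF : ∀ p ∈ F, p.Prime) :
    IsHinftyLeft (numerN F) ∧ IsHinftyRight (denomD F) := by
  constructor
  · have : numerN F = fun z => ∏ p ∈ F, (1 - (p : ℂ) ^ (z - 1)) := rfl
    rw [this]
    exact isHinftyLeft_finset_prod F (fun p z => 1 - (p : ℂ) ^ (z - 1))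
      (fun p hp => isHinftyLeft_one_sub_cpow (hF p hp))
  · have : denomD F = fun z => ∏ p ∈ F, (1 - (p : ℂ) ^ (-z)) := rfl
    rw [this]
    exact isHinftyRight_finset_prod F (fun p z => 1 - (p : ℂ) ^ (-z))
      (fun p hp => isHinftyRight_one_sub_cpow (hF p hp))

/-- `D_F(z) ≠ 0` for `Re z > 0` (each `|p^{−z}| = p^{−Re z} < 1`); in particular on the critical line,
so that multiplication by `D(F,F')` is injective on `L²(∂ℂ_−)` — the injectivity clause of Theorem 5.3 (ii)
(p0015:L22), not spelled out in the printed proof (§5.4). [cite: ConnesConsani2021QuasiInner, Thm 5.3 (ii) (arXiv chunk p0015:L22)] -/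
theorem denomD_ne_zero {F : Finset ℕ} (hF : ∀ p ∈ F, p.Prime) {z : ℂ} (hz : 0 < z.re) :
    denomD F z ≠ 0 := by
  rw [denomD]
  refine Finset.prod_ne_zero_iff.mpr fun p hp => ?_
  have hpp := hF p hp
  have hlt : ‖(p : ℂ) ^ (-z)‖ < 1 := by
    rw [show (p : ℂ) = ((p : ℝ) : ℂ) by norm_cast,
      norm_cpow_eq_rpow_re_of_pos (by exact_mod_cast hpp.pos) (-z)]
    refine Real.rpow_lt_one_of_one_lt_of_neg (by exact_mod_cast hpp.one_lt) ?_
    simp only [neg_re]; linarith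
  intro h
  rw [sub_eq_zero] at h
  rw [← h, norm_one] at hlt
  exact lt_irrefl _ hlt


/-! ## §5.2 The critical line `∂ℂ_−`: `s ↦ ½ + is`, `u_∞ = ρ_∞|_{∂ℂ_−}` -/

/-- The parametrisation `z(s) = ½ + is` of the critical line `∂ℂ_−` («the identification of `ℝ`
with the critical line `∂ℂ_−` given by `s ↦ ½ + is`», §5.2, arXiv chunk p0015:L115).
[cite: ConnesConsani2021QuasiInner, §5.2 (arXiv chunk p0015:L115)] -/
def critPt (s : ℝ) : ℂ := 1 / 2 + s * I

/-- Unfolding `critPt`. [cite: ConnesConsani2021QuasiInner, §5.2 (arXiv chunk p0015:L115)] -/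
theorem critPt_def (s : ℝ) : critPt s = 1 / 2 + s * I := rfl

/-- `Re z(s) = ½`. [cite: ConnesConsani2021QuasiInner, §5.2 (arXiv chunk p0015:L115)] -/
theorem critPt_re (s : ℝ) : (critPt s).re = 1 / 2 := by simp [critPt]

/-- `s ↦ z(s)` is continuous. [cite: ConnesConsani2021QuasiInner, §5.2 (arXiv chunk p0015:L115)] -/
theorem continuous_critPt : Continuous critPt :=
  continuous_const.add (Complex.continuous_ofReal.mul continuous_const)

/-- On the critical line `1 − z = z̄`. [cite: ConnesConsani2021QuasiInner, §5.2 (arXiv chunk p0015:L115)] -/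
theorem one_sub_critPt (s : ℝ) : 1 - critPt s = conj (critPt s) := by
  simp only [critPt, map_add, map_div₀, map_one, map_ofNat, map_mul, conj_ofReal, conj_I]
  ring

/-- `Γ_ℝ(½ + is) ≠ 0` (no pole on the critical line). [cite: ConnesConsani2021QuasiInner, §5.2 (arXiv chunk p0015:L115)] -/
theorem Gammaℝ_critPt_ne_zero (s : ℝ) : Gammaℝ (critPt s) ≠ 0 :=
  Gammaℝ_ne_zero_of_re_pos (by rw [critPt_re]; norm_num)

/-- `|ρ_∞(½ + is)| = 1`: `ρ_∞` is of modulus one on the critical line (§2 p0005:L9/L66; here from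
`Γ_ℝ(z̄) = conj Γ_ℝ(z)`).  PROVED. [cite: ConnesConsani2021QuasiInner, §2 (arXiv chunk p0005:L66)] -/
theorem norm_Gammaℝ_div_critPt (s : ℝ) :
    ‖Gammaℝ (critPt s) / Gammaℝ (1 - critPt s)‖ = 1 := by
  rw [one_sub_critPt, Gammaℝ_conj, norm_div, Complex.norm_conj,
    div_self (norm_ne_zero_iff.mpr (Gammaℝ_critPt_ne_zero s))]

/-- **`u_∞(s) = ρ_∞(½ + is)`** (§5.2, arXiv chunk p0015:L115–L116: «the unitary function `u_∞` of
[Weilcompo] is the restriction of `ρ_∞` to `∂ℂ_−`, `ρ_∞(½ + is) = u_∞(s) ∀ s ∈ ℝ`»), for the tree's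
`u_∞ = archUnitary` (`e^{2iθ(s)}`, CC 2021 Selecta eq. (14), `SchwartzKernels.lean`) and
`ρ_∞(z) = Γ_ℝ(z)/Γ_ℝ(1−z)`.  PROVED from the tree's phase identity
`cexp_riemannSiegelTheta_mul_I_holds` (`e^{iθ} = π^{−is/2}Γ(¼+is/2)/|Γ(¼+is/2)|`).  RH-FREE.
[cite: ConnesConsani2021QuasiInner, §5.2 (arXiv chunk p0015:L115)] -/
theorem archUnitary_eq_Gammaℝ_div (s : ℝ) :
    archUnitary s = Gammaℝ (critPt s) / Gammaℝ (1 - critPt s) := by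
  have hE := cexp_riemannSiegelTheta_mul_I_holds s
  set w : ℂ := 1 / 4 + s / 2 * I with hw
  have hπ0 : (π : ℂ) ≠ 0 := by exact_mod_cast Real.pi_pos.ne'
  have hΓw : Complex.Gamma w ≠ 0 := Complex.Gamma_ne_zero_of_re_pos (by simp [hw])
  have hnorm : ((‖Complex.Gamma w‖ : ℝ) : ℂ) ≠ 0 := by
    exact_mod_cast (norm_pos_iff.2 hΓw).ne'
  have hconj0 : conj (Complex.Gamma w) ≠ 0 := by
    rwa [Ne, map_eq_zero]
  have hsq : archUnitary s = cexp (riemannSiegelTheta s * I) * cexp (riemannSiegelTheta s * I) := by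
    rw [archUnitary, ← Complex.exp_add]; ring_nf
  have hz : critPt s / 2 = w := by rw [critPt, hw]; ring
  have hzc : conj (critPt s) / 2 = conj w := by
    rw [← hz, map_div₀, map_ofNat]
  have hR : Gammaℝ (critPt s) / Gammaℝ (1 - critPt s) =
      (π : ℂ) ^ (-critPt s / 2) / (π : ℂ) ^ (-conj (critPt s) / 2) *
        (Complex.Gamma w / conj (Complex.Gamma w)) := by
    rw [one_sub_critPt, Gammaℝ_def, Gammaℝ_def, hz, hzc, Complex.Gamma_conj, mul_div_mul_comm]
  have hππ : (π : ℂ) ^ (-critPt s / 2) / (π : ℂ) ^ (-conj (critPt s) / 2) =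
      (π : ℂ) ^ (-(s : ℂ) * I / 2) * (π : ℂ) ^ (-(s : ℂ) * I / 2) := by
    rw [← Complex.cpow_sub _ _ hπ0, ← Complex.cpow_add _ _ hπ0]
    congr 1
    simp only [critPt, map_add, map_div₀, map_one, map_ofNat, map_mul, conj_ofReal, conj_I]
    ring
  have hcn : conj (Complex.Gamma w) * Complex.Gamma w = ((‖Complex.Gamma w‖ : ℝ) : ℂ) ^ 2 := by
    rw [mul_comm, Complex.mul_conj, Complex.normSq_eq_norm_sq]; push_cast; ring
  have hquot : Complex.Gamma w / conj (Complex.Gamma w) =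
      Complex.Gamma w ^ 2 / ((‖Complex.Gamma w‖ : ℝ) : ℂ) ^ 2 := by
    rw [div_eq_div_iff hconj0 (pow_ne_zero 2 hnorm), ← hcn]; ring
  rw [hsq, hE, hR, hππ, hquot]
  ring

/-- `s ↦ ρ_∞(½ + is)` is continuous (no poles of `Γ_ℝ(z)^{±1}`, `Γ_ℝ(1−z)^{-1}` on the line; Mathlib's
`differentiable_Gammaℝ_inv`). [cite: ConnesConsani2021QuasiInner, §5.2 (arXiv chunk p0015:L115)] -/
theorem continuous_Gammaℝ_div_critPt :
    Continuous fun s : ℝ => Gammaℝ (critPt s) / Gammaℝ (1 - critPt s) := by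
  have h1 : Continuous fun s : ℝ => (Gammaℝ (1 - critPt s))⁻¹ :=
    differentiable_Gammaℝ_inv.continuous.comp (continuous_const.sub continuous_critPt)
  have h2 : Continuous fun s : ℝ => (Gammaℝ (critPt s))⁻¹ :=
    differentiable_Gammaℝ_inv.continuous.comp continuous_critPt
  have h3 : Continuous fun s : ℝ => (Gammaℝ (1 - critPt s))⁻¹ / (Gammaℝ (critPt s))⁻¹ :=
    h1.div h2 fun s => inv_ne_zero (Gammaℝ_critPt_ne_zero s)
  refine h3.congr fun s => ?_
  rw [inv_div_inv]

/-- `u_∞ = archUnitary` is continuous. [cite: ConnesConsani2021QuasiInner, §5.2 (arXiv chunk p0015:L115)] -/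
theorem continuous_archUnitary : Continuous archUnitary := by
  have : archUnitary = fun s => Gammaℝ (critPt s) / Gammaℝ (1 - critPt s) :=
    funext archUnitary_eq_Gammaℝ_div
  rw [this]; exact continuous_Gammaℝ_div_critPt

/-- `|ρ_p(½ + is)| = 1` for a prime `p`, `ρ_p(z) = (1 − p^{z−1})/(1 − p^{−z})` (§3 l.1 p0008:L6): on
the critical line the numerator is the conjugate of the (non-vanishing) denominator.  PROVED.
[cite: ConnesConsani2021QuasiInner, §3 (arXiv chunk p0008:L6)] -/
theorem norm_localRatio_critPt {p : ℕ} (hp : p.Prime) (s : ℝ) :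
    ‖(1 - (p : ℂ) ^ (critPt s - 1)) / (1 - (p : ℂ) ^ (-critPt s))‖ = 1 := by
  have hp0 : (0 : ℝ) < p := by exact_mod_cast hp.pos
  have harg : ((p : ℝ) : ℂ).arg ≠ π := by
    rw [Complex.arg_ofReal_of_nonneg hp0.le]; exact Real.pi_ne_zero.symm
  have hexp : critPt s - 1 = conj (-critPt s) := by
    simp only [critPt, map_neg, map_add, map_div₀, map_one, map_ofNat, map_mul, conj_ofReal, conj_I]
    ring
  have hnum : (1 : ℂ) - (p : ℂ) ^ (critPt s - 1) = conj (1 - (p : ℂ) ^ (-critPt s)) := by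
    rw [map_sub, map_one, hexp, show (p : ℂ) = ((p : ℝ) : ℂ) by norm_cast,
      Complex.cpow_conj _ _ harg, Complex.conj_ofReal]
  have hden : (1 : ℂ) - (p : ℂ) ^ (-critPt s) ≠ 0 := by
    have hlt : ‖(p : ℂ) ^ (-critPt s)‖ < 1 := by
      rw [show (p : ℂ) = ((p : ℝ) : ℂ) by norm_cast, Complex.norm_cpow_eq_rpow_re_of_pos hp0]
      refine Real.rpow_lt_one_of_one_lt_of_neg (by exact_mod_cast hp.one_lt) ?_
      rw [neg_re, critPt_re]; norm_num
    intro h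
    rw [sub_eq_zero] at h
    rw [← h, norm_one] at hlt
    exact lt_irrefl _ hlt
  rw [hnum, norm_div, Complex.norm_conj, div_self (norm_ne_zero_iff.mpr hden)]

/-- `s ↦ ρ_p(½ + is)` is continuous (denominator non-vanishing). [cite: ConnesConsani2021QuasiInner, §3 (arXiv chunk p0008:L6)] -/
theorem continuous_localRatio_critPt {p : ℕ} (hp : p.Prime) :
    Continuous fun s : ℝ => (1 - (p : ℂ) ^ (critPt s - 1)) / (1 - (p : ℂ) ^ (-critPt s)) := by
  have hp0 : (p : ℂ) ≠ 0 := Nat.cast_ne_zero.mpr hp.ne_zero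
  have hpR : (0 : ℝ) < p := by exact_mod_cast hp.pos
  refine Continuous.div ?_ ?_ ?_
  · exact continuous_const.sub ((continuous_critPt.sub continuous_const).const_cpow (Or.inl hp0))
  · exact continuous_const.sub (continuous_critPt.neg.const_cpow (Or.inl hp0))
  · intro s h
    have hlt : ‖(p : ℂ) ^ (-critPt s)‖ < 1 := by
      rw [show (p : ℂ) = ((p : ℝ) : ℂ) by norm_cast, Complex.norm_cpow_eq_rpow_re_of_pos hpR]
      refine Real.rpow_lt_one_of_one_lt_of_neg (by exact_mod_cast hp.one_lt) ?_
      rw [neg_re, critPt_re]; norm_num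
    rw [sub_eq_zero] at h
    rw [← h, norm_one] at hlt
    exact lt_irrefl _ hlt

/-! ## §5.3 The boundary functions `u(F) = ∏_F ρ_v` and `D(F,F′)` on `∂ℂ_−` -/

/-- `u(F)(½ + is) = ρ_∞(z) ∏_{p ∈ F} ρ_p(z)`, `z = ½ + is`: the boundary values on `∂ℂ_−` of the product
`u(F) = ∏_{v ∈ F ∪ {∞}} ρ_v` of ratios of local factors (Thm 5.3, p0015:L22; Thm 4.1), for a finite set
`F` of primes (a finite set of places containing `∞` is `F ∪ {∞}`); `ρ_∞|_{∂ℂ_−} = u_∞ = archUnitary`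
(`archUnitary_eq_Gammaℝ_div`) and `ρ_p` written inline (§3 l.1).
[cite: ConnesConsani2021QuasiInner, Thm 5.3 (arXiv chunk p0015:L22)] -/
def placeBoundaryFun (F : Finset Nat.Primes) (s : ℝ) : ℂ :=
  archUnitary s * ∏ p ∈ F, (1 - ((p : ℕ) : ℂ) ^ (critPt s - 1)) / (1 - ((p : ℕ) : ℂ) ^ (-critPt s))

/-- Unfolding `placeBoundaryFun`. [cite: ConnesConsani2021QuasiInner, Thm 5.3 (arXiv chunk p0015:L22)] -/
theorem placeBoundaryFun_def (F : Finset Nat.Primes) (s : ℝ) :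
    placeBoundaryFun F s = archUnitary s *
      ∏ p ∈ F, (1 - ((p : ℕ) : ℂ) ^ (critPt s - 1)) / (1 - ((p : ℕ) : ℂ) ^ (-critPt s)) := rfl

/-- `u(∅) = u_∞` (the single archimedean place, §5.2). [cite: ConnesConsani2021QuasiInner, §5.2 (arXiv chunk p0015:L99)] -/
theorem placeBoundaryFun_empty : placeBoundaryFun ∅ = archUnitary := by
  funext s; simp [placeBoundaryFun]

/-- `|u(F)| = 1` on `∂ℂ_−` («`u ∈ L^∞(∂Ω)` of modulus `1`», Intro p0003:L5).  PROVED.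
[cite: ConnesConsani2021QuasiInner, §1 Definition (arXiv chunk p0003:L5)] -/
theorem norm_placeBoundaryFun (F : Finset Nat.Primes) (s : ℝ) : ‖placeBoundaryFun F s‖ = 1 := by
  rw [placeBoundaryFun, norm_mul, norm_archUnitary, one_mul, norm_prod]
  exact Finset.prod_eq_one fun p _ => norm_localRatio_critPt p.2 s

/-- `u(F)` is continuous on `∂ℂ_−`. [cite: ConnesConsani2021QuasiInner, Thm 5.3 (arXiv chunk p0015:L22)] -/
theorem continuous_placeBoundaryFun (F : Finset Nat.Primes) : Continuous (placeBoundaryFun F) := by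
  unfold placeBoundaryFun
  exact continuous_archUnitary.mul
    (continuous_finsetProd F fun p _ => continuous_localRatio_critPt p.2)

/-- `D(F'')(½ + is) := ∏_{p ∈ F''} (1 − p^{−z})`, `z = ½ + is`: the multiplier
`D(F,F′) = ∏_{p ∈ F′ ∖ F}(1 − p^{−z}) = D_{F′∖F}` of Theorem 5.3 (ii) (p0015:L22; eq. (5.3)) restricted
to `∂ℂ_−`. [cite: ConnesConsani2021QuasiInner, Thm 5.3 (ii) (arXiv chunk p0015:L22)] -/
def dBoundaryFun (F : Finset Nat.Primes) (s : ℝ) : ℂ :=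
  ∏ p ∈ F, (1 - ((p : ℕ) : ℂ) ^ (-critPt s))

/-- Unfolding `dBoundaryFun`. [cite: ConnesConsani2021QuasiInner, Thm 5.3 (ii) (arXiv chunk p0015:L22)] -/
theorem dBoundaryFun_def (F : Finset Nat.Primes) (s : ℝ) :
    dBoundaryFun F s = ∏ p ∈ F, (1 - ((p : ℕ) : ℂ) ^ (-critPt s)) := rfl

/-- `D(F'')|_{∂ℂ_−} = D_{F''}(½ + is)` for the function `denomD` of eq. (5.3).
[cite: ConnesConsani2021QuasiInner, §5.3 eq. (5.3) (arXiv chunk p0016:L9)] -/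
theorem dBoundaryFun_eq_denomD (F : Finset Nat.Primes) (s : ℝ) :
    dBoundaryFun F s = denomD (F.image fun p : Nat.Primes => (p : ℕ)) (critPt s) := by
  rw [dBoundaryFun, denomD, Finset.prod_image]
  exact fun p _ q _ h => Nat.Primes.coe_nat_injective h

/-- Transitivity of the multipliers: `D(F,F'') = D(F',F'') · D(F,F')` for `F ⊆ F' ⊆ F''` — the Sonin
spaces `S(u(F))` «form a filtering inductive system under the maps `D(F,F′)`» (p0015:L24).  PROVED.
[cite: ConnesConsani2021QuasiInner, Thm 5.3 (arXiv chunk p0015:L24)] -/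
theorem dBoundaryFun_sdiff_mul {F F' F'' : Finset Nat.Primes} (h₁ : F ⊆ F') (h₂ : F' ⊆ F'') (s : ℝ) :
    dBoundaryFun (F'' \ F') s * dBoundaryFun (F' \ F) s = dBoundaryFun (F'' \ F) s := by
  rw [dBoundaryFun, dBoundaryFun, dBoundaryFun, ← Finset.prod_union (Finset.disjoint_left.mpr
    fun p hp hp' => (Finset.mem_sdiff.mp hp).2 (Finset.mem_sdiff.mp hp').1)]
  congr 1
  ext p
  simp only [Finset.mem_union, Finset.mem_sdiff]
  constructor
  · rintro (⟨h1, h2⟩ | ⟨h1, h2⟩)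
    · exact ⟨h1, fun h => h2 (h₁ h)⟩
    · exact ⟨h₂ h1, h2⟩
  · rintro ⟨h1, h2⟩
    by_cases h : p ∈ F'
    · exact Or.inr ⟨h, h2⟩
    · exact Or.inl ⟨h1, h⟩

/-- `|D(F'')| ≤ 2^{#F''}` on `∂ℂ_−` (each `|p^{−z}| = p^{−1/2} ≤ 1`). [cite: ConnesConsani2021QuasiInner, Lemma 5.6 proof (arXiv chunk p0016:L21)] -/
theorem norm_dBoundaryFun_le (F : Finset Nat.Primes) (s : ℝ) :
    ‖dBoundaryFun F s‖ ≤ 2 ^ F.card := by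
  rw [dBoundaryFun, norm_prod, ← Finset.prod_const]
  refine Finset.prod_le_prod (fun _ _ => norm_nonneg _) fun p _ => ?_
  have hpR : (0 : ℝ) < (p : ℕ) := by exact_mod_cast p.2.pos
  have hle : ‖((p : ℕ) : ℂ) ^ (-critPt s)‖ ≤ 1 := by
    rw [show ((p : ℕ) : ℂ) = (((p : ℕ) : ℝ) : ℂ) by norm_cast,
      Complex.norm_cpow_eq_rpow_re_of_pos hpR]
    refine Real.rpow_le_one_of_one_le_of_nonpos (by exact_mod_cast p.2.one_lt.le) ?_
    rw [neg_re, critPt_re]; norm_num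
  calc ‖1 - ((p : ℕ) : ℂ) ^ (-critPt s)‖ ≤ ‖(1 : ℂ)‖ + ‖((p : ℕ) : ℂ) ^ (-critPt s)‖ :=
        norm_sub_le _ _
    _ ≤ 2 := by rw [norm_one]; linarith

/-- `D(F'')` is continuous on `∂ℂ_−`. [cite: ConnesConsani2021QuasiInner, Thm 5.3 (ii) (arXiv chunk p0015:L22)] -/
theorem continuous_dBoundaryFun (F : Finset Nat.Primes) : Continuous (dBoundaryFun F) := by
  unfold dBoundaryFun
  exact continuous_finsetProd F fun p _ =>
    continuous_const.sub (continuous_critPt.neg.const_cpow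
      (Or.inl (Nat.cast_ne_zero.mpr p.2.ne_zero)))

/-- `D(F'')(½ + is) ≠ 0` (`|p^{−z}| < 1`). [cite: ConnesConsani2021QuasiInner, Thm 5.3 (ii) (arXiv chunk p0015:L22)] -/
theorem dBoundaryFun_ne_zero (F : Finset Nat.Primes) (s : ℝ) : dBoundaryFun F s ≠ 0 := by
  rw [dBoundaryFun]
  refine Finset.prod_ne_zero_iff.mpr fun p _ => ?_
  have hpR : (0 : ℝ) < (p : ℕ) := by exact_mod_cast p.2.pos
  have hlt : ‖((p : ℕ) : ℂ) ^ (-critPt s)‖ < 1 := by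
    rw [show ((p : ℕ) : ℂ) = (((p : ℕ) : ℝ) : ℂ) by norm_cast,
      Complex.norm_cpow_eq_rpow_re_of_pos hpR]
    refine Real.rpow_lt_one_of_one_lt_of_neg (by exact_mod_cast p.2.one_lt) ?_
    rw [neg_re, critPt_re]; norm_num
  intro h
  rw [sub_eq_zero] at h
  rw [← h, norm_one] at hlt
  exact lt_irrefl _ hlt

/-- A bounded continuous function on the critical line as an element of `L^∞(∂ℂ_−) = L^∞(ℝ)`
(«`u ∈ L^∞(∂Ω)` … acts on `L²(∂Ω)` by multiplication», Def. 5.2 p0015:L17); multiplication by it on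
`L²` is Mathlib's Hölder action `Lp ℂ ∞ • Lp ℂ 2 ⊆ Lp ℂ 2`.
[cite: ConnesConsani2021QuasiInner, Def. 5.2 (arXiv chunk p0015:L17)] -/
def toLinfty (u : ℝ → ℂ) (hu : Continuous u) (C : ℝ) (hC : ∀ x, ‖u x‖ ≤ C) :
    Lp ℂ ∞ (volume : Measure ℝ) :=
  (memLp_top_of_bound hu.aestronglyMeasurable C (Eventually.of_forall hC)).toLp u

/-- `toLinfty u` represents `u` a.e. [cite: ConnesConsani2021QuasiInner, Def. 5.2 (arXiv chunk p0015:L17)] -/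
theorem coeFn_toLinfty (u : ℝ → ℂ) (hu : Continuous u) (C : ℝ) (hC : ∀ x, ‖u x‖ ≤ C) :
    (toLinfty u hu C hC : ℝ → ℂ) =ᵐ[volume] u :=
  MemLp.coeFn_toLp _

/-- `u(F) ∈ L^∞(∂ℂ_−)` (Thm 5.3 / Def. 5.2). [cite: ConnesConsani2021QuasiInner, Thm 5.3 (arXiv chunk p0015:L22)] -/
def placeBoundary (F : Finset Nat.Primes) : Lp ℂ ∞ (volume : Measure ℝ) :=
  toLinfty (placeBoundaryFun F) (continuous_placeBoundaryFun F) 1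
    fun s => (norm_placeBoundaryFun F s).le

/-- `u_∞ = ρ_∞|_{∂ℂ_−} ∈ L^∞(∂ℂ_−)` (§5.2 / Prop 5.5). [cite: ConnesConsani2021QuasiInner, Prop. 5.5 (arXiv chunk p0015:L118)] -/
def archBoundary : Lp ℂ ∞ (volume : Measure ℝ) :=
  toLinfty archUnitary continuous_archUnitary 1 fun s => (norm_archUnitary s).le

/-- `D(F'') ∈ L^∞(∂ℂ_−)` (Thm 5.3 (ii)). [cite: ConnesConsani2021QuasiInner, Thm 5.3 (ii) (arXiv chunk p0015:L22)] -/
def dBoundary (F : Finset Nat.Primes) : Lp ℂ ∞ (volume : Measure ℝ) :=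
  toLinfty (dBoundaryFun F) (continuous_dBoundaryFun F) (2 ^ F.card) (norm_dBoundaryFun_le F)

/-- `placeBoundary F` represents `u(F)` a.e. [cite: ConnesConsani2021QuasiInner, Thm 5.3 (arXiv chunk p0015:L22)] -/
theorem coeFn_placeBoundary (F : Finset Nat.Primes) :
    (placeBoundary F : ℝ → ℂ) =ᵐ[volume] placeBoundaryFun F :=
  coeFn_toLinfty _ _ _ _

/-- `archBoundary` represents `u_∞` a.e. [cite: ConnesConsani2021QuasiInner, Prop. 5.5 (arXiv chunk p0015:L118)] -/
theorem coeFn_archBoundary : (archBoundary : ℝ → ℂ) =ᵐ[volume] archUnitary :=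
  coeFn_toLinfty _ _ _ _

/-- `dBoundary F` represents `D(F)` a.e. [cite: ConnesConsani2021QuasiInner, Thm 5.3 (ii) (arXiv chunk p0015:L22)] -/
theorem coeFn_dBoundary (F : Finset Nat.Primes) :
    (dBoundary F : ℝ → ℂ) =ᵐ[volume] dBoundaryFun F :=
  coeFn_toLinfty _ _ _ _

/-! ## §5.3 `L²(∂ℂ_−) = H²(ℂ_−) ⊕ H²(ℂ_+)`: the Hardy subspaces of the critical line

«We let `𝒫` be the orthogonal projection of `L²(∂ℂ_−)` on `H²(ℂ_−)` and view `1 − 𝒫` as the orthogonal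
projection on `H²(ℂ_+)` where `ℂ_+` is the half plane on the right of the critical line» (§5.3,
p0016:L12).  In the parametrisation `s ↦ ½ + is` (`L²(∂ℂ_−) = L²(ℝ, ds)`), a function `F` holomorphic
in `ℂ_− = {Re z < ½}` is a function of `s` holomorphic in the UPPER half-plane `Im s > 0`
(`Re(½ + is) = ½ − Im s`), and by the Paley–Wiener theorem the boundary values of `H²` of the upper
half-plane are exactly the `f ∈ L²(ℝ)` whose Fourier transform `𝓕f(y) = ∫ f(s)e^{−2πisy}ds` is supported
in `y ≥ 0` (then `f(s) = ∫_{y ≥ 0} 𝓕f(y) e^{2πisy} dy` continues to `Im s > 0`; the tree proves this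
direction for the upper half-plane in `Literature/Analysis/Fourier/PaleyWienerHalfPlane.lean`,
`fourier_upperSlice_eq_zero_of_neg` / `paleyWiener_halfPlane_boundaryValue`).  We therefore TYPE the
boundary-value spaces spectrally: `hardyLeft = H²(ℂ_−) := {f | 𝓕f = 0 a.e. on (−∞,0)}` and
`hardyRight = H²(ℂ_+) := {f | 𝓕f = 0 a.e. on (0,∞)}`, and PROVE that they are closed, mutually orthogonal
and each other's orthogonal complement (Plancherel), i.e. `1 − 𝒫` IS the orthogonal projection on
`H²(ℂ_+)` as printed.  Consistency with §5.4 (p0016:L37–L56): the Mellin image `η` of an even `ξ`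
vanishing on `[−1,1]` (`η(s) = ∫₁^∞ ξ(v)v^{−1/2−is}dv = ∫_{x ≥ 0} e^{x/2}ξ(e^x)e^{−isx}dx`) has `𝓕η`
supported in `y ≤ 0`, i.e. lies in `hardyRight = (1 − 𝒫)L² = H²(ℂ_+)`, as used in the printed proof of
Theorem 5.3.  (The disk picture `H²(𝒰)`, `κ = ρ ∘ ψ` of §1–§3 is seat t17's `hardySpace`.) -/

/-- Elements of `L²(ℝ)` vanishing a.e. on a set `S` (generalises the tree's `vanishOn γ = aeVanishOn [−γ,γ]`).
[cite: ConnesConsani2021QuasiInner, §5.3 (arXiv chunk p0016:L12)] -/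
def aeVanishOn (S : Set ℝ) : Submodule ℂ (Lp ℂ 2 (volume : Measure ℝ)) where
  carrier := {ξ | ∀ᵐ x : ℝ, x ∈ S → (ξ : ℝ → ℂ) x = 0}
  zero_mem' := by
    simp only [Set.mem_setOf_eq]
    filter_upwards [Lp.coeFn_zero ℂ 2 (volume : Measure ℝ)] with x hx _
    rw [hx]; rfl
  add_mem' := by
    intro ξ η hξ hη
    simp only [Set.mem_setOf_eq] at hξ hη ⊢
    filter_upwards [Lp.coeFn_add ξ η, hξ, hη] with x hx e1 e2 hxI
    rw [hx, Pi.add_apply, e1 hxI, e2 hxI, add_zero]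
  smul_mem' := by
    intro c ξ hξ
    simp only [Set.mem_setOf_eq] at hξ ⊢
    filter_upwards [Lp.coeFn_smul c ξ, hξ] with x hx e1 hxI
    rw [hx, Pi.smul_apply, e1 hxI, smul_zero]

/-- Membership in `aeVanishOn S`. [cite: ConnesConsani2021QuasiInner, §5.3 (arXiv chunk p0016:L12)] -/
theorem mem_aeVanishOn_iff {S : Set ℝ} {ξ : Lp ℂ 2 (volume : Measure ℝ)} :
    ξ ∈ aeVanishOn S ↔ ∀ᵐ x : ℝ, x ∈ S → (ξ : ℝ → ℂ) x = 0 :=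
  Iff.rfl

/-- The tree's `vanishOn γ` is `aeVanishOn [−γ, γ]`. [cite: ConnesConsani2021QuasiInner, §5.3 (arXiv chunk p0016:L12)] -/
theorem vanishOn_eq_aeVanishOn (γ : ℝ) : vanishOn γ = aeVanishOn (Icc (-γ) γ) :=
  SetLike.ext fun _ => Iff.rfl

/-- `aeVanishOn` is antitone in the set. [cite: ConnesConsani2021QuasiInner, §5.3 (arXiv chunk p0016:L12)] -/
theorem aeVanishOn_mono {S T : Set ℝ} (h : S ⊆ T) : aeVanishOn T ≤ aeVanishOn S := fun _ hξ =>
  (mem_aeVanishOn_iff.mp hξ).mono fun _ hx hxS => hx (h hxS)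

/-- Duality characterisation: `ξ` vanishes a.e. on a measurable `S` iff `ξ` is orthogonal to the
indicators of the finite-measure measurable subsets of `S` (tool for closedness and for
`hardyLeftᗮ = hardyRight`). [cite: ConnesConsani2021QuasiInner, §5.3 (arXiv chunk p0016:L12)] -/
theorem mem_aeVanishOn_iff_forall_inner {S : Set ℝ} (hS : MeasurableSet S)
    (ξ : Lp ℂ 2 (volume : Measure ℝ)) :
    ξ ∈ aeVanishOn S ↔ ∀ (A : Set ℝ) (hA : MeasurableSet A) (hfin : volume A ≠ ∞), A ⊆ S →
      ⟪indicatorConstLp 2 hA hfin (1 : ℂ), ξ⟫_ℂ = 0 := by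
  rw [mem_aeVanishOn_iff]
  constructor
  · intro h A hA hfin hAS
    rw [L2.inner_indicatorConstLp_one]
    exact setIntegral_eq_zero_of_ae_eq_zero (h.mono fun x hx hxA => hx (hAS hxA))
  · intro h
    suffices hn : ∀ n : ℕ, ∀ᵐ x : ℝ, x ∈ S ∩ Icc (-(n : ℝ)) n → (ξ : ℝ → ℂ) x = 0 by
      rw [← ae_all_iff] at hn
      filter_upwards [hn] with x hx hxS
      obtain ⟨n, hn⟩ := exists_nat_ge |x|
      exact hx n ⟨hxS, abs_le.mp hn⟩
    intro n
    have hSnm : MeasurableSet (S ∩ Icc (-(n : ℝ)) n) := hS.inter measurableSet_Icc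
    have hSnfin : volume (S ∩ Icc (-(n : ℝ)) n) < ∞ :=
      lt_of_le_of_lt (measure_mono Set.inter_subset_right) measure_Icc_lt_top
    haveI : IsFiniteMeasure ((volume : Measure ℝ).restrict (S ∩ Icc (-(n : ℝ)) n)) :=
      ⟨by rw [Measure.restrict_apply_univ]; exact hSnfin⟩
    have hint : Integrable (ξ : ℝ → ℂ) ((volume : Measure ℝ).restrict (S ∩ Icc (-(n : ℝ)) n)) :=
      ((Lp.memLp ξ).restrict _).integrable one_le_two
    have hz := hint.ae_eq_zero_of_forall_setIntegral_eq_zero (fun s hs _ => by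
      rw [Measure.restrict_restrict hs]
      have hfin' : volume (s ∩ (S ∩ Icc (-(n : ℝ)) n)) ≠ ∞ :=
        (lt_of_le_of_lt (measure_mono Set.inter_subset_right) hSnfin).ne
      have := h (s ∩ (S ∩ Icc (-(n : ℝ)) n)) (hs.inter hSnm) hfin'
        (Set.inter_subset_right.trans Set.inter_subset_left)
      rwa [L2.inner_indicatorConstLp_one] at this)
    rw [Filter.EventuallyEq, ae_restrict_iff' hSnm] at hz
    filter_upwards [hz] with x hx hxI using hx hxI

/-- `aeVanishOn S` is closed in `L²(ℝ)` for measurable `S`. [cite: ConnesConsani2021QuasiInner, §5.3 (arXiv chunk p0016:L12)] -/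
theorem isClosed_aeVanishOn {S : Set ℝ} (hS : MeasurableSet S) :
    IsClosed (aeVanishOn S : Set (Lp ℂ 2 (volume : Measure ℝ))) := by
  have key : (aeVanishOn S : Set (Lp ℂ 2 (volume : Measure ℝ))) =
      ⋂ (A : Set ℝ) (hA : MeasurableSet A) (hfin : volume A ≠ ∞) (_ : A ⊆ S),
        {ξ | ⟪indicatorConstLp 2 hA hfin (1 : ℂ), ξ⟫_ℂ = 0} := by
    ext ξ
    simp only [SetLike.mem_coe, mem_aeVanishOn_iff_forall_inner hS, Set.mem_iInter,
      Set.mem_setOf_eq]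
  rw [key]
  exact isClosed_iInter fun A => isClosed_iInter fun hA => isClosed_iInter fun hfin =>
    isClosed_iInter fun _ => isClosed_eq (continuous_const.inner continuous_id) continuous_const

/-- Mathlib's `L²` Fourier transform `𝓕` (kernel `e^{−2πixy}`, a unitary of `L²(ℝ)`) as a linear map,
for `Submodule.comap`. [cite: ConnesConsani2021QuasiInner, §5.3 (arXiv chunk p0016:L12)] -/
def fourierL2 : Lp ℂ 2 (volume : Measure ℝ) →ₗ[ℂ] Lp ℂ 2 (volume : Measure ℝ) :=
  ((Lp.fourierTransformₗᵢ ℝ ℂ).toLinearEquiv :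
    Lp ℂ 2 (volume : Measure ℝ) →ₗ[ℂ] Lp ℂ 2 (volume : Measure ℝ))

/-- `fourierL2 f = 𝓕 f`. [cite: ConnesConsani2021QuasiInner, §5.3 (arXiv chunk p0016:L12)] -/
theorem fourierL2_apply (f : Lp ℂ 2 (volume : Measure ℝ)) :
    fourierL2 f = (𝓕 f : Lp ℂ 2 (volume : Measure ℝ)) := rfl

/-- **`H²(ℂ_−)`** = `𝒫 L²(∂ℂ_−)`: boundary values (parameter `s`, `z = ½ + is`) of the Hardy space of the
left half-plane `ℂ_−`, typed spectrally as `{f ∈ L²(ℝ) | 𝓕 f = 0 a.e. on (−∞, 0)}` (Paley–Wiener; see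
the section docstring). [cite: ConnesConsani2021QuasiInner, §5.3 (arXiv chunk p0016:L12)] -/
def hardyLeft : Submodule ℂ (Lp ℂ 2 (volume : Measure ℝ)) := (aeVanishOn (Iio 0)).comap fourierL2

/-- **`H²(ℂ_+)`** = `(1 − 𝒫) L²(∂ℂ_−)`: boundary values of the Hardy space of the right half-plane
`ℂ_+`, typed spectrally as `{f ∈ L²(ℝ) | 𝓕 f = 0 a.e. on (0, ∞)}`.
[cite: ConnesConsani2021QuasiInner, §5.3 (arXiv chunk p0016:L12)] -/
def hardyRight : Submodule ℂ (Lp ℂ 2 (volume : Measure ℝ)) := (aeVanishOn (Ioi 0)).comap fourierL2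

/-- Membership in `H²(ℂ_−)`. [cite: ConnesConsani2021QuasiInner, §5.3 (arXiv chunk p0016:L12)] -/
theorem mem_hardyLeft_iff (f : Lp ℂ 2 (volume : Measure ℝ)) :
    f ∈ hardyLeft ↔
      ∀ᵐ y : ℝ, y ∈ Iio (0 : ℝ) → ((𝓕 f : Lp ℂ 2 (volume : Measure ℝ)) : ℝ → ℂ) y = 0 :=
  Iff.rfl

/-- Membership in `H²(ℂ_+)`. [cite: ConnesConsani2021QuasiInner, §5.3 (arXiv chunk p0016:L12)] -/
theorem mem_hardyRight_iff (f : Lp ℂ 2 (volume : Measure ℝ)) :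
    f ∈ hardyRight ↔
      ∀ᵐ y : ℝ, y ∈ Ioi (0 : ℝ) → ((𝓕 f : Lp ℂ 2 (volume : Measure ℝ)) : ℝ → ℂ) y = 0 :=
  Iff.rfl

/-- `H²(ℂ_−)` is closed. [cite: ConnesConsani2021QuasiInner, §5.3 (arXiv chunk p0016:L12)] -/
theorem isClosed_hardyLeft : IsClosed (hardyLeft : Set (Lp ℂ 2 (volume : Measure ℝ))) :=
  (isClosed_aeVanishOn measurableSet_Iio).preimage (Lp.fourierTransformₗᵢ ℝ ℂ).continuous

/-- `H²(ℂ_+)` is closed. [cite: ConnesConsani2021QuasiInner, §5.3 (arXiv chunk p0016:L12)] -/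
theorem isClosed_hardyRight : IsClosed (hardyRight : Set (Lp ℂ 2 (volume : Measure ℝ))) :=
  (isClosed_aeVanishOn measurableSet_Ioi).preimage (Lp.fourierTransformₗᵢ ℝ ℂ).continuous

/-- `H²(ℂ_−) ⟂ H²(ℂ_+)` (Plancherel: `⟪f,g⟫ = ⟪𝓕f,𝓕g⟫`, disjoint spectral supports, `{0}` null).  PROVED.
[cite: ConnesConsani2021QuasiInner, §5.3 (arXiv chunk p0016:L12)] -/
theorem hardyLeft_isOrtho_hardyRight : hardyLeft ⟂ hardyRight := by
  rw [Submodule.isOrtho_iff_inner_eq]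
  intro f hf g hg
  rw [← Lp.inner_fourier_eq, L2.inner_def]
  apply integral_eq_zero_of_ae
  have h0 : ∀ᵐ y : ℝ, y ≠ 0 := by
    have : (volume : Measure ℝ) {0} = 0 := measure_singleton 0
    exact measure_eq_zero_iff_ae_notMem.mp this
  filter_upwards [(mem_hardyLeft_iff f).mp hf, (mem_hardyRight_iff g).mp hg, h0] with y h1 h2 hy
  rcases lt_or_gt_of_ne hy with h | h
  · simp [h1 h]
  · simp [h2 h]

/-- **`H²(ℂ_−)ᗮ = H²(ℂ_+)`**: «view `1 − 𝒫` as the orthogonal projection on `H²(ℂ_+)`» (p0016:L12) is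
CONSISTENT — proved from Plancherel and the duality characterisation of a.e. vanishing.
[cite: ConnesConsani2021QuasiInner, §5.3 (arXiv chunk p0016:L12)] -/
theorem hardyLeft_orthogonal_eq : hardyLeftᗮ = hardyRight := by
  apply le_antisymm
  · intro g hg
    rw [Submodule.mem_orthogonal] at hg
    rw [mem_hardyRight_iff]
    have hmem : (𝓕 g : Lp ℂ 2 (volume : Measure ℝ)) ∈ aeVanishOn (Ici 0) := by
      rw [mem_aeVanishOn_iff_forall_inner measurableSet_Ici]
      intro A hA hfin hAS
      set χ : Lp ℂ 2 (volume : Measure ℝ) := indicatorConstLp 2 hA hfin (1 : ℂ) with hχ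
      set f : Lp ℂ 2 (volume : Measure ℝ) := (Lp.fourierTransformₗᵢ ℝ ℂ).symm χ with hfdef
      have hFf : (𝓕 f : Lp ℂ 2 (volume : Measure ℝ)) = χ :=
        (Lp.fourierTransformₗᵢ ℝ ℂ).apply_symm_apply χ
      have hf : f ∈ hardyLeft := by
        rw [mem_hardyLeft_iff, hFf, hχ]
        filter_upwards [indicatorConstLp_coeFn (p := 2) (hs := hA) (hμs := hfin) (c := (1 : ℂ))]
          with y hy hyneg
        rw [hy, Set.indicator_of_notMem]
        exact fun hyA => not_le.mpr (Set.mem_Iio.mp hyneg) (Set.mem_Ici.mp (hAS hyA))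
      have := hg f hf
      rwa [← Lp.inner_fourier_eq, hFf] at this
    exact (mem_aeVanishOn_iff.mp hmem).mono fun y hy hypos =>
      hy (Set.mem_Ici.mpr (le_of_lt (Set.mem_Ioi.mp hypos)))
  · exact hardyLeft_isOrtho_hardyRight.symm.le

/-- `H²(ℂ_+)ᗮ = H²(ℂ_−)`. [cite: ConnesConsani2021QuasiInner, §5.3 (arXiv chunk p0016:L12)] -/
theorem hardyRight_orthogonal_eq : hardyRightᗮ = hardyLeft := by
  rw [← hardyLeft_orthogonal_eq, Submodule.orthogonal_orthogonal_eq_closure,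
    IsClosed.submodule_topologicalClosure_eq isClosed_hardyLeft]

/-- **`𝒫`, the orthogonal projection of `L²(∂ℂ_−)` on `H²(ℂ_−)`** (§5.3 p0016:L12; Def. 5.2), as a
bounded operator (Mathlib `Submodule.starProjection` of the closed subspace `hardyLeft`).
[cite: ConnesConsani2021QuasiInner, §5.3 (arXiv chunk p0016:L12)] -/
def hardyLeftProj : Lp ℂ 2 (volume : Measure ℝ) →L[ℂ] Lp ℂ 2 (volume : Measure ℝ) :=
  haveI : CompleteSpace hardyLeft := isClosed_hardyLeft.completeSpace_coe
  hardyLeft.starProjection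

/-- `𝒫 ξ = ξ ↔ ξ ∈ H²(ℂ_−)`. [cite: ConnesConsani2021QuasiInner, §5.3 (arXiv chunk p0016:L12)] -/
theorem hardyLeftProj_eq_self_iff (ξ : Lp ℂ 2 (volume : Measure ℝ)) :
    hardyLeftProj ξ = ξ ↔ ξ ∈ hardyLeft := by
  haveI : CompleteSpace hardyLeft := isClosed_hardyLeft.completeSpace_coe
  exact Submodule.starProjection_eq_self_iff (K := hardyLeft)

/-- `𝒫 ξ = 0 ↔ ξ ∈ H²(ℂ_+)` (`= H²(ℂ_−)ᗮ`). [cite: ConnesConsani2021QuasiInner, §5.3 (arXiv chunk p0016:L12)] -/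
theorem hardyLeftProj_eq_zero_iff (ξ : Lp ℂ 2 (volume : Measure ℝ)) :
    hardyLeftProj ξ = 0 ↔ ξ ∈ hardyRight := by
  haveI : CompleteSpace hardyLeft := isClosed_hardyLeft.completeSpace_coe
  have h := Submodule.starProjection_apply_eq_zero_iff (K := hardyLeft) (v := ξ)
  rw [hardyLeft_orthogonal_eq] at h
  exact h

/-! ## Definition 5.2: the Sonin space `S(u)` of a function `u ∈ L^∞(∂ℂ_−)` -/

/-- **Definition 5.2** (§5; arXiv chunk p0015:L17).  «Let `Ω ⊂ ℂ` be an open disk or a half plane and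
`u ∈ L^∞(∂Ω)` a quasi-inner function.  The Sonin space `S(u)` is the kernel of the operator
`(1 − 𝒫) u (1 − 𝒫) = u₂₂` where `𝒫` is the orthogonal projection of `L²(∂Ω)` on the Hardy space
`H²(Ω)` and `u` acts in `L²(∂Ω)` by multiplication.»  «We apply this definition to `ℂ_−`» (p0015:L19):
typed for `Ω = ℂ_−`, `∂Ω` the critical line, as the kernel of `u₂₂` INSIDE `(1 − 𝒫)L² = H²(ℂ_+)`
(the summand on which the matrix entry `u₂₂` acts; exactly the reading used in §5.4, p0016:L37–L40:
`ξ ∈ S(u(F))` means `ξ ∈ (1−𝒫)L² = H²(ℂ_+)` and `u(F)ξ ∈ 𝒫L² = H²(ℂ_−)`):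
`S(u) = {ξ ∈ H²(ℂ_+) | u·ξ ∈ H²(ℂ_−)}` (`mem_soninSpaceOf_iff_ker` gives the operator form
`(1 − 𝒫)ξ = ξ ∧ (1 − 𝒫)(uξ) = 0`).  Defined for every `u ∈ L^∞` (the quasi-inner hypothesis is not
needed to state it); `u` acts by Mathlib's Hölder product `Lp ℂ ∞ • Lp ℂ 2`.
[cite: ConnesConsani2021QuasiInner, Def. 5.2 (arXiv chunk p0015:L17)] -/
def soninSpaceOf (u : Lp ℂ ∞ (volume : Measure ℝ)) : Submodule ℂ (Lp ℂ 2 (volume : Measure ℝ)) where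
  carrier := {ξ | ξ ∈ hardyRight ∧ (u • ξ : Lp ℂ 2 (volume : Measure ℝ)) ∈ hardyLeft}
  zero_mem' := ⟨Submodule.zero_mem _, by rw [Lp.smul_zero]; exact Submodule.zero_mem _⟩
  add_mem' := by
    rintro ξ η ⟨hξ, hξ'⟩ ⟨hη, hη'⟩
    exact ⟨Submodule.add_mem _ hξ hη, by rw [Lp.add_smul]; exact Submodule.add_mem _ hξ' hη'⟩
  smul_mem' := by
    rintro c ξ ⟨hξ, hξ'⟩
    refine ⟨Submodule.smul_mem _ c hξ, ?_⟩
    rw [← Lp.smul_comm]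
    exact Submodule.smul_mem _ c hξ'

/-- Membership in `S(u)`: `ξ ∈ H²(ℂ_+)` and `uξ ∈ H²(ℂ_−)`. [cite: ConnesConsani2021QuasiInner, Def. 5.2 (arXiv chunk p0015:L17)] -/
theorem mem_soninSpaceOf_iff (u : Lp ℂ ∞ (volume : Measure ℝ)) (ξ : Lp ℂ 2 (volume : Measure ℝ)) :
    ξ ∈ soninSpaceOf u ↔ ξ ∈ hardyRight ∧ (u • ξ : Lp ℂ 2 (volume : Measure ℝ)) ∈ hardyLeft :=
  Iff.rfl

/-- **`S(u) = ker u₂₂`** in operator form: `ξ ∈ S(u)` iff `(1 − 𝒫)ξ = ξ` (`ξ` lies in the summand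
`(1 − 𝒫)L²`) and `(1 − 𝒫)(uξ) = 0` (`u₂₂ ξ = (1 − 𝒫)u(1 − 𝒫)ξ = 0`), exactly as printed in Def. 5.2.
PROVED. [cite: ConnesConsani2021QuasiInner, Def. 5.2 (arXiv chunk p0015:L17)] -/
theorem mem_soninSpaceOf_iff_ker (u : Lp ℂ ∞ (volume : Measure ℝ)) (ξ : Lp ℂ 2 (volume : Measure ℝ)) :
    ξ ∈ soninSpaceOf u ↔
      (1 - hardyLeftProj) ξ = ξ ∧ (1 - hardyLeftProj) (u • ξ : Lp ℂ 2 (volume : Measure ℝ)) = 0 := by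
  rw [mem_soninSpaceOf_iff, sub_apply, sub_apply, one_apply_eq_self, one_apply_eq_self, sub_eq_self,
    hardyLeftProj_eq_zero_iff, sub_eq_zero, eq_comm, hardyLeftProj_eq_self_iff]

/-! ## Theorem 5.3 (named facts; RH-FREE) -/

/-- **Theorem 5.3 (i)** (§5, `(mainsonin)`; arXiv chunk p0015:L22).  «Let `F` be a finite set of places
of `ℚ` containing the archimedean place, `u(F) = ∏_F ρ_v` the associated product of ratios of local
factors over `F`.  Then the Sonin space `S(u(F))` is infinite dimensional.»  Typed for `F ∪ {∞}` with
`F : Finset Nat.Primes`, `u(F)|_{∂ℂ_−} = placeBoundary F`.  NAMED FACT (RH-FREE; printed proof §5.4: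
from (ii) and Prop. 5.5 with the infinite-dimensionality of the classical Sonin space `S(1,1)`).
[cite: ConnesConsani2021QuasiInner, Thm 5.3 (i) (arXiv chunk p0015:L22)] -/
def thm_5_3_i : Prop :=
  ∀ F : Finset Nat.Primes, ¬ FiniteDimensional ℂ (soninSpaceOf (placeBoundary F))

/-- **Theorem 5.3 (ii), range clause** (arXiv chunk p0015:L22; proof §5.4 p0016:L31–L56).  «Let
`F ⊊ F'`… The multiplication by `D(F,F') = ∏_{p ∈ F'∖F}(1 − p^{−z})` defines an injective linear map
`S(u(F)) → S(u(F'))`»: the map INTO — `ξ ∈ S(u(F)) ⟹ D(F,F')ξ ∈ S(u(F'))` (printed proof: `D_{F''}ξ ∈ H²(ℂ_+)`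
by Lemma 5.6 and `u(F')D(F,F')ξ = N_{F''}u(F)ξ ∈ H²(ℂ_−)`).  NAMED FACT (RH-FREE); linearity is that of
multiplication and injectivity is PROVED (`dBoundary_smul_injective`), see `thm_5_3_ii_of_mapsTo`.
[cite: ConnesConsani2021QuasiInner, Thm 5.3 (ii) (arXiv chunk p0015:L22)] -/
def thm_5_3_ii_mapsTo : Prop :=
  ∀ F F' : Finset Nat.Primes, F ⊂ F' →
    ∀ ξ ∈ soninSpaceOf (placeBoundary F),
      (dBoundary (F' \ F) • ξ : Lp ℂ 2 (volume : Measure ℝ)) ∈ soninSpaceOf (placeBoundary F')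

/-- Injectivity of multiplication by `D(F'')` on `L²(∂ℂ_−)` (`D(F'')(½+is) ≠ 0` for every `s`): the
injectivity clause of Theorem 5.3 (ii), not spelled out in the printed proof.  PROVED.
[cite: ConnesConsani2021QuasiInner, Thm 5.3 (ii) (arXiv chunk p0015:L22)] -/
theorem dBoundary_smul_injective (F'' : Finset Nat.Primes) :
    Function.Injective fun ξ : Lp ℂ 2 (volume : Measure ℝ) =>
      (dBoundary F'' • ξ : Lp ℂ 2 (volume : Measure ℝ)) := by
  intro ξ η h
  have h1 := Lp.coeFn_lpSMul (r := 2) (dBoundary F'') ξ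
  have h2 := Lp.coeFn_lpSMul (r := 2) (dBoundary F'') η
  have hD := coeFn_dBoundary F''
  apply Lp.ext
  have h' : ((dBoundary F'' • ξ : Lp ℂ 2 (volume : Measure ℝ)) : ℝ → ℂ) =ᵐ[volume]
      ((dBoundary F'' • η : Lp ℂ 2 (volume : Measure ℝ)) : ℝ → ℂ) := by
    simp only at h; rw [h]
  filter_upwards [h1, h2, hD, h'] with x hx1 hx2 hxD hx
  rw [hx1, hx2, Pi.smul_apply', Pi.smul_apply', smul_eq_mul, smul_eq_mul, hxD] at hx
  exact mul_left_cancel₀ (dBoundaryFun_ne_zero F'' x) hx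

/-- **Theorem 5.3 (ii) as printed**, from the range clause: for `F ⊊ F'`, multiplication by `D(F,F')`
maps `S(u(F))` into `S(u(F'))`, is linear (it is the restriction of the linear map `ξ ↦ D(F,F')·ξ`) and
injective.  PROVED modulo the named fact `thm_5_3_ii_mapsTo`.
[cite: ConnesConsani2021QuasiInner, Thm 5.3 (ii) (arXiv chunk p0015:L22)] -/
theorem thm_5_3_ii_of_mapsTo (h : thm_5_3_ii_mapsTo) {F F' : Finset Nat.Primes} (hFF' : F ⊂ F') :
    (∀ ξ ∈ soninSpaceOf (placeBoundary F),
        (dBoundary (F' \ F) • ξ : Lp ℂ 2 (volume : Measure ℝ)) ∈ soninSpaceOf (placeBoundary F')) ∧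
      Set.InjOn (fun ξ : Lp ℂ 2 (volume : Measure ℝ) =>
        (dBoundary (F' \ F) • ξ : Lp ℂ 2 (volume : Measure ℝ))) (soninSpaceOf (placeBoundary F)) :=
  ⟨h F F' hFF', (dBoundary_smul_injective (F' \ F)).injOn⟩

/-! ## Proposition 5.5: Sonin's space `S(1,1)` is `S(ρ_∞) = ker (ρ_∞)₂₂` (named fact; RH-FREE)

§5.2 (p0015:L102–L113) transports `L²(ℝ)_ev` to `L²(∂ℂ_−)` by the unitary `w`, `(wξ)(λ) = λ^{1/2}ξ(λ)`
(eq. (5.1)), followed by the multiplicative Fourier transform `𝔽_μ(f)(s) = ∫₀^∞ f(v)v^{−is}d*v`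
(eq. (5.2)); explicitly `(𝔽_μ w ξ)(s) = ∫₀^∞ ξ(v) v^{−1/2−is} dv = ∫_ℝ e^{x/2}ξ(e^x) e^{−isx} dx`
`= (𝓕 G)(s/2π)` with `G(x) := e^{x/2}ξ(e^x)` and Mathlib's `𝓕` (kernel `e^{−2πixy}`).  Mathlib has no
Mellin–Plancherel unitary; we type the transport as the RELATION `IsMellinLineImage ξ η` («`η` is the
`𝔽_μ ∘ w`-image of `ξ`») through the `L²` class `G`, and Proposition 5.5 as the transport statement
`ξ ∈ S(1,1) ↔ η ∈ S(ρ_∞)` for every even `ξ` and its image `η` (for the bijection `𝔽_μ ∘ w` this is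
literally «the image of `S(1,1)` is `ker (ρ_∞)₂₂`»).  Printed proof (p0016:L1): `S(1,1)` is the
intersection of `P = 1 − 𝒫` (functions vanishing on `[−1,1]` ↦ `H²(ℂ_+)`) with
`ker 𝔽_{e_ℝ}⁻¹𝒫₁𝔽_{e_ℝ} = ker ρ_∞^*Pρ_∞ = ker Pρ_∞` (CC 2021 Selecta Lemma 6, tree fact `CC2021_lemma_6`:
`𝔽_{e_ℝ}^w = I ∘ u_∞^g`, with `I𝒫I = 1 − 𝒫`). -/

/-- `η` is the image of `ξ` under `𝔽_μ ∘ w` (§5.2 eqs. (5.1)–(5.2), p0015:L104–L113): there is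
`G ∈ L²(ℝ)` with `G(x) = e^{x/2} ξ(e^x)` a.e. (the isometric change of variable `v = e^x` on
`L²(ℝ₊, dv)`, the half of `L²(ℝ)_ev` that `w` sees) and `η(s) = (𝓕 G)(s/2π)` a.e.
(`= ∫ e^{x/2}ξ(e^x)e^{−isx}dx = ∫₀^∞ ξ(v)v^{−1/2−is}dv = 𝔽_μ(wξ)(s)`).
[cite: ConnesConsani2021QuasiInner, §5.2 eqs. (5.1)–(5.2) (arXiv chunk p0015:L104)] -/
def IsMellinLineImage (ξ η : Lp ℂ 2 (volume : Measure ℝ)) : Prop :=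
  ∃ G : Lp ℂ 2 (volume : Measure ℝ),
    ((G : ℝ → ℂ) =ᵐ[volume] fun x => (Real.exp (x / 2) : ℂ) * (ξ : ℝ → ℂ) (Real.exp x)) ∧
    ((η : ℝ → ℂ) =ᵐ[volume] fun s => ((𝓕 G : Lp ℂ 2 (volume : Measure ℝ)) : ℝ → ℂ) (s / (2 * π)))

/-- **Proposition 5.5** (§5.2; arXiv chunk p0015:L118).  «The image `(𝔽_μ ∘ w)(S(1,1))` of Sonin's space
is the kernel of the operator `(1 − 𝒫)ρ_∞(1 − 𝒫) = (ρ_∞)₂₂`.»  Typed as the transport statement: for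
every even `ξ ∈ L²(ℝ)` and every `η` that is its `𝔽_μ ∘ w`-image (`IsMellinLineImage`),
`ξ ∈ S(1,1) = soninSpace 1 1` iff `η ∈ S(ρ_∞) = soninSpaceOf archBoundary` (Def. 5.2 with
`u = u_∞ = ρ_∞|_{∂ℂ_−}`, `archUnitary_eq_Gammaℝ_div`).  NAMED FACT (RH-FREE); see the section docstring
for the printed proof via CC 2021 Lemma 6. [cite: ConnesConsani2021QuasiInner, Prop. 5.5 (arXiv chunk p0015:L118)] -/
def prop_5_5 : Prop :=
  ∀ ξ η : Lp ℂ 2 (volume : Measure ℝ), ξ ∈ evenPart → IsMellinLineImage ξ η →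
    (ξ ∈ soninSpace 1 1 ↔ η ∈ soninSpaceOf archBoundary)


/-! ## Theorem 5.3 (ii): proof of the range clause (discharge of `thm_5_3_ii_mapsTo`)

Printed proof (§5.4, arXiv chunk p0016:L31–L40): write `F″ = F′ ∖ F`, `D(F,F′) = D_{F″}`; for
`ξ ∈ S(u(F))` one has `D_{F″}ξ ∈ H²(ℂ_+)` because `D_{F″} ∈ H^∞(ℂ_+)` (Lemma 5.6), and
`u(F′)D_{F″}ξ = N_{F″}·u(F)ξ ∈ H²(ℂ_−)` because `u(F′) = u(F)·N_{F″}/D_{F″}` and `N_{F″} ∈ H^∞(ℂ_−)`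
(Lemma 5.6).  The tree has no `H^∞·H² ⊆ H²` module structure in boundary-value form, so we prove the
special case that is needed directly (a genuinely shorter road): on `∂ℂ_−` the factors of `D_{F″}` and
`N_{F″}` are `1 − p^{−z} = 1 − p^{−1/2}e^{2πibs}` with `b = −log p/2π ≤ 0` and
`1 − p^{z−1} = 1 − p^{−1/2}e^{2πibs}` with `b = log p/2π ≥ 0`; multiplication by the character `e^{2πibs}`
translates the (`L²`, Plancherel) Fourier transform by `b` (`fourier_charLinfty_smul`), hence preserves
`H²(ℂ_+) = {𝓕f = 0 a.e. on (0,∞)}` when `b ≤ 0` and `H²(ℂ_−) = {𝓕f = 0 a.e. on (−∞,0)}` when `b ≥ 0`. -/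

/-! ### Modulation by a character translates the `L²` Fourier transform -/

/-- `t ↦ e^{2πit}` is smooth (plumbing for the Schwartz multiplier `e^{2πibs}`). [folklore] -/
private theorem contDiff_fourierChar_coe :
    ContDiff ℝ ((⊤ : ℕ∞) : WithTop ℕ∞) (fun t : ℝ => (𝐞 t : ℂ)) := by
  have h : (fun t : ℝ => (𝐞 t : ℂ)) = fun t : ℝ => Complex.exp (((2 * π * t : ℝ) : ℂ) * I) := by
    funext t; exact Real.fourierChar_apply t
  rw [h]
  refine Complex.contDiff_exp.comp ?_
  exact ((ofRealCLM.contDiff.comp (contDiff_const.mul contDiff_id)).mul contDiff_const)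

/-- `(d/dt)^n e^{2πit} = (2πi)^n e^{2πit}`. [folklore] -/
private theorem iteratedDeriv_fourierChar_coe (n : ℕ) :
    iteratedDeriv n (fun t : ℝ => (𝐞 t : ℂ)) = fun t : ℝ => (2 * π * I) ^ n * (𝐞 t : ℂ) := by
  induction n with
  | zero => funext t; simp
  | succ n ih =>
      rw [iteratedDeriv_succ, ih]
      funext t
      rw [deriv_const_mul _ (Real.differentiable_fourierChar t), Real.deriv_fourierChar, pow_succ]
      ring

/-- `t ↦ e^{2πit}` has temperate growth (all derivatives bounded). [folklore] -/
private theorem hasTemperateGrowth_fourierChar_coe :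
    (fun t : ℝ => (𝐞 t : ℂ)).HasTemperateGrowth := by
  refine ⟨contDiff_fourierChar_coe, fun n => ⟨0, (2 * π) ^ n, fun t => ?_⟩⟩
  rw [norm_iteratedFDeriv_eq_norm_iteratedDeriv, iteratedDeriv_fourierChar_coe]
  simp only [norm_mul, norm_pow, Circle.norm_coe, mul_one, pow_zero]
  rw [show ‖(2 : ℂ)‖ * ‖(π : ℂ)‖ * ‖I‖ = 2 * π by simp [abs_of_pos Real.pi_pos]]

/-- `s ↦ e^{2πibs}` has temperate growth, so it multiplies Schwartz functions. [folklore] -/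
private theorem hasTemperateGrowth_fourierChar_mul (b : ℝ) :
    (fun x : ℝ => (𝐞 (b * x) : ℂ)).HasTemperateGrowth :=
  hasTemperateGrowth_fourierChar_coe.comp
    ((Function.HasTemperateGrowth.const b).mul Function.HasTemperateGrowth.id')

/-- `s ↦ e^{2πibs}` is continuous. [folklore] -/
private theorem continuous_fourierChar_mul (b : ℝ) : Continuous fun x : ℝ => (𝐞 (b * x) : ℂ) :=
  Continuous.comp continuous_subtype_val
    (Real.continuous_fourierChar.comp (continuous_const.mul continuous_id))

/-- The character `χ_b(s) = e^{2πibs}` of the critical line as an element of `L^∞(∂ℂ_−)` (for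
`b = ∓log p/2π` these are the boundary values `p^{∓is}` of `p^{1/2−z}`, `p^{z−1/2}`, the oscillatory parts
of the factors of `D_F`, `N_F`, eq. (5.3)). [cite: ConnesConsani2021QuasiInner, §5.3 eq. (5.3) (arXiv chunk p0016:L9)] -/
def charLinfty (b : ℝ) : Lp ℂ ∞ (volume : Measure ℝ) :=
  toLinfty (fun x : ℝ => (𝐞 (b * x) : ℂ)) (continuous_fourierChar_mul b) 1 fun x => by simp

/-- `charLinfty b` represents `s ↦ e^{2πibs}` a.e. [cite: ConnesConsani2021QuasiInner, §5.3 eq. (5.3) (arXiv chunk p0016:L9)] -/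
theorem coeFn_charLinfty (b : ℝ) :
    (charLinfty b : ℝ → ℂ) =ᵐ[volume] fun x => (𝐞 (b * x) : ℂ) :=
  coeFn_toLinfty _ _ _ _

/-- Translation `(τ_b g)(y) = g(y − b)` as a linear isometry of `L²(ℝ)`.
[cite: BrennerThomeeWahlbin1975, Ch. 1 §1.1 (1.1) p. 6] -/
def translateL2 (b : ℝ) : Lp ℂ 2 (volume : Measure ℝ) →ₗᵢ[ℂ] Lp ℂ 2 (volume : Measure ℝ) :=
  Lp.compMeasurePreservingₗᵢ ℂ (fun y : ℝ => y - b) (measurePreserving_sub_right volume b)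

/-- `τ_b g = g(· − b)` a.e. [cite: BrennerThomeeWahlbin1975, Ch. 1 §1.1 (1.1) p. 6] -/
theorem coeFn_translateL2 (b : ℝ) (g : Lp ℂ 2 (volume : Measure ℝ)) :
    (translateL2 b g : ℝ → ℂ) =ᵐ[volume] fun y => (g : ℝ → ℂ) (y - b) :=
  Lp.coeFn_compMeasurePreserving g (measurePreserving_sub_right volume b)

/-- Multiplication by `e^{2πibs}` is continuous on `L²(ℝ)` (it is Mathlib's bounded bilinear Hölder map
`holderL`). [folklore] -/
private theorem continuous_charLinfty_smul (b : ℝ) :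
    Continuous fun f : Lp ℂ 2 (volume : Measure ℝ) =>
      (charLinfty b • f : Lp ℂ 2 (volume : Measure ℝ)) := by
  have : (fun f : Lp ℂ 2 (volume : Measure ℝ) => (charLinfty b • f : Lp ℂ 2 (volume : Measure ℝ))) =
      fun f => (ContinuousLinearMap.lsmul ℂ ℂ).holderL (volume : Measure ℝ) ∞ 2 2 (charLinfty b) f := by
    funext f
    rw [ContinuousLinearMap.holderL_apply_apply]
    refine Lp.ext ?_
    filter_upwards [Lp.coeFn_lpSMul (r := 2) (charLinfty b) f,
      (ContinuousLinearMap.lsmul ℂ ℂ).coeFn_holder (r := 2) (charLinfty b) f] with x h1 h2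
    rw [h1, h2, Pi.smul_apply', ContinuousLinearMap.lsmul_apply]
  rw [this]
  exact ContinuousLinearMap.continuous _

/-- **Modulation is translation of the Fourier transform, on `L²(ℝ)`**: `𝓕(e^{2πib·}f) = (𝓕f)(· − b)`
for Mathlib's unitary `L²` Fourier transform (proved on Schwartz functions from the integral formula and
extended by density and continuity). [cite: BrennerThomeeWahlbin1975, Ch. 1 Thm 2.8 (proof), §1.1 (1.1) p. 6] -/
theorem fourier_charLinfty_smul (b : ℝ) (f : Lp ℂ 2 (volume : Measure ℝ)) :
    (𝓕 (charLinfty b • f : Lp ℂ 2 (volume : Measure ℝ)) : Lp ℂ 2 (volume : Measure ℝ)) =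
      translateL2 b (𝓕 f) := by
  have hL : Continuous fun f : Lp ℂ 2 (volume : Measure ℝ) =>
      (𝓕 (charLinfty b • f : Lp ℂ 2 (volume : Measure ℝ)) : Lp ℂ 2 (volume : Measure ℝ)) :=
    (Lp.fourierTransformₗᵢ ℝ ℂ).continuous.comp (continuous_charLinfty_smul b)
  have hR : Continuous fun f : Lp ℂ 2 (volume : Measure ℝ) => translateL2 b (𝓕 f) :=
    (translateL2 b).continuous.comp (Lp.fourierTransformₗᵢ ℝ ℂ).continuous
  refine DenseRange.induction_on
    (p := fun f : Lp ℂ 2 (volume : Measure ℝ) =>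
      (𝓕 (charLinfty b • f : Lp ℂ 2 (volume : Measure ℝ)) : Lp ℂ 2 (volume : Measure ℝ)) =
        translateL2 b (𝓕 f))
    (SchwartzMap.denseRange_toLpCLM (F := ℂ) (E := ℝ) (p := 2) (μ := (volume : Measure ℝ))
      ENNReal.ofNat_ne_top) f (isClosed_eq hL hR) ?_
  intro φ
  have hχ := hasTemperateGrowth_fourierChar_mul b
  set ψ : SchwartzMap ℝ ℂ := SchwartzMap.smulLeftCLM ℂ (fun x : ℝ => (𝐞 (b * x) : ℂ)) φ with hψ
  have hφ : (SchwartzMap.toLpCLM ℝ ℂ 2 (volume : Measure ℝ)) φ = φ.toLp 2 volume := rfl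
  rw [hφ]
  -- (i) `e^{2πib·} • [φ] = [ψ]`
  have h1 : (charLinfty b • φ.toLp 2 volume : Lp ℂ 2 (volume : Measure ℝ)) = ψ.toLp 2 volume := by
    refine Lp.ext ?_
    filter_upwards [Lp.coeFn_lpSMul (r := 2) (charLinfty b) (φ.toLp 2 volume), coeFn_charLinfty b,
      φ.coeFn_toLp 2 volume, ψ.coeFn_toLp 2 volume] with x h1 h2 h3 h4
    rw [h1, Pi.smul_apply', h2, h3, h4, hψ, SchwartzMap.smulLeftCLM_apply_apply hχ]
  rw [h1, SchwartzMap.toLp_fourier_eq, SchwartzMap.toLp_fourier_eq]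
  -- (ii) compare a.e. representatives through the integral formula
  refine Lp.ext ?_
  have h3 : (fun y : ℝ => (((𝓕 φ).toLp 2 volume : Lp ℂ 2 (volume : Measure ℝ)) : ℝ → ℂ) (y - b))
      =ᵐ[volume] fun y : ℝ => (𝓕 φ : SchwartzMap ℝ ℂ) (y - b) :=
    (measurePreserving_sub_right volume b).quasiMeasurePreserving.ae_eq_comp
      ((𝓕 φ).coeFn_toLp 2 volume)
  filter_upwards [(𝓕 ψ).coeFn_toLp 2 (volume : Measure ℝ),
    coeFn_translateL2 b ((𝓕 φ).toLp 2 volume), h3] with y hy1 hy2 hy3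
  rw [hy1, hy2, hy3, SchwartzMap.fourier_coe, SchwartzMap.fourier_coe]
  have hψfun : (⇑ψ : ℝ → ℂ) = fun x => (𝐞 (b * x) : ℂ) * φ x := by
    funext x
    rw [hψ, SchwartzMap.smulLeftCLM_apply_apply hχ, smul_eq_mul]
  rw [hψfun, Real.fourier_real_eq, Real.fourier_real_eq]
  refine integral_congr_ae (Filter.Eventually.of_forall fun v => ?_)
  dsimp only
  rw [Circle.smul_def, Circle.smul_def, smul_eq_mul, smul_eq_mul, ← mul_assoc, ← Circle.coe_mul,
    ← AddChar.map_add_eq_mul]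
  have : -(v * y) + b * v = -(v * (y - b)) := by ring
  rw [this]

/-! ### Characters with nonpositive / nonnegative frequency preserve `H²(ℂ_+)` / `H²(ℂ_−)` -/

/-- `e^{2πibs}·H²(ℂ_+) ⊆ H²(ℂ_+)` for `b ≤ 0` (the Fourier transform is translated to the left).
[cite: ConnesConsani2021QuasiInner, §5.4 proof of Thm 5.3 (arXiv chunk p0016:L37)] -/
theorem charLinfty_smul_mem_hardyRight {b : ℝ} (hb : b ≤ 0) {ξ : Lp ℂ 2 (volume : Measure ℝ)}
    (hξ : ξ ∈ hardyRight) : (charLinfty b • ξ : Lp ℂ 2 (volume : Measure ℝ)) ∈ hardyRight := by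
  rw [mem_hardyRight_iff] at hξ ⊢
  rw [fourier_charLinfty_smul]
  have h2 : ∀ᵐ y : ℝ, y - b ∈ Ioi (0 : ℝ) →
      ((𝓕 ξ : Lp ℂ 2 (volume : Measure ℝ)) : ℝ → ℂ) (y - b) = 0 :=
    (measurePreserving_sub_right volume b).quasiMeasurePreserving.ae hξ
  filter_upwards [coeFn_translateL2 b (𝓕 ξ), h2] with y hy1 hy2 hy
  rw [hy1]
  exact hy2 (by rw [Set.mem_Ioi] at hy ⊢; linarith)

/-- `e^{2πibs}·H²(ℂ_−) ⊆ H²(ℂ_−)` for `0 ≤ b` (the Fourier transform is translated to the right).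
[cite: ConnesConsani2021QuasiInner, §5.4 proof of Thm 5.3 (arXiv chunk p0016:L40)] -/
theorem charLinfty_smul_mem_hardyLeft {b : ℝ} (hb : 0 ≤ b) {ξ : Lp ℂ 2 (volume : Measure ℝ)}
    (hξ : ξ ∈ hardyLeft) : (charLinfty b • ξ : Lp ℂ 2 (volume : Measure ℝ)) ∈ hardyLeft := by
  rw [mem_hardyLeft_iff] at hξ ⊢
  rw [fourier_charLinfty_smul]
  have h2 : ∀ᵐ y : ℝ, y - b ∈ Iio (0 : ℝ) →
      ((𝓕 ξ : Lp ℂ 2 (volume : Measure ℝ)) : ℝ → ℂ) (y - b) = 0 :=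
    (measurePreserving_sub_right volume b).quasiMeasurePreserving.ae hξ
  filter_upwards [coeFn_translateL2 b (𝓕 ξ), h2] with y hy1 hy2 hy
  rw [hy1]
  exact hy2 (by rw [Set.mem_Iio] at hy ⊢; linarith)

/-- Multipliers agreeing a.e. with `1 − c·e^{2πibs}` act as `η ↦ η − c·(χ_b η)`. [folklore] -/
private theorem smul_eq_of_ae_eq_one_sub (U : Lp ℂ ∞ (volume : Measure ℝ)) (c : ℂ) (b : ℝ)
    (hU : (U : ℝ → ℂ) =ᵐ[volume] fun s => 1 - c * (𝐞 (b * s) : ℂ))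
    (η : Lp ℂ 2 (volume : Measure ℝ)) :
    (U • η : Lp ℂ 2 (volume : Measure ℝ)) =
      η - c • (charLinfty b • η : Lp ℂ 2 (volume : Measure ℝ)) := by
  refine Lp.ext ?_
  filter_upwards [Lp.coeFn_lpSMul (r := 2) U η, hU,
    Lp.coeFn_sub η (c • (charLinfty b • η : Lp ℂ 2 (volume : Measure ℝ))),
    Lp.coeFn_smul c (charLinfty b • η : Lp ℂ 2 (volume : Measure ℝ)),
    Lp.coeFn_lpSMul (r := 2) (charLinfty b) η, coeFn_charLinfty b] with s h1 h2 h3 h4 h5 h6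
  rw [h1, Pi.smul_apply', h2, h3, Pi.sub_apply, h4, Pi.smul_apply, h5, Pi.smul_apply', h6,
    smul_eq_mul, smul_eq_mul, smul_eq_mul]
  ring

/-- A multiplier agreeing a.e. with a pointwise product acts as the composite. [folklore] -/
private theorem smul_eq_smul_smul (U V W : Lp ℂ ∞ (volume : Measure ℝ))
    (hUVW : (U : ℝ → ℂ) =ᵐ[volume] fun s => (V : ℝ → ℂ) s * (W : ℝ → ℂ) s)
    (η : Lp ℂ 2 (volume : Measure ℝ)) :
    (U • η : Lp ℂ 2 (volume : Measure ℝ)) = V • (W • η : Lp ℂ 2 (volume : Measure ℝ)) := by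
  refine Lp.ext ?_
  filter_upwards [Lp.coeFn_lpSMul (r := 2) U η, hUVW,
    Lp.coeFn_lpSMul (r := 2) V (W • η : Lp ℂ 2 (volume : Measure ℝ)),
    Lp.coeFn_lpSMul (r := 2) W η] with s h1 h2 h3 h4
  rw [h1, Pi.smul_apply', h2, h3, Pi.smul_apply', h4, Pi.smul_apply', smul_eq_mul, smul_eq_mul,
    smul_eq_mul, mul_assoc]

/-! ### The factors `1 − p^{−z}` and `1 − p^{z−1}` on the critical line -/

/-- `p^{−z(s)} = p^{−1/2}·e^{2πibs}` with `b = −log p/2π`. [cite: ConnesConsani2021QuasiInner, §5.3 eq. (5.3) (arXiv chunk p0016:L9)] -/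
theorem natCast_cpow_neg_critPt {p : ℕ} (hp : 0 < p) (s : ℝ) :
    (p : ℂ) ^ (-critPt s) = (p : ℂ) ^ (-(1 / 2 : ℂ)) * (𝐞 (-(Real.log p / (2 * π)) * s) : ℂ) := by
  have hp0 : (p : ℂ) ≠ 0 := Nat.cast_ne_zero.mpr hp.ne'
  rw [critPt, neg_add, Complex.cpow_add _ _ hp0]
  congr 1
  rw [Complex.cpow_def_of_ne_zero hp0, Real.fourierChar_apply, ← Complex.natCast_log]
  congr 1
  have h2 : (2 * π * (-(Real.log p / (2 * π)) * s)) = -(Real.log p * s) := by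
    field_simp
  rw [h2]
  push_cast
  ring

/-- `p^{z(s)−1} = p^{−1/2}·e^{2πibs}` with `b = log p/2π`. [cite: ConnesConsani2021QuasiInner, §5.3 eq. (5.3) (arXiv chunk p0016:L9)] -/
theorem natCast_cpow_critPt_sub_one {p : ℕ} (hp : 0 < p) (s : ℝ) :
    (p : ℂ) ^ (critPt s - 1) = (p : ℂ) ^ (-(1 / 2 : ℂ)) * (𝐞 ((Real.log p / (2 * π)) * s) : ℂ) := by
  have hp0 : (p : ℂ) ≠ 0 := Nat.cast_ne_zero.mpr hp.ne'
  rw [show critPt s - 1 = -(1 / 2 : ℂ) + s * I by rw [critPt]; ring, Complex.cpow_add _ _ hp0]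
  congr 1
  rw [Complex.cpow_def_of_ne_zero hp0, Real.fourierChar_apply, ← Complex.natCast_log]
  congr 1
  have h2 : (2 * π * (Real.log p / (2 * π) * s)) = Real.log p * s := by
    field_simp
  rw [h2]
  push_cast
  ring

/-- `1 − p^{−z(s)} ≠ 0` on the critical line (`|p^{−z}| = p^{−1/2} < 1`). [cite: ConnesConsani2021QuasiInner, Thm 5.3 (ii) (arXiv chunk p0015:L22)] -/
theorem one_sub_cpow_neg_critPt_ne_zero (p : Nat.Primes) (s : ℝ) :
    1 - ((p : ℕ) : ℂ) ^ (-critPt s) ≠ 0 := by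
  have h := dBoundaryFun_ne_zero {p} s
  rwa [dBoundaryFun, Finset.prod_singleton] at h

/-- `N(F'')(½ + is) := ∏_{p ∈ F''} (1 − p^{z−1})`, `z = ½ + is`: the numerator `N_{F″}` of eq. (5.3)
restricted to `∂ℂ_−`. [cite: ConnesConsani2021QuasiInner, §5.3 eq. (5.3) (arXiv chunk p0016:L9)] -/
def numerBoundaryFun (F : Finset Nat.Primes) (s : ℝ) : ℂ :=
  ∏ p ∈ F, (1 - ((p : ℕ) : ℂ) ^ (critPt s - 1))

/-- Unfolding `numerBoundaryFun`. [cite: ConnesConsani2021QuasiInner, §5.3 eq. (5.3) (arXiv chunk p0016:L9)] -/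
theorem numerBoundaryFun_def (F : Finset Nat.Primes) (s : ℝ) :
    numerBoundaryFun F s = ∏ p ∈ F, (1 - ((p : ℕ) : ℂ) ^ (critPt s - 1)) := rfl

/-- `N(F'')|_{∂ℂ_−} = N_{F''}(½ + is)` for the function `numerN` of eq. (5.3).
[cite: ConnesConsani2021QuasiInner, §5.3 eq. (5.3) (arXiv chunk p0016:L9)] -/
theorem numerBoundaryFun_eq_numerN (F : Finset Nat.Primes) (s : ℝ) :
    numerBoundaryFun F s = numerN (F.image fun p : Nat.Primes => (p : ℕ)) (critPt s) := by
  rw [numerBoundaryFun, numerN, Finset.prod_image]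
  exact fun p _ q _ h => Nat.Primes.coe_nat_injective h

/-- `|N(F'')| ≤ 2^{#F''}` on `∂ℂ_−` (each `|p^{z−1}| = p^{−1/2} ≤ 1`). [cite: ConnesConsani2021QuasiInner, Lemma 5.6 proof (arXiv chunk p0016:L17)] -/
theorem norm_numerBoundaryFun_le (F : Finset Nat.Primes) (s : ℝ) :
    ‖numerBoundaryFun F s‖ ≤ 2 ^ F.card := by
  rw [numerBoundaryFun, norm_prod, ← Finset.prod_const]
  refine Finset.prod_le_prod (fun _ _ => norm_nonneg _) fun p _ => ?_
  have hpR : (0 : ℝ) < (p : ℕ) := by exact_mod_cast p.2.pos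
  have hle : ‖((p : ℕ) : ℂ) ^ (critPt s - 1)‖ ≤ 1 := by
    rw [show ((p : ℕ) : ℂ) = (((p : ℕ) : ℝ) : ℂ) by norm_cast,
      Complex.norm_cpow_eq_rpow_re_of_pos hpR]
    refine Real.rpow_le_one_of_one_le_of_nonpos (by exact_mod_cast p.2.one_lt.le) ?_
    rw [sub_re, critPt_re, one_re]; norm_num
  calc ‖1 - ((p : ℕ) : ℂ) ^ (critPt s - 1)‖ ≤ ‖(1 : ℂ)‖ + ‖((p : ℕ) : ℂ) ^ (critPt s - 1)‖ :=
        norm_sub_le _ _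
    _ ≤ 2 := by rw [norm_one]; linarith

/-- `N(F'')` is continuous on `∂ℂ_−`. [cite: ConnesConsani2021QuasiInner, §5.3 eq. (5.3) (arXiv chunk p0016:L9)] -/
theorem continuous_numerBoundaryFun (F : Finset Nat.Primes) : Continuous (numerBoundaryFun F) := by
  unfold numerBoundaryFun
  exact continuous_finsetProd F fun p _ =>
    continuous_const.sub ((continuous_critPt.sub continuous_const).const_cpow
      (Or.inl (Nat.cast_ne_zero.mpr p.2.ne_zero)))

/-- `N(F'') ∈ L^∞(∂ℂ_−)`. [cite: ConnesConsani2021QuasiInner, §5.4 proof of Thm 5.3 (arXiv chunk p0016:L40)] -/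
def numerBoundary (F : Finset Nat.Primes) : Lp ℂ ∞ (volume : Measure ℝ) :=
  toLinfty (numerBoundaryFun F) (continuous_numerBoundaryFun F) (2 ^ F.card)
    (norm_numerBoundaryFun_le F)

/-- `numerBoundary F` represents `N(F)` a.e. [cite: ConnesConsani2021QuasiInner, §5.4 proof of Thm 5.3 (arXiv chunk p0016:L40)] -/
theorem coeFn_numerBoundary (F : Finset Nat.Primes) :
    (numerBoundary F : ℝ → ℂ) =ᵐ[volume] numerBoundaryFun F :=
  coeFn_toLinfty _ _ _ _

/-- **`u(F′)·D(F,F′) = N_{F′∖F}·u(F)` on `∂ℂ_−`** for `F ⊆ F′` (§5.4 p0016:L40: «`u(F′) D(F,F′)ξ = N_{F″}h`,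
`h = u(F)ξ`»). [cite: ConnesConsani2021QuasiInner, §5.4 proof of Thm 5.3 (arXiv chunk p0016:L40)] -/
theorem placeBoundaryFun_mul_dBoundaryFun {F F' : Finset Nat.Primes} (h : F ⊆ F') (s : ℝ) :
    placeBoundaryFun F' s * dBoundaryFun (F' \ F) s =
      numerBoundaryFun (F' \ F) s * placeBoundaryFun F s := by
  have hPD : (∏ p ∈ F' \ F, (1 - ((p : ℕ) : ℂ) ^ (critPt s - 1)) / (1 - ((p : ℕ) : ℂ) ^ (-critPt s))) *
      dBoundaryFun (F' \ F) s = numerBoundaryFun (F' \ F) s := by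
    rw [dBoundaryFun, numerBoundaryFun, ← Finset.prod_mul_distrib]
    exact Finset.prod_congr rfl fun p _ => div_mul_cancel₀ _ (one_sub_cpow_neg_critPt_ne_zero p s)
  rw [placeBoundaryFun, placeBoundaryFun, ← Finset.prod_sdiff h, ← hPD]
  ring

/-- The same identity for the `L^∞` multipliers acting on `L²(∂ℂ_−)`:
`u(F′)·(D(F,F′)ξ) = N_{F′∖F}·(u(F)ξ)`. [cite: ConnesConsani2021QuasiInner, §5.4 proof of Thm 5.3 (arXiv chunk p0016:L40)] -/
theorem placeBoundary_smul_dBoundary_smul {F F' : Finset Nat.Primes} (h : F ⊆ F')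
    (ξ : Lp ℂ 2 (volume : Measure ℝ)) :
    (placeBoundary F' • (dBoundary (F' \ F) • ξ : Lp ℂ 2 (volume : Measure ℝ)) :
        Lp ℂ 2 (volume : Measure ℝ)) =
      numerBoundary (F' \ F) • (placeBoundary F • ξ : Lp ℂ 2 (volume : Measure ℝ)) := by
  refine Lp.ext ?_
  filter_upwards [Lp.coeFn_lpSMul (r := 2) (placeBoundary F')
      (dBoundary (F' \ F) • ξ : Lp ℂ 2 (volume : Measure ℝ)),
    Lp.coeFn_lpSMul (r := 2) (dBoundary (F' \ F)) ξ,
    Lp.coeFn_lpSMul (r := 2) (numerBoundary (F' \ F))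
      (placeBoundary F • ξ : Lp ℂ 2 (volume : Measure ℝ)),
    Lp.coeFn_lpSMul (r := 2) (placeBoundary F) ξ,
    coeFn_placeBoundary F', coeFn_placeBoundary F, coeFn_dBoundary (F' \ F),
    coeFn_numerBoundary (F' \ F)] with s h1 h2 h3 h4 h5 h6 h7 h8
  rw [h1, Pi.smul_apply', h2, Pi.smul_apply', h3, Pi.smul_apply', h4, Pi.smul_apply', h5, h6, h7, h8,
    smul_eq_mul, smul_eq_mul, smul_eq_mul, smul_eq_mul, ← mul_assoc, ← mul_assoc,
    placeBoundaryFun_mul_dBoundaryFun h]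

/-! ### `D_{F″}·H²(ℂ_+) ⊆ H²(ℂ_+)` and `N_{F″}·H²(ℂ_−) ⊆ H²(ℂ_−)` -/

/-- **`D_{F″}ξ ∈ H²(ℂ_+)` for `ξ ∈ H²(ℂ_+)`** (§5.4 p0016:L37; there from `D_{F″} ∈ H^∞(ℂ_+)`, Lemma 5.6).
[cite: ConnesConsani2021QuasiInner, §5.4 proof of Thm 5.3 (arXiv chunk p0016:L37)] -/
theorem dBoundary_smul_mem_hardyRight (F'' : Finset Nat.Primes) {η : Lp ℂ 2 (volume : Measure ℝ)}
    (hη : η ∈ hardyRight) : (dBoundary F'' • η : Lp ℂ 2 (volume : Measure ℝ)) ∈ hardyRight := by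
  induction F'' using Finset.induction_on with
  | empty =>
      have : (dBoundary ∅ • η : Lp ℂ 2 (volume : Measure ℝ)) = η := by
        refine Lp.ext ?_
        filter_upwards [Lp.coeFn_lpSMul (r := 2) (dBoundary ∅) η, coeFn_dBoundary ∅] with s h1 h2
        rw [h1, Pi.smul_apply', h2, dBoundaryFun, Finset.prod_empty, one_smul]
      rw [this]; exact hη
  | insert p F hp ih =>
      have hsplit : ((dBoundary (insert p F) : Lp ℂ ∞ (volume : Measure ℝ)) : ℝ → ℂ) =ᵐ[volume]
          fun s => (dBoundary {p} : ℝ → ℂ) s * (dBoundary F : ℝ → ℂ) s := by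
        filter_upwards [coeFn_dBoundary (insert p F), coeFn_dBoundary {p}, coeFn_dBoundary F]
          with s h1 h2 h3
        rw [h1, h2, h3, dBoundaryFun, dBoundaryFun, dBoundaryFun, Finset.prod_insert hp,
          Finset.prod_singleton]
      rw [smul_eq_smul_smul _ _ _ hsplit]
      have hfac : ((dBoundary {p} : Lp ℂ ∞ (volume : Measure ℝ)) : ℝ → ℂ) =ᵐ[volume]
          fun s => 1 - ((p : ℕ) : ℂ) ^ (-(1 / 2 : ℂ)) * (𝐞 (-(Real.log (p : ℕ) / (2 * π)) * s) : ℂ) := by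
        filter_upwards [coeFn_dBoundary {p}] with s h1
        rw [h1, dBoundaryFun, Finset.prod_singleton, natCast_cpow_neg_critPt p.2.pos]
      rw [smul_eq_of_ae_eq_one_sub _ _ _ hfac]
      refine Submodule.sub_mem _ ih (Submodule.smul_mem _ _ (charLinfty_smul_mem_hardyRight ?_ ih))
      have : 0 ≤ Real.log (p : ℕ) := Real.log_nonneg (by exact_mod_cast p.2.one_lt.le)
      have hπ : 0 < 2 * π := by positivity
      exact neg_nonpos.mpr (div_nonneg this hπ.le)

/-- **`N_{F″}h ∈ H²(ℂ_−)` for `h ∈ H²(ℂ_−)`** (§5.4 p0016:L40; there from `N_{F″} ∈ H^∞(ℂ_−)`, Lemma 5.6).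
[cite: ConnesConsani2021QuasiInner, §5.4 proof of Thm 5.3 (arXiv chunk p0016:L40)] -/
theorem numerBoundary_smul_mem_hardyLeft (F'' : Finset Nat.Primes) {η : Lp ℂ 2 (volume : Measure ℝ)}
    (hη : η ∈ hardyLeft) : (numerBoundary F'' • η : Lp ℂ 2 (volume : Measure ℝ)) ∈ hardyLeft := by
  induction F'' using Finset.induction_on with
  | empty =>
      have : (numerBoundary ∅ • η : Lp ℂ 2 (volume : Measure ℝ)) = η := by
        refine Lp.ext ?_
        filter_upwards [Lp.coeFn_lpSMul (r := 2) (numerBoundary ∅) η, coeFn_numerBoundary ∅]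
          with s h1 h2
        rw [h1, Pi.smul_apply', h2, numerBoundaryFun, Finset.prod_empty, one_smul]
      rw [this]; exact hη
  | insert p F hp ih =>
      have hsplit : ((numerBoundary (insert p F) : Lp ℂ ∞ (volume : Measure ℝ)) : ℝ → ℂ) =ᵐ[volume]
          fun s => (numerBoundary {p} : ℝ → ℂ) s * (numerBoundary F : ℝ → ℂ) s := by
        filter_upwards [coeFn_numerBoundary (insert p F), coeFn_numerBoundary {p},
          coeFn_numerBoundary F] with s h1 h2 h3
        rw [h1, h2, h3, numerBoundaryFun, numerBoundaryFun, numerBoundaryFun, Finset.prod_insert hp,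
          Finset.prod_singleton]
      rw [smul_eq_smul_smul _ _ _ hsplit]
      have hfac : ((numerBoundary {p} : Lp ℂ ∞ (volume : Measure ℝ)) : ℝ → ℂ) =ᵐ[volume]
          fun s => 1 - ((p : ℕ) : ℂ) ^ (-(1 / 2 : ℂ)) * (𝐞 ((Real.log (p : ℕ) / (2 * π)) * s) : ℂ) := by
        filter_upwards [coeFn_numerBoundary {p}] with s h1
        rw [h1, numerBoundaryFun, Finset.prod_singleton, natCast_cpow_critPt_sub_one p.2.pos]
      rw [smul_eq_of_ae_eq_one_sub _ _ _ hfac]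
      refine Submodule.sub_mem _ ih (Submodule.smul_mem _ _ (charLinfty_smul_mem_hardyLeft ?_ ih))
      have : 0 ≤ Real.log (p : ℕ) := Real.log_nonneg (by exact_mod_cast p.2.one_lt.le)
      have hπ : 0 < 2 * π := by positivity
      exact div_nonneg this hπ.le

/-- **Theorem 5.3 (ii), range clause — PROVED** (discharge of the named fact `thm_5_3_ii_mapsTo`): for
`F ⊊ F′` and `ξ ∈ S(u(F))`, `D(F,F′)ξ ∈ S(u(F′))`: `D_{F′∖F}ξ ∈ H²(ℂ_+)` and
`u(F′)D(F,F′)ξ = N_{F′∖F}·u(F)ξ ∈ H²(ℂ_−)`.  RH-FREE.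
[cite: ConnesConsani2021QuasiInner, Thm 5.3 (ii) (arXiv chunk p0015:L22; proof p0016:L31–L40)] -/
theorem thm_5_3_ii_mapsTo_holds : thm_5_3_ii_mapsTo := by
  intro F F' hFF' ξ hξ
  rw [mem_soninSpaceOf_iff] at hξ ⊢
  refine ⟨dBoundary_smul_mem_hardyRight (F' \ F) hξ.1, ?_⟩
  rw [placeBoundary_smul_dBoundary_smul hFF'.1 ξ]
  exact numerBoundary_smul_mem_hardyLeft (F' \ F) hξ.2

/-- **Theorem 5.3 (ii) as printed — PROVED**: for `F ⊊ F′`, multiplication by `D(F,F′)` maps `S(u(F))`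
into `S(u(F′))` and is injective there. RH-FREE.
[cite: ConnesConsani2021QuasiInner, Thm 5.3 (ii) (arXiv chunk p0015:L22)] -/
theorem thm_5_3_ii {F F' : Finset Nat.Primes} (hFF' : F ⊂ F') :
    (∀ ξ ∈ soninSpaceOf (placeBoundary F),
        (dBoundary (F' \ F) • ξ : Lp ℂ 2 (volume : Measure ℝ)) ∈ soninSpaceOf (placeBoundary F')) ∧
      Set.InjOn (fun ξ : Lp ℂ 2 (volume : Measure ℝ) =>
        (dBoundary (F' \ F) • ξ : Lp ℂ 2 (volume : Measure ℝ))) (soninSpaceOf (placeBoundary F)) :=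
  thm_5_3_ii_of_mapsTo thm_5_3_ii_mapsTo_holds hFF'


/-! ## Proposition 5.5, first half: `P ↦ 1 − 𝒫` — vanishing on `[−1,1]` ⟺ Mellin image in `H²(ℂ_+)`

Printed proof of Proposition 5.5 (arXiv chunk p0016:L1): «Sonin's space `S(1,1)` is the intersection of
`P = 1 − 𝒫` with the kernel of `𝒫̂₁ = 𝔽_{e_ℝ}⁻¹𝒫₁𝔽_{e_ℝ}`.  The latter is the same as the kernel of
`ρ_∞^* P ρ_∞` which in turns is the kernel of `Pρ_∞`.»  The first ingredient is the identification, under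
`𝔽_μ ∘ w`, of the projection `P` (even functions supported in `|v| ≥ 1`; CC 2021 Selecta eq. (17):
`P = 1_{[1,∞)}` on `L²(ℝ₊*, d*λ)`) with `1 − 𝒫`, the projection on `H²(ℂ_+)` (Paley–Wiener).  In the line
model of this file: `η(s) = (𝓕G)(s/2π)` with `G(x) = e^{x/2}ξ(e^x)` (`IsMellinLineImage`), so
`𝓕η = 2π·(𝓕𝓕G)(2π·) = 2π·G(−2π·)` (dilation law, and `𝓕𝓕 = reflection` on `L²(ℝ)` — the tree's
`Literature.Analysis.Fourier.fourier_fourier_eq_compNeg`), whence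
`𝓕η = 0` a.e. on `(0,∞)` ⟺ `G = 0` a.e. on `(−∞,0)` ⟺ `ξ = 0` a.e. on `(0,1)` (`v = e^x`; images of null
sets under the smooth maps `exp`, `log` are null) ⟺ `ξ = 0` a.e. on `[−1,1]` (`ξ` even).  PROVED:
`vanishOn_iff_mellinImage_mem_hardyRight`.  (The second ingredient, `ker Pρ_∞`, is CC 2021 Selecta
Lemma 6 — the tree theorem `CC2021_lemma_6_holds` — in `L²` form; not in this section.) -/

section PropFiveFiveFirstHalf

open Literature.Analysis.OperatorTheory (lpDilation lpDilation_coeFn quasiMeasurePreserving_smul'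
  ae_eq_comp_smul)
open Literature.Analysis.Fourier (coeFn_compNeg fourier_fourier_eq_compNeg)

/-- **Dilation law on `L²(ℝ)`**: `𝓕(u(c·)) = |c|⁻¹(𝓕u)(c⁻¹·)`, `c ≠ 0` (by density of Schwartz functions
from the function-level law `fourier_comp_smul`). [folklore] -/
private theorem fourier_lpDilation_line {c : ℝ} (hc : c ≠ 0) (u : Lp ℂ 2 (volume : Measure ℝ)) :
    (𝓕 (lpDilation (V := ℝ) (F := ℂ) (p := (2 : ℝ≥0∞)) c hc ENNReal.ofNat_ne_top u) :
        Lp ℂ 2 (volume : Measure ℝ)) =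
      (|c|⁻¹ : ℝ) • lpDilation (V := ℝ) (F := ℂ) (p := (2 : ℝ≥0∞)) c⁻¹ (inv_ne_zero hc)
        ENNReal.ofNat_ne_top (𝓕 u : Lp ℂ 2 (volume : Measure ℝ)) := by
  refine DenseRange.induction_on
    (p := fun u : Lp ℂ 2 (volume : Measure ℝ) =>
      (𝓕 (lpDilation (V := ℝ) (F := ℂ) (p := (2 : ℝ≥0∞)) c hc ENNReal.ofNat_ne_top u) :
          Lp ℂ 2 (volume : Measure ℝ)) =
        (|c|⁻¹ : ℝ) • lpDilation (V := ℝ) (F := ℂ) (p := (2 : ℝ≥0∞)) c⁻¹ (inv_ne_zero hc)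
          ENNReal.ofNat_ne_top (𝓕 u : Lp ℂ 2 (volume : Measure ℝ)))
    (SchwartzMap.denseRange_toLpCLM (F := ℂ) (E := ℝ) (p := 2) (μ := (volume : Measure ℝ))
      ENNReal.ofNat_ne_top) u
    (isClosed_eq
      ((Lp.fourierTransformₗᵢ ℝ ℂ).continuous.comp
        (lpDilation (V := ℝ) (F := ℂ) (p := (2 : ℝ≥0∞)) c hc ENNReal.ofNat_ne_top).continuous)
      ?_) ?_
  · have hR : Continuous fun u : Lp ℂ 2 (volume : Measure ℝ) =>
        lpDilation (V := ℝ) (F := ℂ) (p := (2 : ℝ≥0∞)) c⁻¹ (inv_ne_zero hc)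
          ENNReal.ofNat_ne_top (𝓕 u : Lp ℂ 2 (volume : Measure ℝ)) :=
      (lpDilation (V := ℝ) (F := ℂ) (p := (2 : ℝ≥0∞)) c⁻¹ (inv_ne_zero hc)
          ENNReal.ofNat_ne_top).continuous.comp (Lp.fourierTransformₗᵢ ℝ ℂ).continuous
    exact hR.const_smul (|c|⁻¹ : ℝ)
  intro φ
  have hφ : (SchwartzMap.toLpCLM ℝ ℂ 2 (volume : Measure ℝ)) φ = φ.toLp 2 volume := rfl
  rw [hφ]
  -- `ψ = φ(c ·)` as a Schwartz function
  set ψ : SchwartzMap ℝ ℂ := SchwartzMap.compCLMOfContinuousLinearEquiv ℂ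
    (ContinuousLinearEquiv.smulLeft (Units.mk0 c hc) : ℝ ≃L[ℝ] ℝ) φ with hψdef
  have hψ : ∀ x, ψ x = φ (c • x) := fun x => rfl
  have h1 : lpDilation (V := ℝ) (F := ℂ) (p := (2 : ℝ≥0∞)) c hc ENNReal.ofNat_ne_top
      (φ.toLp 2 volume) = ψ.toLp 2 volume := by
    refine Lp.ext ?_
    filter_upwards [lpDilation_coeFn (V := ℝ) (F := ℂ) (p := (2 : ℝ≥0∞)) hc ENNReal.ofNat_ne_top
      (φ.toLp 2 volume), ae_eq_comp_smul (φ.coeFn_toLp 2 (volume : Measure ℝ)) hc,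
      ψ.coeFn_toLp 2 (volume : Measure ℝ)] with x e1 e2 e3
    rw [e1, e2, e3, hψ]
  rw [h1, SchwartzMap.toLp_fourier_eq, SchwartzMap.toLp_fourier_eq]
  refine Lp.ext ?_
  filter_upwards [(𝓕 ψ).coeFn_toLp 2 (volume : Measure ℝ),
    Lp.coeFn_smul (|c|⁻¹ : ℝ) (lpDilation (V := ℝ) (F := ℂ) (p := (2 : ℝ≥0∞)) c⁻¹ (inv_ne_zero hc)
      ENNReal.ofNat_ne_top ((𝓕 φ).toLp 2 volume : Lp ℂ 2 (volume : Measure ℝ))),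
    lpDilation_coeFn (V := ℝ) (F := ℂ) (p := (2 : ℝ≥0∞)) (inv_ne_zero hc) ENNReal.ofNat_ne_top
      ((𝓕 φ).toLp 2 volume : Lp ℂ 2 (volume : Measure ℝ)),
    ae_eq_comp_smul ((𝓕 φ).coeFn_toLp 2 (volume : Measure ℝ)) (inv_ne_zero hc)] with x e1 e2 e3 e4
  rw [e1, e2, Pi.smul_apply, e3, e4, SchwartzMap.fourier_coe, SchwartzMap.fourier_coe]
  have hψfun : (⇑ψ : ℝ → ℂ) = fun x => φ (c • x) := funext hψ
  rw [hψfun, Literature.Analysis.Fourier.fourier_comp_smul (⇑φ) hc]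
  simp only [Module.finrank_self, pow_one, abs_inv]

/-- Null sets of `(0,1)` and of `(−∞,0)` correspond under `v = e^x` (images of null sets under the smooth
maps `exp` and `log` are null). [folklore] -/
private theorem ae_Ioo_iff_ae_comp_exp (P : ℝ → Prop) :
    (∀ᵐ v : ℝ, v ∈ Set.Ioo (0 : ℝ) 1 → P v) ↔ ∀ᵐ x : ℝ, x < 0 → P (Real.exp x) := by
  rw [ae_iff, ae_iff]
  have hA : {v : ℝ | ¬(v ∈ Set.Ioo (0 : ℝ) 1 → P v)} =
      Real.exp '' {x : ℝ | ¬(x < 0 → P (Real.exp x))} := by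
    ext v
    simp only [Set.mem_setOf_eq, Classical.not_imp, Set.mem_image, Set.mem_Ioo]
    constructor
    · rintro ⟨⟨h0, h1⟩, hP⟩
      exact ⟨Real.log v, ⟨Real.log_neg h0 h1, by rwa [Real.exp_log h0]⟩, Real.exp_log h0⟩
    · rintro ⟨x, ⟨hx, hP⟩, rfl⟩
      exact ⟨⟨Real.exp_pos x, Real.exp_lt_one_iff.mpr hx⟩, hP⟩
  have hB : {x : ℝ | ¬(x < 0 → P (Real.exp x))} =
      Real.log '' {v : ℝ | ¬(v ∈ Set.Ioo (0 : ℝ) 1 → P v)} := by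
    ext x
    simp only [Set.mem_setOf_eq, Classical.not_imp, Set.mem_image, Set.mem_Ioo]
    constructor
    · rintro ⟨hx, hP⟩
      exact ⟨Real.exp x, ⟨⟨Real.exp_pos x, Real.exp_lt_one_iff.mpr hx⟩, hP⟩, Real.log_exp x⟩
    · rintro ⟨v, ⟨⟨h0, h1⟩, hP⟩, rfl⟩
      exact ⟨Real.log_neg h0 h1, by rwa [Real.exp_log h0]⟩
  constructor
  · intro h
    rw [hB]
    refine addHaar_image_eq_zero_of_differentiableOn_of_addHaar_eq_zero (μ := volume) ?_ h
    refine Real.differentiableOn_log.mono fun v hv => ?_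
    simp only [Set.mem_setOf_eq, Classical.not_imp, Set.mem_Ioo] at hv
    exact hv.1.1.ne'
  · intro h
    rw [hA]
    exact addHaar_image_eq_zero_of_differentiableOn_of_addHaar_eq_zero (μ := volume)
      Real.differentiable_exp.differentiableOn h

/-- A.e. statements on `(−∞,0)` and on `(0,∞)` correspond under `x = a·y`, `a < 0`. [folklore] -/
private theorem ae_neg_iff_ae_pos_mul {Q : ℝ → Prop} {a : ℝ} (ha : a < 0) :
    (∀ᵐ x : ℝ, x < 0 → Q x) ↔ ∀ᵐ y : ℝ, 0 < y → Q (a * y) := by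
  constructor
  · intro h
    have h' := (quasiMeasurePreserving_smul' (V := ℝ) ha.ne).ae h
    filter_upwards [h'] with y hy hpos
    rw [smul_eq_mul] at hy
    exact hy (mul_neg_of_neg_of_pos ha hpos)
  · intro h
    have h' := (quasiMeasurePreserving_smul' (V := ℝ) (inv_ne_zero ha.ne)).ae h
    filter_upwards [h'] with x hx hneg
    rw [smul_eq_mul] at hx
    have := hx (mul_pos_of_neg_of_neg (inv_lt_zero.mpr ha) hneg)
    rwa [mul_inv_cancel_left₀ ha.ne] at this

/-- For an EVEN `ξ`: `ξ = 0` a.e. on `[−1,1]` ⟺ `ξ = 0` a.e. on `(0,1)`. [folklore] -/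
private theorem vanishOn_one_iff_Ioo {ξ : Lp ℂ 2 (volume : Measure ℝ)} (hev : ξ ∈ evenPart) :
    ξ ∈ vanishOn 1 ↔ ∀ᵐ v : ℝ, v ∈ Set.Ioo (0 : ℝ) 1 → (ξ : ℝ → ℂ) v = 0 := by
  rw [mem_vanishOn_iff]
  constructor
  · intro h
    filter_upwards [h] with v hv hvI
    exact hv ⟨by linarith [hvI.1], hvI.2.le⟩
  · intro h
    have h' : ∀ᵐ x : ℝ, -x ∈ Set.Ioo (0 : ℝ) 1 → (ξ : ℝ → ℂ) (-x) = 0 :=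
      (Measure.measurePreserving_neg (volume : Measure ℝ)).quasiMeasurePreserving.ae h
    have h0 : ∀ᵐ x : ℝ, x ∉ ({-1, 0, 1} : Set ℝ) :=
      measure_eq_zero_iff_ae_notMem.mp ((Set.toFinite _).measure_zero volume)
    filter_upwards [h, h', mem_evenPart_iff.mp hev, h0] with x h1 h2 h3 h4 hxI
    simp only [Set.mem_insert_iff, Set.mem_singleton_iff, not_or] at h4
    obtain ⟨hxm1, hx0, hx1⟩ := h4
    rcases lt_or_gt_of_ne hx0 with hneg | hpos
    · rw [← h3]
      exact h2 ⟨by linarith, by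
        rcases hxI with ⟨ha, _⟩
        have : -1 < x := lt_of_le_of_ne ha (fun e => hxm1 e.symm)
        linarith⟩
    · exact h1 ⟨hpos, lt_of_le_of_ne hxI.2 hx1⟩

/-- **Proposition 5.5, first half — PROVED** (the `P ↦ 1 − 𝒫` identification of the printed proof,
p0016:L1): for an even `ξ ∈ L²(ℝ)` and its `𝔽_μ ∘ w`-image `η` (`IsMellinLineImage ξ η`, §5.2 eqs.
(5.1)–(5.2)), `ξ` vanishes a.e. on `[−1,1]` iff `η ∈ H²(ℂ_+) = (1 − 𝒫)L²(∂ℂ_−)` (`hardyRight`, §5.3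
p0016:L12).  RH-FREE. [cite: ConnesConsani2021QuasiInner, Prop 5.5, proof (arXiv chunk p0016:L1)] -/
theorem vanishOn_iff_mellinImage_mem_hardyRight {ξ η : Lp ℂ 2 (volume : Measure ℝ)}
    (hev : ξ ∈ evenPart) (hM : IsMellinLineImage ξ η) : ξ ∈ vanishOn 1 ↔ η ∈ hardyRight := by
  obtain ⟨G, hG, hη⟩ := hM
  have h2π : (2 * π : ℝ) ≠ 0 := by positivity
  have h2π' : ((2 * π)⁻¹ : ℝ) ≠ 0 := inv_ne_zero h2π
  -- `η = D_{(2π)⁻¹}(𝓕G)`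
  have hηD : η = lpDilation (V := ℝ) (F := ℂ) (p := (2 : ℝ≥0∞)) (2 * π)⁻¹ h2π'
      ENNReal.ofNat_ne_top (𝓕 G : Lp ℂ 2 (volume : Measure ℝ)) := by
    refine Lp.ext ?_
    filter_upwards [hη, lpDilation_coeFn (V := ℝ) (F := ℂ) (p := (2 : ℝ≥0∞)) h2π'
      ENNReal.ofNat_ne_top (𝓕 G : Lp ℂ 2 (volume : Measure ℝ))] with s e1 e2
    rw [e1, e2, smul_eq_mul, inv_mul_eq_div]
  -- `𝓕η = 2π·D_{2π}(G(−·))` (dilation law + `𝓕𝓕 = reflection`, the tree's `fourier_fourier_eq_compNeg`)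
  have hFη : (𝓕 η : Lp ℂ 2 (volume : Measure ℝ)) =
      (|(2 * π)⁻¹|⁻¹ : ℝ) • lpDilation (V := ℝ) (F := ℂ) (p := (2 : ℝ≥0∞)) (2 * π)⁻¹⁻¹
        (inv_ne_zero h2π') ENNReal.ofNat_ne_top
        (Lp.compMeasurePreserving (fun x : ℝ => -x)
          (Measure.measurePreserving_neg (volume : Measure ℝ)) G) := by
    rw [hηD, fourier_lpDilation_line, fourier_fourier_eq_compNeg]
  -- pointwise: `(𝓕η)(y) = 2π·G(−2πy)` a.e.
  have hpt : ∀ᵐ y : ℝ, ((𝓕 η : Lp ℂ 2 (volume : Measure ℝ)) : ℝ → ℂ) y =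
      ((|(2 * π)⁻¹|⁻¹ : ℝ) : ℂ) * (G : ℝ → ℂ) (-((2 * π) * y)) := by
    rw [hFη]
    filter_upwards [Lp.coeFn_smul (|(2 * π)⁻¹|⁻¹ : ℝ)
        (lpDilation (V := ℝ) (F := ℂ) (p := (2 : ℝ≥0∞)) (2 * π)⁻¹⁻¹ (inv_ne_zero h2π')
          ENNReal.ofNat_ne_top
          (Lp.compMeasurePreserving (fun x : ℝ => -x)
            (Measure.measurePreserving_neg (volume : Measure ℝ)) G)),
      lpDilation_coeFn (V := ℝ) (F := ℂ) (p := (2 : ℝ≥0∞)) (inv_ne_zero h2π') ENNReal.ofNat_ne_top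
        (Lp.compMeasurePreserving (fun x : ℝ => -x)
          (Measure.measurePreserving_neg (volume : Measure ℝ)) G),
      ae_eq_comp_smul (coeFn_compNeg (V := ℝ) (F := ℂ) G)
        (inv_ne_zero h2π')] with y e1 e2 e3
    rw [e1, Pi.smul_apply, e2, e3]
    simp only [smul_eq_mul, inv_inv, Complex.real_smul, Complex.ofReal_inv]
  have hc : ((|(2 * π)⁻¹|⁻¹ : ℝ) : ℂ) ≠ 0 := by
    exact_mod_cast inv_ne_zero (abs_ne_zero.mpr h2π')
  -- `η ∈ H²(ℂ_+)` ⟺ `G(−2πy) = 0` for a.e. `y > 0`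
  have step1 : η ∈ hardyRight ↔ ∀ᵐ y : ℝ, 0 < y → (G : ℝ → ℂ) ((-(2 * π)) * y) = 0 := by
    rw [mem_hardyRight_iff]
    constructor
    · intro h
      filter_upwards [h, hpt] with y hy hp hpos
      have h0 := hy hpos
      rw [hp] at h0
      rw [neg_mul]
      exact (mul_eq_zero.mp h0).resolve_left hc
    · intro h
      filter_upwards [h, hpt] with y hy hp hpos
      rw [hp, ← neg_mul, hy hpos, mul_zero]
  -- ⟺ `G = 0` a.e. on `(−∞,0)`
  have step2 : (∀ᵐ y : ℝ, 0 < y → (G : ℝ → ℂ) ((-(2 * π)) * y) = 0) ↔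
      ∀ᵐ x : ℝ, x < 0 → (G : ℝ → ℂ) x = 0 :=
    (ae_neg_iff_ae_pos_mul (Q := fun x => (G : ℝ → ℂ) x = 0)
      (by linarith [Real.pi_pos] : -(2 * π) < 0)).symm
  -- ⟺ `ξ(e^x) = 0` for a.e. `x < 0` (`G(x) = e^{x/2}ξ(e^x)`, `e^{x/2} ≠ 0`)
  have step3 : (∀ᵐ x : ℝ, x < 0 → (G : ℝ → ℂ) x = 0) ↔
      ∀ᵐ x : ℝ, x < 0 → (ξ : ℝ → ℂ) (Real.exp x) = 0 := by
    constructor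
    · intro h
      filter_upwards [h, hG] with x hx hGx hneg
      have h0 := hx hneg
      rw [hGx] at h0
      exact (mul_eq_zero.mp h0).resolve_left (by exact_mod_cast (Real.exp_pos _).ne')
    · intro h
      filter_upwards [h, hG] with x hx hGx hneg
      rw [hGx, hx hneg, mul_zero]
  -- ⟺ `ξ = 0` a.e. on `(0,1)` ⟺ (even) `ξ ∈ vanishOn 1`
  rw [step1, step2, step3, ← ae_Ioo_iff_ae_comp_exp (fun v => (ξ : ℝ → ℂ) v = 0),
    vanishOn_one_iff_Ioo hev]

end PropFiveFiveFirstHalf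

/-! ## Proposition 5.5, second half and the discharge `prop_5_5_holds`

Second ingredient of the printed proof (p0016:L1): «the kernel of `𝒫̂₁ = 𝔽_{e_ℝ}⁻¹𝒫₁𝔽_{e_ℝ}` … is the same
as the kernel of `ρ_∞^* P ρ_∞`», i.e. CC 2021 Selecta Lemma 6, `𝔽_{e_ℝ}^w = I ∘ u_∞^g`: on the Mellin line,
`𝔽_μ w 𝓕_{e_ℝ} = J u_∞ 𝔽_μ w` with `(Jη)(s) = η(−s)` (`𝔽_μ I = J 𝔽_μ`).  In this file's typing: the
`𝔽_μ ∘ w`-image `η′` of `𝓕ξ` is `η′(s) = u_∞(−s)η(−s)` for the image `η` of an even `ξ`.  PROVED below in `L²`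
(`mellinLine_fourier_eq`): (1) the transform `ξ ↦ η` is a bounded operator `mellinLineL2 = D_{1/2π}∘𝓕∘E`,
`(Eξ)(x) = e^{x/2}ξ(e^x)` (`‖Eξ‖ = ‖ξ|_{(0,∞)}‖`, change of variables `v = e^x`); (2) for a Schwartz `φ`,
`η(s) = 𝓜φ(½ − is)` (Mellin transform; Mathlib's `mellin_eq_fourier` and the tree's Plancherel
representation `fourier_toLp_ae_eq_fourierIntegral`); (3) for an EVEN Schwartz `φ`, Tate's local functional
equation at the real place on the critical line (tree theorem
`TateArchimedean.mellin_fourier_mul_Gammaℝ_of_even`: `𝓜(𝓕φ)(z)Γ_ℝ(1−z) = Γ_ℝ(z)𝓜φ(1−z)`, `z = ½ − is`)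
gives `η′(s) = u_∞(−s)η(−s)` with `u_∞ = Γ_ℝ(½+is)/Γ_ℝ(½−is)` (`archUnitary_eq_Gammaℝ_div`) — this is
exactly the content of CC 2021 Lemma 6 / App. B (the tree's `CC2021_lemma_6_holds` is the same identity on
`C_c^∞(ℝ₊*)`); (4) density of even Schwartz functions in `L²(ℝ)_ev` (symmetrisation) and continuity.
Consequently (`fourier_vanishOn_iff_smul_mem_hardyLeft`): `𝓕ξ = 0` on `[−1,1]` ⟺ `η′ ∈ H²(ℂ_+)` (first
half) ⟺ `J(u_∞η) ∈ H²(ℂ_+)` ⟺ `u_∞η ∈ H²(ℂ_−)` (`𝓕J = J𝓕`), and `prop_5_5_holds` follows. -/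

section PropFiveFiveSecondHalf

open Literature.Analysis.OperatorTheory (lpDilation lpDilation_coeFn quasiMeasurePreserving_smul'
  ae_eq_comp_smul)
open Literature.Analysis.Fourier (coeFn_compNeg fourier_fourier_eq_compNeg fourier_compNeg
  fourierIntegral_comp_neg)
open Literature.NumberTheory.Automorphic.TateArchimedean (mellin_fourier_mul_Gammaℝ_of_even)

/-! ### The change of variables `v = e^x`: `(Eξ)(x) = e^{x/2}ξ(e^x)` as a bounded operator on `L²(ℝ)` -/

/-- `exp` is quasi-measure-preserving for Lebesgue measure (preimages of null sets are images of null
subsets of `(0,∞)` under the smooth map `log`). [folklore] -/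
private theorem quasiMeasurePreserving_exp :
    Measure.QuasiMeasurePreserving Real.exp (volume : Measure ℝ) volume := by
  refine ⟨Real.measurable_exp, Measure.AbsolutelyContinuous.mk fun s hs h0 => ?_⟩
  rw [Measure.map_apply Real.measurable_exp hs]
  have hpre : Real.exp ⁻¹' s = Real.log '' (s ∩ Set.Ioi 0) := by
    ext x
    simp only [Set.mem_preimage, Set.mem_image, Set.mem_inter_iff, Set.mem_Ioi]
    constructor
    · intro hx
      exact ⟨Real.exp x, ⟨hx, Real.exp_pos x⟩, Real.log_exp x⟩
    · rintro ⟨v, ⟨hv, hv0⟩, rfl⟩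
      rwa [Real.exp_log hv0]
  rw [hpre]
  exact addHaar_image_eq_zero_of_differentiableOn_of_addHaar_eq_zero (μ := volume)
    (Real.differentiableOn_log.mono fun v hv => (Set.mem_Ioi.mp hv.2).ne')
    (measure_mono_null Set.inter_subset_left h0)

/-- `G_f(x) = e^{x/2} f(e^x)` (§5.2: `(𝔽_μ w ξ)(s) = ∫₀^∞ ξ(v)v^{1/2−is}d*v = ∫ G_ξ(x)e^{−isx}dx`). [folklore] -/
private def expPull (f : ℝ → ℂ) (x : ℝ) : ℂ := (Real.exp (x / 2) : ℂ) * f (Real.exp x)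

/-- `expPull` respects a.e. equality. [folklore] -/
private theorem expPull_congr_ae {f g : ℝ → ℂ} (h : f =ᵐ[volume] g) :
    expPull f =ᵐ[volume] expPull g := by
  filter_upwards [quasiMeasurePreserving_exp.ae_eq h] with x hx
  simp only [Function.comp_apply] at hx
  simp only [expPull, hx]

/-- `∫ ‖G_f‖² = ∫₀^∞ ‖f‖²` (substitution `v = e^x`). [folklore] -/
private theorem lintegral_enorm_sq_expPull (f : ℝ → ℂ) :
    ∫⁻ x, ‖expPull f x‖ₑ ^ 2 = ∫⁻ v in Set.Ioi 0, ‖f v‖ₑ ^ 2 := by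
  have h := lintegral_image_eq_lintegral_abs_deriv_mul (f := Real.exp) (f' := Real.exp)
    MeasurableSet.univ (fun x _ => (Real.hasDerivAt_exp x).hasDerivWithinAt)
    Real.exp_injective.injOn (fun v => ‖f v‖ₑ ^ 2)
  rw [Set.image_univ, Real.range_exp, Measure.restrict_univ] at h
  rw [h]
  refine lintegral_congr fun x => ?_
  rw [expPull, enorm_mul, mul_pow, abs_of_pos (Real.exp_pos x),
    ← ofReal_norm ((Real.exp (x / 2) : ℝ) : ℂ), Complex.norm_real,
    Real.norm_of_nonneg (Real.exp_pos _).le, ← ENNReal.ofReal_pow (Real.exp_pos _).le, sq,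
    ← Real.exp_add, add_halves]

/-- `‖G_f‖_{L²(ℝ)} = ‖f‖_{L²(0,∞)}`. [folklore] -/
private theorem eLpNorm_expPull (f : ℝ → ℂ) :
    eLpNorm (expPull f) 2 volume = eLpNorm f 2 (volume.restrict (Set.Ioi 0)) := by
  rw [eLpNorm_eq_lintegral_rpow_enorm_toReal two_ne_zero ENNReal.ofNat_ne_top,
    eLpNorm_eq_lintegral_rpow_enorm_toReal two_ne_zero ENNReal.ofNat_ne_top]
  simp only [ENNReal.toReal_ofNat, ENNReal.rpow_ofNat]
  rw [lintegral_enorm_sq_expPull]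

/-- `G_ξ` is a.e.-strongly measurable for `ξ ∈ L²`. [folklore] -/
private theorem aestronglyMeasurable_expPull (ξ : Lp ℂ 2 (volume : Measure ℝ)) :
    AEStronglyMeasurable (expPull ξ) volume :=
  (Complex.continuous_ofReal.comp (Real.continuous_exp.comp
    (continuous_id.div_const 2))).aestronglyMeasurable.mul
    ((Lp.aestronglyMeasurable ξ).comp_quasiMeasurePreserving quasiMeasurePreserving_exp)

/-- `G_ξ ∈ L²(ℝ)` for `ξ ∈ L²(ℝ)`. [folklore] -/
private theorem memLp_expPull (ξ : Lp ℂ 2 (volume : Measure ℝ)) : MemLp (expPull ξ) 2 volume := by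
  refine ⟨aestronglyMeasurable_expPull ξ, ?_⟩
  rw [eLpNorm_expPull]
  exact (eLpNorm_mono_measure _ Measure.restrict_le_self).trans_lt (Lp.memLp ξ).eLpNorm_lt_top

/-- `‖G_ξ‖ ≤ ‖ξ‖`. [folklore] -/
private theorem eLpNorm_expPull_le (ξ : Lp ℂ 2 (volume : Measure ℝ)) :
    eLpNorm (expPull ξ) 2 volume ≤ eLpNorm ξ 2 volume := by
  rw [eLpNorm_expPull]
  exact eLpNorm_mono_measure _ Measure.restrict_le_self

/-- **`E : ξ ↦ G_ξ = e^{x/2}ξ(e^x)`** as a bounded operator `L²(ℝ) → L²(ℝ)` (the unitary `w` of eq. (5.1)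
followed by the substitution `v = e^x`; a contraction, isometric on functions supported in `(0,∞)`). [folklore] -/
private def expPullL2 : Lp ℂ 2 (volume : Measure ℝ) →L[ℂ] Lp ℂ 2 (volume : Measure ℝ) :=
  LinearMap.mkContinuous
    { toFun := fun ξ => (memLp_expPull ξ).toLp _
      map_add' := fun ξ ζ => by
        rw [← MemLp.toLp_add]
        refine MemLp.toLp_congr _ _ ?_
        filter_upwards [expPull_congr_ae (Lp.coeFn_add ξ ζ)] with x hx
        rw [hx]
        simp only [expPull, Pi.add_apply, mul_add]
      map_smul' := fun c ξ => by
        simp only [RingHom.id_apply]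
        rw [← MemLp.toLp_const_smul]
        refine MemLp.toLp_congr _ _ ?_
        filter_upwards [expPull_congr_ae (Lp.coeFn_smul c ξ)] with x hx
        rw [hx, Pi.smul_apply, expPull, expPull, Pi.smul_apply, smul_eq_mul, smul_eq_mul]
        ring }
    1 (fun ξ => by
      rw [one_mul]
      change ‖(memLp_expPull ξ).toLp _‖ ≤ ‖ξ‖
      rw [Lp.norm_toLp, Lp.norm_def]
      exact ENNReal.toReal_mono (Lp.memLp ξ).eLpNorm_ne_top (eLpNorm_expPull_le ξ))

/-- `Eξ = e^{x/2}ξ(e^x)` a.e. [folklore] -/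
private theorem coeFn_expPullL2 (ξ : Lp ℂ 2 (volume : Measure ℝ)) :
    (expPullL2 ξ : ℝ → ℂ) =ᵐ[volume] fun x => (Real.exp (x / 2) : ℂ) * (ξ : ℝ → ℂ) (Real.exp x) :=
  MemLp.coeFn_toLp (memLp_expPull ξ)

/-! ### The transform `𝔽_μ ∘ w` as a bounded operator on `L²(ℝ)` -/

/-- `(2π)⁻¹ ≠ 0`. [folklore] -/
private theorem two_pi_inv_ne_zero : ((2 * π)⁻¹ : ℝ) ≠ 0 := inv_ne_zero (by positivity)

/-- **`M = D_{1/2π} ∘ 𝓕 ∘ E`**: `(Mξ)(s) = (𝓕G_ξ)(s/2π) = 𝔽_μ(wξ)(s)` — the unitary `𝔽_μ ∘ w` of §5.2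
(eqs. (5.1)–(5.2)) as a bounded operator on `L²(ℝ)` (it only sees `ξ|_{(0,∞)}`). [folklore] -/
private def mellinLineL2 : Lp ℂ 2 (volume : Measure ℝ) →L[ℂ] Lp ℂ 2 (volume : Measure ℝ) :=
  (lpDilation (V := ℝ) (F := ℂ) (p := (2 : ℝ≥0∞)) (2 * π)⁻¹ two_pi_inv_ne_zero ENNReal.ofNat_ne_top) ∘L
    ((((Lp.fourierTransformₗᵢ ℝ ℂ).toContinuousLinearEquiv :
        Lp ℂ 2 (volume : Measure ℝ) ≃L[ℂ] Lp ℂ 2 (volume : Measure ℝ)) :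
        Lp ℂ 2 (volume : Measure ℝ) →L[ℂ] Lp ℂ 2 (volume : Measure ℝ)) ∘L expPullL2)

/-- Unfolding `M`. [folklore] -/
private theorem mellinLineL2_apply (ξ : Lp ℂ 2 (volume : Measure ℝ)) :
    mellinLineL2 ξ = lpDilation (V := ℝ) (F := ℂ) (p := (2 : ℝ≥0∞)) (2 * π)⁻¹ two_pi_inv_ne_zero
      ENNReal.ofNat_ne_top (𝓕 (expPullL2 ξ) : Lp ℂ 2 (volume : Measure ℝ)) := rfl

/-- `Mξ` IS a `𝔽_μ ∘ w`-image of `ξ` in the sense of `IsMellinLineImage`. [folklore] -/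
private theorem isMellinLineImage_mellinLineL2 (ξ : Lp ℂ 2 (volume : Measure ℝ)) :
    IsMellinLineImage ξ (mellinLineL2 ξ) := by
  refine ⟨expPullL2 ξ, coeFn_expPullL2 ξ, ?_⟩
  rw [mellinLineL2_apply]
  filter_upwards [lpDilation_coeFn (V := ℝ) (F := ℂ) (p := (2 : ℝ≥0∞)) two_pi_inv_ne_zero
    ENNReal.ofNat_ne_top (𝓕 (expPullL2 ξ) : Lp ℂ 2 (volume : Measure ℝ))] with s hs
  rw [hs, smul_eq_mul, inv_mul_eq_div]

/-- Uniqueness: any `𝔽_μ ∘ w`-image of `ξ` is `Mξ`. [folklore] -/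
private theorem eq_mellinLineL2_of_isMellinLineImage {ξ η : Lp ℂ 2 (volume : Measure ℝ)}
    (h : IsMellinLineImage ξ η) : η = mellinLineL2 ξ := by
  obtain ⟨G, hG, hη⟩ := h
  have hGE : G = expPullL2 ξ := Lp.ext (hG.trans (coeFn_expPullL2 ξ).symm)
  rw [hGE] at hη
  refine Lp.ext ?_
  rw [mellinLineL2_apply]
  filter_upwards [hη, lpDilation_coeFn (V := ℝ) (F := ℂ) (p := (2 : ℝ≥0∞)) two_pi_inv_ne_zero
    ENNReal.ofNat_ne_top (𝓕 (expPullL2 ξ) : Lp ℂ 2 (volume : Measure ℝ))] with s h1 h2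
  rw [h1, h2, smul_eq_mul, inv_mul_eq_div]

/-! ### Reflection `J`, evenness, and the Hardy spaces -/

/-- `ξ` is even iff `Jξ = ξ` (`J` the reflection of `L²(ℝ)`). [folklore] -/
private theorem mem_evenPart_iff_compNeg_eq (ξ : Lp ℂ 2 (volume : Measure ℝ)) :
    ξ ∈ evenPart ↔
      Lp.compMeasurePreserving (fun x : ℝ => -x) (Measure.measurePreserving_neg (volume : Measure ℝ))
        ξ = ξ := by
  rw [mem_evenPart_iff]
  constructor
  · intro h
    exact Lp.ext ((coeFn_compNeg (V := ℝ) (F := ℂ) ξ).trans h)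
  · intro h
    have h2 := coeFn_compNeg (V := ℝ) (F := ℂ) ξ
    rw [h] at h2
    filter_upwards [h2] with x hx
    exact hx.symm

/-- The Fourier transform of an even `ξ ∈ L²` is even (`𝓕J = J𝓕`). [folklore] -/
private theorem fourier_mem_evenPart {ξ : Lp ℂ 2 (volume : Measure ℝ)} (h : ξ ∈ evenPart) :
    (𝓕 ξ : Lp ℂ 2 (volume : Measure ℝ)) ∈ evenPart := by
  rw [mem_evenPart_iff_compNeg_eq] at h ⊢
  rw [← fourier_compNeg, h]

/-- `Jw ∈ H²(ℂ_+) ⟺ w ∈ H²(ℂ_−)` (`𝓕J = J𝓕` exchanges the spectral half-lines). [folklore] -/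
private theorem compNeg_mem_hardyRight_iff (w : Lp ℂ 2 (volume : Measure ℝ)) :
    Lp.compMeasurePreserving (fun x : ℝ => -x) (Measure.measurePreserving_neg (volume : Measure ℝ)) w ∈
        hardyRight ↔ w ∈ hardyLeft := by
  rw [mem_hardyRight_iff, mem_hardyLeft_iff, fourier_compNeg]
  have hc := coeFn_compNeg (V := ℝ) (F := ℂ) (𝓕 w : Lp ℂ 2 (volume : Measure ℝ))
  have hneg := (Measure.measurePreserving_neg (volume : Measure ℝ)).quasiMeasurePreserving
  constructor
  · intro h
    have h' := hneg.ae (h.and hc)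
    filter_upwards [h'] with x hx hxneg
    obtain ⟨h1, h2⟩ := hx
    have := h1 (by rw [Set.mem_Ioi]; rw [Set.mem_Iio] at hxneg; linarith)
    rwa [h2, neg_neg] at this
  · intro h
    have h' := hneg.ae h
    filter_upwards [h', hc] with x hx hxc hxpos
    rw [hxc]
    exact hx (by rw [Set.mem_Iio]; rw [Set.mem_Ioi] at hxpos; linarith)

/-- Multiplication by `u ∈ L^∞` is continuous on `L²` (Mathlib's bounded bilinear Hölder map). [folklore] -/
private theorem continuous_linfty_smul (u : Lp ℂ ∞ (volume : Measure ℝ)) :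
    Continuous fun f : Lp ℂ 2 (volume : Measure ℝ) => (u • f : Lp ℂ 2 (volume : Measure ℝ)) := by
  have : (fun f : Lp ℂ 2 (volume : Measure ℝ) => (u • f : Lp ℂ 2 (volume : Measure ℝ))) =
      fun f => (ContinuousLinearMap.lsmul ℂ ℂ).holderL (volume : Measure ℝ) ∞ 2 2 u f := by
    funext f
    rw [ContinuousLinearMap.holderL_apply_apply]
    refine Lp.ext ?_
    filter_upwards [Lp.coeFn_lpSMul (r := 2) u f,
      (ContinuousLinearMap.lsmul ℂ ℂ).coeFn_holder (r := 2) u f] with x h1 h2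
    rw [h1, h2, Pi.smul_apply', ContinuousLinearMap.lsmul_apply]
  rw [this]
  exact ContinuousLinearMap.continuous _

/-! ### `M` on Schwartz functions: the Mellin transform on the critical line -/

/-- A.e. `x ≠ 0`. [folklore] -/
private theorem ae_ne_zero : ∀ᵐ x : ℝ, x ≠ 0 := by
  have : (volume : Measure ℝ) {0} = 0 := measure_singleton 0
  exact measure_eq_zero_iff_ae_notMem.mp this

/-- `‖|x|^r‖ = |x|^{re r}` for `x ≠ 0`. [folklore] -/
private theorem norm_abs_cpow {x : ℝ} (hx : x ≠ 0) (r : ℂ) :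
    ‖((|x| : ℝ) : ℂ) ^ r‖ = |x| ^ r.re :=
  Complex.norm_cpow_eq_rpow_re_of_pos (abs_pos.mpr hx) r

/-- `∫ |y|^w h(y) dy` converges absolutely for `h` bounded and integrable and `−1 < re w ≤ 0` (near `0`
compare with `|y|^{re w}`, away from `0` with `|h|`); the argument of the tree's
`SchwartzKernelsProofs` (private there). [folklore] -/
private theorem integrable_abs_cpow_mul_of_norm_le {h : ℝ → ℂ} {M : ℝ} (hi : Integrable h)
    (hb : ∀ y, ‖h y‖ ≤ M) {w : ℂ} (hw0 : -1 < w.re) (hw1 : w.re ≤ 0) :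
    Integrable fun y : ℝ => ((|y| : ℝ) : ℂ) ^ w * h y := by
  have hmeas : AEStronglyMeasurable (fun y : ℝ => ((|y| : ℝ) : ℂ) ^ w * h y) :=
    ((Complex.measurable_ofReal.comp continuous_abs.measurable).pow_const w).aestronglyMeasurable.mul
      hi.aestronglyMeasurable
  rw [← integrableOn_univ, ← Set.union_compl_self (Set.Ioo (-1 : ℝ) 1), integrableOn_union]
  constructor
  · have hr : IntegrableOn (fun y : ℝ => |y| ^ w.re) (Set.Ioo 0 1) := by
      refine ((intervalIntegral.integrableOn_Ioo_rpow_iff zero_lt_one).2 hw0).congr_fun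
        (fun y hy => ?_) measurableSet_Ioo
      rw [abs_of_pos hy.1]
    have hl : IntegrableOn (fun y : ℝ => |y| ^ w.re) (Set.Ioo (-1) 0) := by
      have e1 : (Neg.neg ⁻¹' Set.Ioo (0 : ℝ) 1) = Set.Ioo (-1) 0 := by
        ext y; simp only [Set.mem_preimage, Set.mem_Ioo]
        constructor <;> intro h <;> constructor <;> linarith
      have e2 : ((fun y : ℝ => |y| ^ w.re) ∘ Neg.neg) = fun y : ℝ => |y| ^ w.re := by
        funext y; simp [abs_neg]
      have := ((Measure.measurePreserving_neg (volume : Measure ℝ)).integrableOn_comp_preimage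
        (Homeomorph.neg ℝ).measurableEmbedding).2 hr
      rwa [e1, e2] at this
    have hm : IntegrableOn (fun y : ℝ => |y| ^ w.re) (Set.Ioo (-1) 1) := by
      have hl' : IntegrableOn (fun y : ℝ => |y| ^ w.re) (Set.Ioc (-1) 0) := by
        rw [integrableOn_Ioc_iff_integrableOn_Ioo]; exact hl
      have e : Set.Ioo (-1 : ℝ) 1 = Set.Ioc (-1) 0 ∪ Set.Ioo 0 1 := by
        ext y; simp only [Set.mem_union, Set.mem_Ioo, Set.mem_Ioc]
        constructor
        · intro h
          rcases le_or_gt y 0 with hy | hy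
          · exact Or.inl ⟨h.1, hy⟩
          · exact Or.inr ⟨hy, h.2⟩
        · rintro (h | h) <;> constructor <;> linarith
      rw [e]
      exact hl'.union hr
    have hM : 0 ≤ M := (norm_nonneg _).trans (hb 0)
    refine Integrable.mono' (hm.const_mul M) hmeas.restrict ?_
    filter_upwards [ae_restrict_mem measurableSet_Ioo, ae_restrict_of_ae ae_ne_zero] with y hy hy0
    rw [norm_mul, norm_abs_cpow hy0, mul_comm]
    exact mul_le_mul_of_nonneg_right (hb y) (Real.rpow_nonneg (abs_nonneg y) _)
  · refine Integrable.mono' hi.norm.integrableOn hmeas.restrict ?_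
    filter_upwards [ae_restrict_mem (measurableSet_Ioo.compl)] with y hy
    have hy1 : 1 ≤ |y| := by
      simp only [Set.mem_compl_iff, Set.mem_Ioo, not_and_or, not_lt] at hy
      rcases hy with h | h
      · calc (1 : ℝ) ≤ -y := by linarith
          _ ≤ |y| := neg_le_abs y
      · exact h.trans (le_abs_self y)
    have hy0 : y ≠ 0 := fun h => by rw [h, abs_zero] at hy1; exact absurd hy1 (by norm_num)
    rw [norm_mul, norm_abs_cpow hy0]
    calc |y| ^ w.re * ‖h y‖ ≤ 1 * ‖h y‖ :=
          mul_le_mul_of_nonneg_right (Real.rpow_le_one_of_one_le_of_nonpos hy1 hw1) (norm_nonneg _)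
      _ = ‖h y‖ := one_mul _

/-- For a Schwartz `φ`: `∫ |x|^w φ(x) dx` converges absolutely when `−1 < re w ≤ 0`. [folklore] -/
private theorem integrable_abs_cpow_mul_schwartz (φ : SchwartzMap ℝ ℂ) {w : ℂ} (hw0 : -1 < w.re)
    (hw1 : w.re ≤ 0) : Integrable fun y : ℝ => ((|y| : ℝ) : ℂ) ^ w * φ y := by
  obtain ⟨M, hM⟩ : ∃ M, ∀ y, ‖φ y‖ ≤ M := by
    obtain ⟨M, _, hM⟩ := φ.decay 0 0
    exact ⟨M, fun y => by simpa using hM y⟩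
  exact integrable_abs_cpow_mul_of_norm_le φ.integrable hM hw0 hw1

/-- `G_φ ∈ L¹(ℝ)` for a Schwartz `φ` (`∫ e^{x/2}|φ(e^x)|dx = ∫₀^∞ v^{−1/2}|φ(v)|dv`). [folklore] -/
private theorem integrable_expPull_schwartz (φ : SchwartzMap ℝ ℂ) : Integrable (expPull φ) := by
  -- `g(v) = v^{-1/2} φ(v)` is integrable on `(0,∞)`
  have hg : IntegrableOn (fun v : ℝ => ((|v| : ℝ) : ℂ) ^ (-(1 / 2 : ℂ)) * φ v) (Set.Ioi 0) :=
    (integrable_abs_cpow_mul_schwartz φ (w := -(1 / 2 : ℂ)) (by norm_num) (by norm_num)).integrableOn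
  have h := (integrableOn_image_iff_integrableOn_abs_deriv_smul (f := Real.exp) (f' := Real.exp)
    MeasurableSet.univ (fun x _ => (Real.hasDerivAt_exp x).hasDerivWithinAt)
    Real.exp_injective.injOn (fun v : ℝ => ((|v| : ℝ) : ℂ) ^ (-(1 / 2 : ℂ)) * φ v)).1
    (by rwa [Set.image_univ, Real.range_exp])
  rw [integrableOn_univ] at h
  refine h.congr (Eventually.of_forall fun x => ?_)
  have hpos : 0 < Real.exp x := Real.exp_pos x
  simp only [expPull, abs_of_pos hpos, Complex.real_smul]
  rw [show ((Real.exp x : ℝ) : ℂ) ^ (-(1 / 2 : ℂ)) = ((Real.exp (-(x / 2)) : ℝ) : ℂ) by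
    rw [show (-(1 / 2 : ℂ)) = ((-(1 / 2 : ℝ) : ℝ) : ℂ) by push_cast; ring,
      ← Complex.ofReal_cpow hpos.le, ← Real.exp_mul]
    congr 2; ring]
  rw [← mul_assoc, ← Complex.ofReal_mul, ← Real.exp_add]
  congr 2; ring

/-- **`(Mφ)(s) = 𝓜φ(½ − is)`** for a Schwartz `φ`: the `L²` transform `M` restricted to `𝓢` is the Mellin
transform on the critical line (`𝓜φ(s) = ∫₀^∞ φ(v)v^{s−1}dv`; Mathlib's `mellin_eq_fourier` and the
Plancherel representation of `𝓕` on `L¹ ∩ L²`). [folklore] -/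
private theorem mellinLineL2_toLp_schwartz (φ : SchwartzMap ℝ ℂ) :
    (mellinLineL2 (φ.toLp 2 (volume : Measure ℝ)) : ℝ → ℂ) =ᵐ[volume]
      fun s => mellin (fun v => φ v) (1 / 2 - s * I) := by
  have h1 : Integrable (expPull φ) := integrable_expPull_schwartz φ
  have h2 : MemLp (expPull φ) 2 volume :=
    (memLp_expPull (φ.toLp 2 volume)).ae_eq (expPull_congr_ae (φ.coeFn_toLp 2 volume))
  have hE : expPullL2 (φ.toLp 2 volume) = h2.toLp _ :=
    Lp.ext ((coeFn_expPullL2 _).trans ((expPull_congr_ae (φ.coeFn_toLp 2 volume)).trans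
      (MemLp.coeFn_toLp h2).symm))
  have hF := Literature.Analysis.FunctionSpaces.fourier_toLp_ae_eq_fourierIntegral h1 h2
  rw [mellinLineL2_apply, hE]
  filter_upwards [lpDilation_coeFn (V := ℝ) (F := ℂ) (p := (2 : ℝ≥0∞)) two_pi_inv_ne_zero
      ENNReal.ofNat_ne_top (𝓕 (h2.toLp _) : Lp ℂ 2 (volume : Measure ℝ)),
    ae_eq_comp_smul hF two_pi_inv_ne_zero] with s e1 e2
  rw [e1, e2, mellin_eq_fourier]
  have hre : ((1 / 2 : ℂ) - (s : ℂ) * I).re = 1 / 2 := by simp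
  have him : ((1 / 2 : ℂ) - (s : ℂ) * I).im = -s := by simp
  rw [hre, him]
  -- `𝓕 G_φ ((2π)⁻¹ s) = 𝓕 (u ↦ e^{-u/2} φ(e^{-u})) (-s/(2π))`
  have hfun : (fun u : ℝ => (Real.exp (-(1 / 2 : ℝ) * u) : ℝ) • φ (Real.exp (-u))) =
      fun u : ℝ => expPull φ (-u) := by
    funext u
    rw [expPull, Complex.real_smul, show -(1 / 2 : ℝ) * u = -u / 2 by ring]
  rw [hfun, fourierIntegral_comp_neg]
  rw [smul_eq_mul]
  field_simp

/-! ### Tate's local functional equation on the critical line, for even Schwartz functions -/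

/-- For an even Schwartz `φ` and real `s`:  `𝓜(𝓕φ)(½ − is) = u_∞(−s)·𝓜φ(½ + is)` — Tate's local functional
equation at the real place (tree theorem `mellin_fourier_mul_Gammaℝ_of_even`) with `z = ½ − is`, and
`u_∞(−s) = Γ_ℝ(½ − is)/Γ_ℝ(½ + is)`; the Mellin-line form of CC 2021 Selecta Lemma 6.
[cite: ConnesConsani2021QuasiInner, Prop 5.5, proof (arXiv chunk p0016:L1)] -/
theorem mellin_fourier_critPt_of_even (φ : SchwartzMap ℝ ℂ) (hφ : ∀ x, φ (-x) = φ x) (s : ℝ) :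
    mellin (𝓕 (fun v => φ v)) (1 / 2 - s * I) =
      archUnitary (-s) * mellin (fun v => φ v) (1 / 2 + s * I) := by
  have hz0 : 0 < (1 / 2 - s * I : ℂ).re := by simp
  have hz1 : (1 / 2 - s * I : ℂ).re < 1 := by simp; norm_num
  have hT := mellin_fourier_mul_Gammaℝ_of_even hz0 hz1 hφ φ.integrable
    (integrable_abs_cpow_mul_schwartz φ (by simp; norm_num) (by simp))
    (by
      have := integrable_abs_cpow_mul_schwartz (𝓕 φ) (w := (1 / 2 - s * I : ℂ) - 1)
        (by simp) (by simp; norm_num)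
      simpa only [SchwartzMap.fourier_coe] using this)
  have e1 : (1 : ℂ) - (1 / 2 - s * I) = 1 / 2 + s * I := by ring
  rw [e1] at hT
  have hne : Gammaℝ (1 / 2 + s * I) ≠ 0 := Gammaℝ_ne_zero_of_re_pos (by simp)
  have hu : archUnitary (-s) = Gammaℝ (1 / 2 - s * I) / Gammaℝ (1 / 2 + s * I) := by
    rw [archUnitary_eq_Gammaℝ_div, critPt]
    push_cast
    congr 2 <;> ring
  rw [hu, div_mul_eq_mul_div, eq_div_iff hne, ← hT]

/-! ### Symmetrisation and the `L²` identity `M𝓕 = J u_∞ M` on even functions -/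

/-- The even Schwartz function `½(φ + φ(−·))`. [folklore] -/
private def schwartzEven (φ : SchwartzMap ℝ ℂ) : SchwartzMap ℝ ℂ :=
  (1 / 2 : ℂ) • (φ + SchwartzMap.compCLMOfContinuousLinearEquiv ℂ (ContinuousLinearEquiv.neg ℝ) φ)

/-- `schwartzEven φ (x) = ½(φ x + φ(−x))`. [folklore] -/
private theorem schwartzEven_apply (φ : SchwartzMap ℝ ℂ) (x : ℝ) :
    schwartzEven φ x = (1 / 2 : ℂ) * (φ x + φ (-x)) := rfl

/-- `schwartzEven φ` is even. [folklore] -/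
private theorem schwartzEven_neg (φ : SchwartzMap ℝ ℂ) (x : ℝ) :
    schwartzEven φ (-x) = schwartzEven φ x := by
  rw [schwartzEven_apply, schwartzEven_apply, neg_neg, add_comm]

/-- The symmetrisation `Su = ½(u + Ju)` of `L²(ℝ)`. [folklore] -/
private def symL2 (u : Lp ℂ 2 (volume : Measure ℝ)) : Lp ℂ 2 (volume : Measure ℝ) :=
  (1 / 2 : ℂ) • (u + Lp.compMeasurePreserving (fun x : ℝ => -x)
    (Measure.measurePreserving_neg (volume : Measure ℝ)) u)

/-- `S` is continuous. [folklore] -/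
private theorem continuous_symL2 : Continuous symL2 := by
  have hR : Continuous fun u : Lp ℂ 2 (volume : Measure ℝ) =>
      Lp.compMeasurePreserving (fun x : ℝ => -x) (Measure.measurePreserving_neg (volume : Measure ℝ)) u :=
    (Lp.compMeasurePreservingₗᵢ ℂ (fun x : ℝ => -x) (Measure.measurePreserving_neg (volume : Measure ℝ)) :
      Lp ℂ 2 (volume : Measure ℝ) →ₗᵢ[ℂ] Lp ℂ 2 (volume : Measure ℝ)).continuous
  exact (continuous_id.add hR).const_smul (1 / 2 : ℂ)

/-- `Sξ = ξ` for even `ξ`. [folklore] -/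
private theorem symL2_of_mem_evenPart {ξ : Lp ℂ 2 (volume : Measure ℝ)} (h : ξ ∈ evenPart) :
    symL2 ξ = ξ := by
  rw [symL2, (mem_evenPart_iff_compNeg_eq ξ).mp h, ← two_smul ℂ ξ, smul_smul]
  norm_num

/-- `S[φ] = [schwartzEven φ]`. [folklore] -/
private theorem symL2_toLp (φ : SchwartzMap ℝ ℂ) :
    symL2 (φ.toLp 2 (volume : Measure ℝ)) = (schwartzEven φ).toLp 2 volume := by
  refine Lp.ext ?_
  have hR : (fun x : ℝ => ((φ.toLp 2 volume : Lp ℂ 2 (volume : Measure ℝ)) : ℝ → ℂ) (-x))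
      =ᵐ[volume] fun x : ℝ => φ (-x) :=
    (Measure.measurePreserving_neg (volume : Measure ℝ)).quasiMeasurePreserving.ae_eq_comp
      (φ.coeFn_toLp 2 volume)
  rw [symL2]
  filter_upwards [Lp.coeFn_smul (1 / 2 : ℂ) (φ.toLp 2 volume + Lp.compMeasurePreserving (fun x : ℝ => -x)
      (Measure.measurePreserving_neg (volume : Measure ℝ)) (φ.toLp 2 volume)),
    Lp.coeFn_add (φ.toLp 2 volume) (Lp.compMeasurePreserving (fun x : ℝ => -x)
      (Measure.measurePreserving_neg (volume : Measure ℝ)) (φ.toLp 2 volume)),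
    coeFn_compNeg (V := ℝ) (F := ℂ) (φ.toLp 2 (volume : Measure ℝ)), hR, φ.coeFn_toLp 2 volume,
    (schwartzEven φ).coeFn_toLp 2 volume] with x e1 e2 e3 e4 e5 e6
  rw [e1, Pi.smul_apply, e2, Pi.add_apply, e3, e4, e5, e6, schwartzEven_apply, smul_eq_mul]

/-- **`M(𝓕ξ) = J(u_∞·Mξ)` for even `ξ ∈ L²(ℝ)`** — CC 2021 Selecta Lemma 6 (`𝔽_{e_ℝ}^w = I∘u_∞^g`) on the
Mellin line, in `L²`: from Tate's functional equation on even Schwartz functions by density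
(symmetrisation) and continuity of both sides. [cite: ConnesConsani2021QuasiInner, Prop 5.5, proof (arXiv chunk p0016:L1)] -/
private theorem mellinLineL2_fourier_eq_of_mem_evenPart {ξ : Lp ℂ 2 (volume : Measure ℝ)}
    (hev : ξ ∈ evenPart) :
    mellinLineL2 (𝓕 ξ : Lp ℂ 2 (volume : Measure ℝ)) =
      Lp.compMeasurePreserving (fun x : ℝ => -x) (Measure.measurePreserving_neg (volume : Measure ℝ))
        (archBoundary • mellinLineL2 ξ : Lp ℂ 2 (volume : Measure ℝ)) := by
  -- continuity of both sides (composed with the symmetrisation)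
  have hR : Continuous fun u : Lp ℂ 2 (volume : Measure ℝ) =>
      Lp.compMeasurePreserving (fun x : ℝ => -x) (Measure.measurePreserving_neg (volume : Measure ℝ)) u :=
    (Lp.compMeasurePreservingₗᵢ ℂ (fun x : ℝ => -x) (Measure.measurePreserving_neg (volume : Measure ℝ)) :
      Lp ℂ 2 (volume : Measure ℝ) →ₗᵢ[ℂ] Lp ℂ 2 (volume : Measure ℝ)).continuous
  have hL : Continuous fun u : Lp ℂ 2 (volume : Measure ℝ) =>
      mellinLineL2 (𝓕 (symL2 u) : Lp ℂ 2 (volume : Measure ℝ)) :=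
    mellinLineL2.continuous.comp ((Lp.fourierTransformₗᵢ ℝ ℂ).continuous.comp continuous_symL2)
  have hR' : Continuous fun u : Lp ℂ 2 (volume : Measure ℝ) =>
      Lp.compMeasurePreserving (fun x : ℝ => -x) (Measure.measurePreserving_neg (volume : Measure ℝ))
        (archBoundary • mellinLineL2 (symL2 u) : Lp ℂ 2 (volume : Measure ℝ)) :=
    hR.comp ((continuous_linfty_smul archBoundary).comp (mellinLineL2.continuous.comp continuous_symL2))
  suffices key : ∀ u : Lp ℂ 2 (volume : Measure ℝ),
      mellinLineL2 (𝓕 (symL2 u) : Lp ℂ 2 (volume : Measure ℝ)) =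
        Lp.compMeasurePreserving (fun x : ℝ => -x) (Measure.measurePreserving_neg (volume : Measure ℝ))
          (archBoundary • mellinLineL2 (symL2 u) : Lp ℂ 2 (volume : Measure ℝ)) by
    have := key ξ
    rwa [symL2_of_mem_evenPart hev] at this
  intro u
  refine DenseRange.induction_on
    (p := fun u : Lp ℂ 2 (volume : Measure ℝ) =>
      mellinLineL2 (𝓕 (symL2 u) : Lp ℂ 2 (volume : Measure ℝ)) =
        Lp.compMeasurePreserving (fun x : ℝ => -x) (Measure.measurePreserving_neg (volume : Measure ℝ))
          (archBoundary • mellinLineL2 (symL2 u) : Lp ℂ 2 (volume : Measure ℝ)))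
    (SchwartzMap.denseRange_toLpCLM (F := ℂ) (E := ℝ) (p := 2) (μ := (volume : Measure ℝ))
      ENNReal.ofNat_ne_top) u (isClosed_eq hL hR') ?_
  intro φ
  have hφ : (SchwartzMap.toLpCLM ℝ ℂ 2 (volume : Measure ℝ)) φ = φ.toLp 2 volume := rfl
  rw [hφ, symL2_toLp, SchwartzMap.toLp_fourier_eq]
  set ψ := schwartzEven φ with hψ
  -- both sides as functions of `s`
  refine Lp.ext ?_
  have hneg := (Measure.measurePreserving_neg (volume : Measure ℝ)).quasiMeasurePreserving
  have hM := mellinLineL2_toLp_schwartz ψ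
  have hMF := mellinLineL2_toLp_schwartz (𝓕 ψ)
  have hprod := Lp.coeFn_lpSMul (r := 2) archBoundary (mellinLineL2 (ψ.toLp 2 volume))
  have hJ := coeFn_compNeg (V := ℝ) (F := ℂ)
    (archBoundary • mellinLineL2 (ψ.toLp 2 volume) : Lp ℂ 2 (volume : Measure ℝ))
  have h3 := hneg.ae_eq_comp (hprod.trans (EventuallyEq.mul coeFn_archBoundary hM))
  filter_upwards [hMF, hJ, h3] with s e1 e2 e3
  rw [e1, e2]
  simp only [Function.comp_apply] at e3
  rw [e3, Pi.mul_apply, SchwartzMap.fourier_coe]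
  rw [show (1 / 2 - ((-s : ℝ) : ℂ) * I) = 1 / 2 + s * I by push_cast; ring]
  exact mellin_fourier_critPt_of_even ψ (schwartzEven_neg φ) s

/-- **Proposition 5.5, second half — PROVED**: for an even `ξ ∈ L²(ℝ)` with `𝔽_μ ∘ w`-image `η`, the
Fourier transform `𝓕ξ` vanishes a.e. on `[−1,1]` iff `u_∞η ∈ H²(ℂ_−) = 𝒫L²` (`hardyLeft`), `u_∞ = ρ_∞|_{∂ℂ_−}`
(`archBoundary`) — «the kernel of `𝒫̂₁` is the kernel of `ρ_∞^*Pρ_∞`, which is the kernel of `Pρ_∞`»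
(p0016:L1).  RH-FREE. [cite: ConnesConsani2021QuasiInner, Prop 5.5, proof (arXiv chunk p0016:L1)] -/
theorem fourier_vanishOn_iff_smul_mem_hardyLeft {ξ η : Lp ℂ 2 (volume : Measure ℝ)}
    (hev : ξ ∈ evenPart) (hM : IsMellinLineImage ξ η) :
    (𝓕 ξ : Lp ℂ 2 (volume : Measure ℝ)) ∈ vanishOn 1 ↔
      (archBoundary • η : Lp ℂ 2 (volume : Measure ℝ)) ∈ hardyLeft := by
  have hη : η = mellinLineL2 ξ := eq_mellinLineL2_of_isMellinLineImage hM
  rw [vanishOn_iff_mellinImage_mem_hardyRight (fourier_mem_evenPart hev)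
    (isMellinLineImage_mellinLineL2 _), mellinLineL2_fourier_eq_of_mem_evenPart hev, ← hη,
    compNeg_mem_hardyRight_iff]

end PropFiveFiveSecondHalf

/-- **Proposition 5.5 — PROVED** (discharge of the named fact `prop_5_5`): for every even `ξ ∈ L²(ℝ)` and
its `𝔽_μ ∘ w`-image `η`, `ξ ∈ S(1,1)` iff `η ∈ S(ρ_∞) = ker (ρ_∞)₂₂` — from the two halves
`vanishOn_iff_mellinImage_mem_hardyRight` (`P ↦ 1 − 𝒫`) and `fourier_vanishOn_iff_smul_mem_hardyLeft`
(`ker 𝒫̂₁ ↦ ker 𝒫ρ_∞`, CC 2021 Selecta Lemma 6 via Tate's local functional equation), and the bridge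
`S(1,1) = evenPart ⊓ localSoninSpace`.  RH-FREE.
[cite: ConnesConsani2021QuasiInner, Prop 5.5 (arXiv chunk p0015:L118; proof p0016:L1)] -/
theorem prop_5_5_holds : prop_5_5 := by
  intro ξ η hev hM
  rw [soninSpace_one_one_eq_evenPart_inf, Submodule.mem_inf, mem_localSoninSpace_iff',
    mem_soninSpaceOf_iff, vanishOn_iff_mellinImage_mem_hardyRight hev hM,
    fourier_vanishOn_iff_smul_mem_hardyLeft hev hM]
  exact ⟨fun h => h.2, fun h => ⟨hev, h⟩⟩


/-! ## Theorem 5.3 (i) reduced to Sonin's theorem (`dim S(1,1) = ∞`)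

Printed proof of Theorem 5.3 (i) (§5.4 p0016:L29: «It is enough to prove (ii)»): `S(u(F)) ⊇ D(∅,F)·S(u_∞)`
by (ii), `S(u_∞) = (𝔽_μ ∘ w)(S(1,1))` by Proposition 5.5 with `𝔽_μ ∘ w` unitary, and Sonin's space `S(1,1)` is
infinite dimensional (N. Sonin 1880; «the well-known infinite dimensional Sonin's space», CC 2021 Selecta §1)
— a classical theorem the tree does not have.  PROVED here: the reduction, i.e. Theorem 5.3 (i) from
`¬ FiniteDimensional ℂ (soninSpace 1 1)`, using `prop_5_5_holds`, `thm_5_3_ii_mapsTo_holds`, injectivity of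
`D(∅,F)` and of the Mellin operator `M` on even functions. -/

section ThmFiveThreeOne

open Literature.Analysis.OperatorTheory (lpDilation lpDilation_coeFn quasiMeasurePreserving_smul'
  ae_eq_comp_smul)
open Literature.Analysis.Fourier (coeFn_compNeg)

/-- A.e. statements on `(0,∞)` and on `ℝ` correspond under `v = e^x`. [folklore] -/
private theorem ae_Ioi_iff_ae_comp_exp (P : ℝ → Prop) :
    (∀ᵐ v : ℝ, v ∈ Set.Ioi (0 : ℝ) → P v) ↔ ∀ᵐ x : ℝ, P (Real.exp x) := by
  rw [ae_iff, ae_iff]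
  have hA : {v : ℝ | ¬(v ∈ Set.Ioi (0 : ℝ) → P v)} = Real.exp '' {x : ℝ | ¬P (Real.exp x)} := by
    ext v
    simp only [Set.mem_setOf_eq, Classical.not_imp, Set.mem_image, Set.mem_Ioi]
    constructor
    · rintro ⟨h0, hP⟩
      exact ⟨Real.log v, by rwa [Real.exp_log h0], Real.exp_log h0⟩
    · rintro ⟨x, hP, rfl⟩
      exact ⟨Real.exp_pos x, hP⟩
  have hB : {x : ℝ | ¬P (Real.exp x)} = Real.log '' {v : ℝ | ¬(v ∈ Set.Ioi (0 : ℝ) → P v)} := by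
    ext x
    simp only [Set.mem_setOf_eq, Classical.not_imp, Set.mem_image, Set.mem_Ioi]
    constructor
    · intro hP
      exact ⟨Real.exp x, ⟨Real.exp_pos x, hP⟩, Real.log_exp x⟩
    · rintro ⟨v, ⟨h0, hP⟩, rfl⟩
      rwa [Real.exp_log h0]
  constructor
  · intro h
    rw [hB]
    refine addHaar_image_eq_zero_of_differentiableOn_of_addHaar_eq_zero (μ := volume) ?_ h
    refine Real.differentiableOn_log.mono fun v hv => ?_
    simp only [Set.mem_setOf_eq, Classical.not_imp, Set.mem_Ioi] at hv
    exact hv.1.ne'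
  · intro h
    rw [hA]
    exact addHaar_image_eq_zero_of_differentiableOn_of_addHaar_eq_zero (μ := volume)
      Real.differentiable_exp.differentiableOn h

/-- The Mellin operator `M = 𝔽_μ ∘ w` is injective on even functions (it is `√(2π)`× an isometry on
`L²(0,∞)`). [folklore] -/
private theorem eq_zero_of_mellinLineL2_eq_zero {ξ : Lp ℂ 2 (volume : Measure ℝ)} (hev : ξ ∈ evenPart)
    (h : mellinLineL2 ξ = 0) : ξ = 0 := by
  have h2π : (2 * π : ℝ) ≠ 0 := by positivity
  -- `𝓕(Eξ) = 0`
  have hF : (𝓕 (expPullL2 ξ) : Lp ℂ 2 (volume : Measure ℝ)) = 0 := by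
    refine Lp.ext ?_
    have h0 : ((mellinLineL2 ξ : Lp ℂ 2 (volume : Measure ℝ)) : ℝ → ℂ) =ᵐ[volume] 0 := by
      rw [h]; exact Lp.coeFn_zero ℂ 2 volume
    rw [mellinLineL2_apply] at h0
    have h1 := (lpDilation_coeFn (V := ℝ) (F := ℂ) (p := (2 : ℝ≥0∞)) two_pi_inv_ne_zero
      ENNReal.ofNat_ne_top (𝓕 (expPullL2 ξ) : Lp ℂ 2 (volume : Measure ℝ))).symm.trans h0
    -- transport along `t = (2π)⁻¹ s`
    have h2 := (quasiMeasurePreserving_smul' (V := ℝ) h2π).ae h1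
    filter_upwards [h2, Lp.coeFn_zero ℂ 2 (volume : Measure ℝ)] with t ht h0t
    rw [h0t]
    simp only [smul_eq_mul, Pi.zero_apply] at ht
    rwa [inv_mul_cancel_left₀ h2π] at ht
  have hE : expPullL2 ξ = 0 := by
    have := (Lp.fourierTransformₗᵢ ℝ ℂ).map_eq_zero_iff.mp hF
    exact this
  -- `ξ = 0` a.e. on `(0,∞)`
  have hpos : ∀ᵐ v : ℝ, v ∈ Set.Ioi (0 : ℝ) → (ξ : ℝ → ℂ) v = 0 := by
    rw [ae_Ioi_iff_ae_comp_exp]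
    have h0 : ((expPullL2 ξ : Lp ℂ 2 (volume : Measure ℝ)) : ℝ → ℂ) =ᵐ[volume] 0 := by
      rw [hE]; exact Lp.coeFn_zero ℂ 2 volume
    filter_upwards [h0, coeFn_expPullL2 ξ] with x h1 h2
    rw [h2, Pi.zero_apply] at h1
    exact (mul_eq_zero.mp h1).resolve_left (by exact_mod_cast (Real.exp_pos _).ne')
  -- evenness: `ξ = 0` a.e.
  refine Lp.ext ?_
  have hneg : ∀ᵐ x : ℝ, -x ∈ Set.Ioi (0 : ℝ) → (ξ : ℝ → ℂ) (-x) = 0 :=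
    (Measure.measurePreserving_neg (volume : Measure ℝ)).quasiMeasurePreserving.ae hpos
  have h0 : ∀ᵐ x : ℝ, x ≠ 0 := by
    have : (volume : Measure ℝ) {0} = 0 := measure_singleton 0
    exact measure_eq_zero_iff_ae_notMem.mp this
  filter_upwards [hpos, hneg, mem_evenPart_iff.mp hev, h0, Lp.coeFn_zero ℂ 2 (volume : Measure ℝ)]
    with x h1 h2 h3 h4 h5
  rw [h5, Pi.zero_apply]
  rcases lt_or_gt_of_ne h4 with hlt | hgt
  · rw [← h3]; exact h2 (by rw [Set.mem_Ioi]; linarith)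
  · exact h1 hgt

/-- `u(∅)|_{∂ℂ_−} = u_∞` as elements of `L^∞`. [cite: ConnesConsani2021QuasiInner, §5.2 (arXiv chunk p0015:L99)] -/
theorem placeBoundary_empty : placeBoundary ∅ = archBoundary :=
  Lp.ext ((coeFn_placeBoundary ∅).trans (by rw [placeBoundaryFun_empty]; exact coeFn_archBoundary.symm))

/-- `D(∅)ξ = ξ`. [cite: ConnesConsani2021QuasiInner, Thm 5.3 (ii) (arXiv chunk p0015:L22)] -/
theorem dBoundary_empty_smul (ξ : Lp ℂ 2 (volume : Measure ℝ)) :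
    (dBoundary ∅ • ξ : Lp ℂ 2 (volume : Measure ℝ)) = ξ := by
  refine Lp.ext ?_
  filter_upwards [Lp.coeFn_lpSMul (r := 2) (dBoundary ∅) ξ, coeFn_dBoundary ∅] with s h1 h2
  rw [h1, Pi.smul_apply', h2, dBoundaryFun, Finset.prod_empty, one_smul]

/-- `D(∅,F)·S(u_∞) ⊆ S(u(F))` for every finite set of primes `F` (Thm 5.3 (ii) for `∅ ⊊ F`; trivial for `F = ∅`).
[cite: ConnesConsani2021QuasiInner, Thm 5.3 (ii) (arXiv chunk p0015:L22)] -/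
theorem dBoundary_smul_mem_soninSpaceOf_of_mem_arch (F : Finset Nat.Primes) {η : Lp ℂ 2 (volume : Measure ℝ)}
    (hη : η ∈ soninSpaceOf archBoundary) :
    (dBoundary F • η : Lp ℂ 2 (volume : Measure ℝ)) ∈ soninSpaceOf (placeBoundary F) := by
  rcases F.eq_empty_or_nonempty with hF | hF
  · rw [hF, dBoundary_empty_smul, placeBoundary_empty]; exact hη
  · rw [← placeBoundary_empty] at hη
    have h := thm_5_3_ii_mapsTo_holds ∅ F
      (Finset.ssubset_iff_subset_ne.mpr ⟨Finset.empty_subset F, fun h => hF.ne_empty h.symm⟩) η hη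
    rwa [Finset.sdiff_empty] at h

/-- **`S(1,1) ↪ S(u(F))` linearly** (`ξ ↦ D(∅,F)·𝔽_μwξ`): the injection behind Theorem 5.3 (i).
[cite: ConnesConsani2021QuasiInner, Thm 5.3, proof §5.4 (arXiv chunk p0016:L29)] -/
theorem exists_linearMap_soninSpace_injective (F : Finset Nat.Primes) :
    ∃ Φ : soninSpace 1 1 →ₗ[ℂ] soninSpaceOf (placeBoundary F), Function.Injective Φ := by
  have hmem : ∀ ξ : Lp ℂ 2 (volume : Measure ℝ), ξ ∈ soninSpace 1 1 →
      (dBoundary F • mellinLineL2 ξ : Lp ℂ 2 (volume : Measure ℝ)) ∈ soninSpaceOf (placeBoundary F) := by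
    intro ξ hξ
    have hev : ξ ∈ evenPart := by
      rw [soninSpace_one_one_eq_evenPart_inf] at hξ; exact hξ.1
    exact dBoundary_smul_mem_soninSpaceOf_of_mem_arch F
      ((prop_5_5_holds ξ _ hev (isMellinLineImage_mellinLineL2 ξ)).mp hξ)
  refine ⟨{ toFun := fun ξ => ⟨dBoundary F • mellinLineL2 (ξ : Lp ℂ 2 (volume : Measure ℝ)), hmem ξ ξ.2⟩
            map_add' := fun ξ ζ => by
              apply Subtype.ext
              simp only [Submodule.coe_add, map_add, Lp.add_smul]
            map_smul' := fun c ξ => by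
              apply Subtype.ext
              simp only [Submodule.coe_smul, map_smul, RingHom.id_apply, Lp.smul_comm] }, ?_⟩
  intro ξ ζ h
  apply Subtype.ext
  have h' : (dBoundary F • mellinLineL2 (ξ : Lp ℂ 2 (volume : Measure ℝ)) : Lp ℂ 2 (volume : Measure ℝ)) =
      dBoundary F • mellinLineL2 (ζ : Lp ℂ 2 (volume : Measure ℝ)) := congrArg Subtype.val h
  have h2 : mellinLineL2 ((ξ : Lp ℂ 2 (volume : Measure ℝ)) - ζ) = 0 := by
    rw [map_sub, sub_eq_zero]; exact dBoundary_smul_injective F h'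
  have hev : ((ξ : Lp ℂ 2 (volume : Measure ℝ)) - ζ) ∈ evenPart := by
    have hsub : ((ξ : Lp ℂ 2 (volume : Measure ℝ)) - (ζ : Lp ℂ 2 (volume : Measure ℝ))) ∈
        evenPart ⊓ localSoninSpace :=
      soninSpace_one_one_eq_evenPart_inf ▸ (soninSpace 1 1).sub_mem ξ.2 ζ.2
    exact hsub.1
  exact sub_eq_zero.mp (eq_zero_of_mellinLineL2_eq_zero hev h2)

/-- **Theorem 5.3 (i) from Sonin's theorem** — PROVED REDUCTION: if Sonin's space `S(1,1)` is infinite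
dimensional (N. Sonin 1880, classical; not in the tree), then every `S(u(F))` is infinite dimensional
(printed proof §5.4: (ii) + Prop. 5.5).  RH-FREE.
[cite: ConnesConsani2021QuasiInner, Thm 5.3 (i) (arXiv chunk p0015:L22; proof §5.4 p0016:L29)] -/
theorem thm_5_3_i_of_not_finiteDimensional_soninSpace
    (hS : ¬ FiniteDimensional ℂ (soninSpace 1 1)) : thm_5_3_i := by
  intro F hF
  obtain ⟨Φ, hΦ⟩ := exists_linearMap_soninSpace_injective F
  exact hS (FiniteDimensional.of_injective Φ hΦ)

end ThmFiveThreeOne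


/-! ## `𝔽_μ ∘ w` on `L²(ℝ)`: public API for `IsMellinLineImage` (existence, uniqueness, linearity,
injectivity on even functions) — so that `prop_5_5_holds` can be applied to any even `ξ`. -/

section MellinLineImageAPI

/-- Every `ξ ∈ L²(ℝ)` HAS a `𝔽_μ ∘ w`-image (`G_ξ = e^{x/2}ξ(e^x) ∈ L²` by the substitution `v = e^x`,
then `η = (𝓕G_ξ)(·/2π)`). [cite: ConnesConsani2021QuasiInner, §5.2 eqs. (5.1)–(5.2) (arXiv chunk p0015:L104)] -/
theorem exists_isMellinLineImage (ξ : Lp ℂ 2 (volume : Measure ℝ)) : ∃ η, IsMellinLineImage ξ η :=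
  ⟨_, isMellinLineImage_mellinLineL2 ξ⟩

/-- The `𝔽_μ ∘ w`-image is unique. [cite: ConnesConsani2021QuasiInner, §5.2 eqs. (5.1)–(5.2) (arXiv chunk p0015:L104)] -/
theorem IsMellinLineImage.unique {ξ η₁ η₂ : Lp ℂ 2 (volume : Measure ℝ)} (h₁ : IsMellinLineImage ξ η₁)
    (h₂ : IsMellinLineImage ξ η₂) : η₁ = η₂ :=
  (eq_mellinLineL2_of_isMellinLineImage h₁).trans (eq_mellinLineL2_of_isMellinLineImage h₂).symm

/-- `𝔽_μ ∘ w` is additive. [cite: ConnesConsani2021QuasiInner, §5.2 eqs. (5.1)–(5.2) (arXiv chunk p0015:L104)] -/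
theorem IsMellinLineImage.add {ξ₁ ξ₂ η₁ η₂ : Lp ℂ 2 (volume : Measure ℝ)} (h₁ : IsMellinLineImage ξ₁ η₁)
    (h₂ : IsMellinLineImage ξ₂ η₂) : IsMellinLineImage (ξ₁ + ξ₂) (η₁ + η₂) := by
  rw [eq_mellinLineL2_of_isMellinLineImage h₁, eq_mellinLineL2_of_isMellinLineImage h₂, ← map_add]
  exact isMellinLineImage_mellinLineL2 _

/-- `𝔽_μ ∘ w` is homogeneous. [cite: ConnesConsani2021QuasiInner, §5.2 eqs. (5.1)–(5.2) (arXiv chunk p0015:L104)] -/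
theorem IsMellinLineImage.smul {ξ η : Lp ℂ 2 (volume : Measure ℝ)} (h : IsMellinLineImage ξ η) (c : ℂ) :
    IsMellinLineImage (c • ξ) (c • η) := by
  rw [eq_mellinLineL2_of_isMellinLineImage h, ← map_smul]
  exact isMellinLineImage_mellinLineL2 _

/-- `𝔽_μ ∘ w` is injective on even functions: the image of an even `ξ` vanishes iff `ξ = 0`.
[cite: ConnesConsani2021QuasiInner, §5.2 eqs. (5.1)–(5.2) (arXiv chunk p0015:L104)] -/
theorem IsMellinLineImage.eq_zero_iff {ξ η : Lp ℂ 2 (volume : Measure ℝ)} (hev : ξ ∈ evenPart)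
    (h : IsMellinLineImage ξ η) : η = 0 ↔ ξ = 0 := by
  rw [eq_mellinLineL2_of_isMellinLineImage h]
  refine ⟨eq_zero_of_mellinLineL2_eq_zero hev, fun h0 => by rw [h0, map_zero]⟩

/-- The `𝔽_μ ∘ w`-image of the Fourier transform of an even `ξ` is `J(u_∞·η)`, `(Jf)(s) = f(−s)`:
CC 2021 Selecta Lemma 6 (`𝔽_{e_ℝ}^w = I ∘ u_∞^g`) on the Mellin line, in `L²`.
[cite: ConnesConsani2021QuasiInner, Prop 5.5, proof (arXiv chunk p0016:L1)] -/
theorem IsMellinLineImage.fourier {ξ η : Lp ℂ 2 (volume : Measure ℝ)} (hev : ξ ∈ evenPart)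
    (h : IsMellinLineImage ξ η) :
    IsMellinLineImage (𝓕 ξ : Lp ℂ 2 (volume : Measure ℝ))
      (Lp.compMeasurePreserving (fun x : ℝ => -x) (Measure.measurePreserving_neg (volume : Measure ℝ))
        (archBoundary • η : Lp ℂ 2 (volume : Measure ℝ))) := by
  rw [eq_mellinLineL2_of_isMellinLineImage h, ← mellinLineL2_fourier_eq_of_mem_evenPart hev]
  exact isMellinLineImage_mellinLineL2 _

end MellinLineImageAPI


end QuasiInner

end Literature.NumberTheory.ConnesConsani2021

end
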